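import Summits.QuantumFields.YangMills.Theses.LuscherReduction
import Summits.QuantumFields.YangMills.Theorems.FemtoTransferGapBounds
import Summits.QuantumFields.YangMills.Theorems.FemtoTransferGapPositivity
import Summits.QuantumFields.YangMills.Theorems.FemtoTransferGapRungW1up
import Summits.QuantumFields.YangMills.Theorems.LuscherReductionOneSiteLevelsVariational
import Summits.QuantumFields.YangMills.Theorems.FemtoTransferGapSlabRayleigh
import Literature.Analysis.OperatorTheory.YangMillsMatrixModelDiscreteness
import Literature.Analysis.OperatorTheory.ClusterKatoTempleBound
import Summits.QuantumFields.YangMills.Theorems.LuscherReductionRunningReductionKTDoorR3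
import Summits.QuantumFields.YangMills.Cruxes.RunningReduction.Lines.birth
import Literature.Analysis.Asymptotics.LaplaceAtomsFromDyadicRatios
import Summits.QuantumFields.YangMills.Theorems.FemtoTransferGapLevels
import Summits.QuantumFields.YangMills.Theorems.LuscherReductionRunningReductionKTRCalibration
import Summits.QuantumFields.YangMills.Theorems.LuscherReductionRunningReductionTraceFormulaDefs
import Summits.QuantumFields.YangMills.Theorems.LuscherReductionRunningReductionLevelGapSummable
import Summits.QuantumFields.YangMills.Theorems.LuscherReductionOneSiteLevelsClosed

/-! # REV 8 NOTE (owner ym-beyond-p1 g19, 2026-08-27T07:xxZ): rev 7 ∘ THREE LANDINGS, no statement text changed —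
(1) ★ the route's crux ONE `OneSiteLevels` (stmt-QuantumFields-20007) is CLOSED (`FemtoTransferGap.oneSiteLevels_proof`, `Theorems/LuscherReductionOneSiteLevelsClosed.lean`,
07:09:23Z): the two ONE-derived registered stubs are DISCHARGED in-file — `KT.stub_oneSiteLowerCoarse := stub_oneSiteLowerCoarse_of_ONE oneSiteLevels_proof`,
`TT.stub_oneSiteTraceLimit := stub_oneSiteTraceLimit_of_ONE oneSiteLevels_proof stub_oneSiteTail` — and every `…_ONE` composition gets its unconditional twin:
`KT.RunningReduction_of_KT8 : 3a′ → 3b′ → dressedRitz → RED`, `KT.RunningReduction_of_explicit8 : explicitNoIntruder → dressedRitz → RED`,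
`TT.RunningReduction_of_trace8 : traceFormula → twistedTraceScaling → oneSiteTail → KT.dressedRitz → RED` (THE TT DOOR, 4 stubs, no ONE), `TT.coarseLevels_of_stubs8`;
(2) PART 5 §1 trace objects RE-POINTED at the tree module `Theorems/LuscherReductionRunningReductionTraceFormulaDefs.lean` (ym-infvol-p1 g3, 06:53Z; defs VERBATIM = rev 6/7 §1)
by `export FemtoTransferGap.TT (centreElem twist3 gaugeMeasure physAvg physTraceSucc physTrace physKernel)` — so `Stmt.stub_traceFormula` / `Stmt.stub_twistedTraceScaling` are now
LITERALLY over tree constants (a Theorems proof of the body closes the stub by `exact`); `traceRatio`, `femtoSteps`, `seqRatio`, `hTraceRatio`, `levelMoment`, `levelRatio` stay here;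
(3) PART 5 §3b `LevelGapSummable` DISCHARGED BY NAME from the tree (`FemtoTransferGap.LGS.levelGapSummable_all`, p505266 ym-infvol-p1 g3; owner farm check `lgs-check-light.lean` rc 0):
the in-file `TT.LGS` section is removed.  REGISTERED STUBS (7): KT door {`stub_coarseHandoverUpper2` XL, `stub_coarseNoIntruderAt2` L, `stub_explicitNoIntruder` XL} ·
shared {`KT.stub_dressedRitz` XL/L} · TT door {`stub_traceFormula` M, `stub_twistedTraceScaling` XL, `stub_oneSiteTail` M}.  Card: `p1-g19-files/Lines-KTR-r8.md`. -/

/-! # REV 7 NOTE (owner ym-beyond-p1 g18, 2026-08-27, same session as revs 5–6): rev 6 + PART 8 «OST»: the registered one-site stub `TT.stub_oneSiteTraceLimit` REDUCED to the route's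
crux ONE — `OST.oneSiteTraceLimit_of_ONE : OneSiteLevels → LevelGapSummable → OneSiteTail → OneSiteTraceLimit` PROVED (termwise limits from ONE with explicit thresholds via
`bareLambda_le_of_le`, tails from the NEW registered stub `stub_oneSiteTail` (M: B-uniform tail bound `Σ_k x_{k+K}(B)^T ≤ ε` for `s ≤ 2Tλ_b`) and from `LevelGapSummable`
(`tendsto_sum_nat_add`), ratio by `Inv.ratio_sub_ratio_le`); rev-7 composition `RunningReduction_of_trace7_ONE : TF → TTS → stub_oneSiteTail → KT.stub_dressedRitz → ONE → RED`.
9 sorried stubs registered (rev 6's eight + `stub_oneSiteTail`); `stub_oneSiteTraceLimit` stays registered for a direct proof.  Card: `p1-g18-files/Lines-KTR-r7.md`. -/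

/-! # REV 6 NOTE (owner ym-beyond-p1 g18, 2026-08-27, same session as rev 5): rev 5 with the registered stub `TT.stub_traceInversion` PROVED in-file — new PART 6 «INV»
(`TT.Inv.traceInversion : TraceInversion`, kernel-closed, ≈ 600 lines of real analysis over the landed Tauberian theorem `Literature…LaplaceAtoms.laplaceAtoms`):
regularised running-max femto atoms `ã_j = max_{i≤j} b_i`, `b_j = max((L/λ)log(λ₀/λ_j), δj)` on positive levels / `j/δ` on zero levels (Laplace-summable for every
`s > 0`, monotone, `ã_0 = 0`); summed discrepancy `|Σ_j e^{−(T/c)ã_j} − m(T)| ≤ Σ_j min(x_j², Sδj) + Σ_{j≥1} e^{−σ_min j/δ}` made `≤ 1/(n+1)` by a per-lattice choice of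
`δ_n` (dominated convergence); currency bridge `traceRatio = levelRatio` under `TraceFormula` (`T ≥ 2`, `β ≥ 1`); one-site limit at each dyadic grid time
`q = ⌈s2^m⌉/2^m` with the exact tolerance `femtoSteps_mul_sub_le`; diagonal selection over `m` + continuity of `r_𝔥` (Tannery) ⇒ hypothesis (hr) of
`laplaceAtoms`; the violation of `CoarseLevels` at level `k` is `η/2`-far in atom currency (`far_of_violation`) — contradiction.  PART 7: `stub_traceInversion :=
Inv.traceInversion` and the 5-ary rev-6 compositions `RunningReduction_of_trace6` (TF → TTS → OSTL → KT.dressedRitz → KT.oneSiteLowerCoarse → RED),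
`RunningReduction_of_trace6_ONE`, `coarseLevels_of_stubs6`.  8 sorried stubs remain (KT: coarseHandoverUpper2, coarseNoIntruderAt2, dressedRitz, oneSiteLowerCoarse ⇐ ONE,
explicitNoIntruder; TT: traceFormula, twistedTraceScaling, oneSiteTraceLimit).  One extra import (`…KTRCalibration`, for `levelValue_antitone`).
Card: `p1-g18-files/Lines-KTR-r6.md`. -/

/-! # REV 5 NOTE (owner ym-beyond-p1 g18, 2026-08-27, one hour after rev 4): rev 4 with the registered stub `TT.stub_levelGapSummable` PROVED in-file (PART 5 §3b:
Haar scaling in `ℝ⁹` ⇒ `N(E) ≤ 8·48⁹(E+1)¹⁸` ⇒ `μ_{k+1} ≥ ((k+1)/(16·48⁹))^{1/18} − 1` ⇒ `e^{−sΔ_k} ≤ C(s)/(k+1)²`); the trace composition is now 6-ary; 9 sorried stubs remain.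
# REV 4 NOTE: rev 3 VERBATIM (parts 1–4, compositions `KT.RunningReduction_of` = 3a′ → 3b′ → dressedRitz →
oneSiteLowerCoarse → RED **of record**, and `KT.RunningReduction_of_explicit`) + PART 5 «TT» (twisted trace): the THIRD typed currency for the exclusive
half — partition functions — with five new registered stubs `TT.stub_traceFormula` (M), `TT.stub_twistedTraceScaling` (XL, RG), `TT.stub_levelGapSummable`
(S/M, provable now), `TT.stub_oneSiteTraceLimit` (M/L), `TT.stub_traceInversion` (M) and the kernel-checked third composition `TT.RunningReduction_of_trace`.
One registry skeleton per crux ⇒ all three doors live in this one file (10 stubs = 3 alternative compositions sharing `stub_dressedRitz`/`stub_oneSiteLowerCoarse`;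
each composition uses ≤ 7).  Card: `p1-g18-files/Lines-KTR-r4.md` (= r3 card + «TT» card). -/

/-!
# Crux RED `RunningReduction` — line «KTR» rev 3 (skeleton of record): rev 2 UNCHANGED (parts 1–3, four stubs, composition `RunningReduction_of`)
# + part 4 «EXPLICIT»: the owner-audited alternative to the hand-over pair 3a′/3b′ — ONE XL stub `stub_explicitNoIntruder` with a PROVED glue onto stub 3

REV 3 (owner ym-beyond-p1 g17, 2026-08-27; companion memo `pub/ym-beyond/p1-g17-files/OWNER-MEMO-3a-g17.md`).  Parts 1–3 below are BYTE-IDENTICAL to rev 2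
(sha16 3cffefe53154727e): the four registered stubs `stub_coarseHandoverUpper2` (3a′) · `stub_coarseNoIntruderAt2` (3b′) · `stub_dressedRitz` · `stub_oneSiteLowerCoarse`
keep their names, statements and composition.  NEW part 4 (`namespace …KT`, appended at the end of the file) records the owner's audit of the g16 cut of 3a′ by
comparison maps — two kernel-checked LOCATED DEFECTS (`normLoss_forced`: a contractive comparison map with a constant shared between domination and ground
refinement is forced to be an `e^{-2ελ}`-isometry on the fine vacuum, which block averaging violates by bulk factors; `mixture_witness`: non-uniform norm loss
breaks any linear vacuum-normalised domination) — and files the typed NON-COSTUME alternative: the FIFTH registered stub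
`stub_explicitNoIntruder : ∀ k, ExplicitNoIntruder k` (XL: long-time vacuum-normalised no-intruder bound whose k constraint states are dressed flowed Polyakov
lifts `dressedLift β t m u_i = flowLift t u_i · slabGround β m` of k ONE-SITE functions — tree objects of `FemtoTransferGapSlab`), the PROVED Cauchy–Schwarz
log-convexity of transfer moments (`moment_sq_le`, `moment_one_pow_le`: unit time ↔ dyadic long time), the PROVED glue
`coarseNoIntruder_of_explicit : Stmt.stub_explicitNoIntruder → Derived.coarseNoIntruder` (KT's stub 3 WITHOUT the coarse lattice), and the second
composition `RunningReduction_of_explicit : stub_explicitNoIntruder → stub_dressedRitz → stub_oneSiteLowerCoarse → RED` (+ `_ONE`).  So stub 3 now has TWO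
registered ways in: {3a′ + 3b′} (hand-over at `L0 = 2`) or {explicit}.  Sorries ONLY inside the five `stub_*`.  REGISTERED STUBS (5): the four of rev 2 +
`stub_explicitNoIntruder` (XL).  HONEST FRAMING unchanged: femto rung R2b1 only.

REV 2 HEADER (kept verbatim):
# Crux RED `RunningReduction` — line «KTR» rev 2 (skeleton of record): «KT» rev 3 (RESIDUAL-GRAM repair of `DressedRitz`/`KatoTempleDoor`)
# with the door and the Ritz basics DISCHARGED BY TREE THEOREMS and stub 3 split by the hand-over seam

Owner-built (ym-beyond-p1 g16; rev 1 900de0ee 02:08Z, rev 2 02:12Z = rev 1 with part 2 replaced by the TREE module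
`Theorems/LuscherReductionRunningReductionKTDoorR3.lean` p486020, sha16 b41e486a, landed by ym-infvol-p2 g3 — cite, don't restate) for `stmt-QuantumFields-19978`
(route-QuantumFields-LuscherReduction crux RED).  SUPERSEDES «KTH»
(`Lines-KTH.lean` 54ef160d, registered 02:01Z) and «KT» (`Lines-KT.lean` abb17db2): both carried the DEFECT located by planner ym-cruxidea-19978-1 g3
(evidence on 19978 01:50Z, `Lines-KT-r3.lean` header): `DressedRitz` clause (ii) bounded the TOTAL two-step variance on the whole span by `C(λ³/L²)m₀²`,
which the in-span spread `(m₀−m₁)²/4 ≍ m₀²Δ₁²λ²/(4L²)` of any two Ritz vectors makes unsatisfiable for every `k` beyond the ground multiplet — so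
`stub_dressedRitz` (abb17db2 / 54ef160d) was refutable from ONE and those compositions were vacuous for such `k`.  The door THEOREM was true but unusable
at that `ϱ`.  REPAIR (ideator-1's rev 3, adopted here verbatim): witnesses are `l2`-orthonormal `qform`-diagonal antitone physical families, clause (ii′) is
the RESIDUAL Gram bound `‖Σ c_i (Kφ_i − m_iφ_i)‖² ≤ C(λ³/L²)m₀² Σ c_i²` (only leakage OUT of the span counts; exact eigenvectors have residual 0), the door
is the concrete instance of lit g8's `clusterKatoTemple_op`, `RitzBasics` is `m_j ≤ λ_j` for diagonal families; `ritzValue`/`qform2` disappear.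
THIS FILE = two kernel-checked parts concatenated (+ the tree import for the door):
1. `namespace …KTCoarseHandover` — VERBATIM body of `pub/ym-beyond/ym-cruxidea-19978-2/kt-coarse-handover.lean` (sha16 a9ba2e33047e1039, planner
   ym-cruxidea-19978-2 g3, card `Ideas/handover-split.md` rev 3; sorry-free): `MatchedCoupling` + proof, 3a′ `CoarseHandoverUpper L0`, 3b′
   `CoarseNoIntruderAt L0`, `CoarseLowerAt L0`, seam `coarseNoIntruder_of_handover(_two)`, converse, calibrations.
2. (no longer pasted) the rev-3 door and Ritz basics are the TREE theorems `…Theorems.FemtoTransferGap.KTDoorR3.katoTempleDoorR3` / `ritzBasicsR3`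
   (p486020 = ideator-1's `KTDoorR3.lean` ae2d37eb filed by ym-infvol-p2 g3 with the statements inlined; over tree `…KTPhysSpace|KTRitzDiag|RitzBasics.lean`
   and lit g8's `ClusterKatoTempleBound`).
3. `namespace …KT` — `pub/ym-beyond/ym-cruxidea-19978-1/Lines-KT-r3.lean` (sha16 354dc29ed6fa4da7) from its `set_option` line on, with:
   `Stmt.stub_katoTempleDoor`/`Stmt.stub_ritzBasics` → `Proved.katoTempleDoor`/`Proved.ritzBasics` discharged by the tree theorems (`katoTempleDoor_holds`/`ritzBasics_holds`,
   definitional match of the verbatim statement texts); `Stmt.stub_coarseNoIntruder` → `Derived.coarseNoIntruder`, derived from the two NEW registered stubs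
   `stub_coarseHandoverUpper2` (3a′, XL) and `stub_coarseNoIntruderAt2` (3b′, L, finite-dimensional) by `coarseNoIntruder_of_stubs` (part 1's seam at
   `L0 = 2`); r3's composition renamed `RunningReduction_of_KT` (conclusion spelled `KTGoal := RED`); the NEW composition
   `RunningReduction_of : stub_coarseHandoverUpper2 → stub_coarseNoIntruderAt2 → stub_dressedRitz → stub_oneSiteLowerCoarse → RunningReduction` (+ `_of_ONE`).
REGISTERED STUBS (4): `stub_coarseHandoverUpper2` (XL), `stub_coarseNoIntruderAt2` (L), `stub_dressedRitz` (XL/L, rev-3 residual form), `stub_oneSiteLowerCoarse`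
(⇐ ONE, proved from ONE in-file by `stub_oneSiteLowerCoarse_of_ONE`).  Sorries ONLY inside these four.
SATISFIABILITY CHECK OF THE REPAIRED (ii′) (owner): for exact eigenvectors the residuals vanish, so (ii′) is implied by RED ∧ (spectral layer) and is a
statement about leakage out of the dressed span only; the door then yields `λ_j ≤ m_j + ϱ/(m_k − θ)` with `ϱ/(gap) ≍ (λ³m₀²/L²)/(m₀gλ/L) ≍ λ²m₀/L` =
RED's precision, the in-span spread being absorbed by `m_k − θ`.
HONEST FRAMING: femto rung R2b1 (`FemtoGapOfRecord` via RED ∧ ONE) only — nothing here bears on infinite volume, the continuum limit or the Clay mass gap;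
the XL stubs 3a′ and `stub_dressedRitz` carry the weight.
-/

noncomputable section

namespace Summit.QuantumFields.YangMills.Cruxes.RunningReduction.KTCoarseHandover

open MeasureTheory Filter Topology Real
open Literature.MathematicalPhysics.QuantumFieldTheory
open Literature.MathematicalPhysics.QuantumLattice
open Literature.Analysis.OperatorTheory.YMMatrixModel
open Summit.QuantumFields.YangMills.Theorems.FemtoTransferGap
open Summit.QuantumFields.YangMills.Cruxes.RunningReduction.Birth (FixedLatticeReduction)

/-! ## The matching of two-loop labels (support, PROVED) and the fixed-lattice restriction of tree `FixedLatticeReduction` -/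

/-- **`MatchedCoupling L0` (support, S)**: every fine window point `(L,β)` has a coarse partner `β' ≥ 1` with the same two-loop label,
`λ(β',L0) = λ(β,L)`, once `lam` is small.  Proof sketch: `β ↦ invRunningCoupling β L0 = β/2 − 2b₀ log L0 + (b₁/b₀) log(2b₀/β)` is continuous and
increasing on `[1,∞)` with limit `+∞`, so `β ↦ λ(β,L0)` is continuous on `{invRunningCoupling > 0}` and decreases to `0`: IVT. -/
def MatchedCoupling (L0 : ℕ) : Prop :=
  ∃ lamM : ℝ, 0 < lamM ∧ ∀ lam : ℝ, 0 < lam → lam ≤ lamM →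
    ∀ (L : ℕ) [NeZero L] (β : ℝ), InFemtoWindow lam β L → ∃ β' : ℝ, 1 ≤ β' ∧ luscherLambda β' L0 = luscherLambda β L


/-- **BOTTOM = `FixedLatticeReductionAt L0` (crux of Card C, finite-dimensional)**: tree `Birth.FixedLatticeReduction` at the single lattice size
`L0` — spectral Born–Oppenheimer for the Kogut–Susskind-type transfer operator on the FIXED compact manifold `SU(2)^{3L0³}` as `β → ∞`. -/
def FixedLatticeReductionAt (L0 : ℕ) [NeZero L0] : Prop :=
  ∀ k : ℕ, ∃ C lam0 : ℝ, 0 < lam0 ∧ ∀ lam : ℝ, 0 < lam → lam ≤ lam0 → ∀ β : ℝ, InFemtoWindow lam β L0 →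
    levelValue su2Rep L0 β k * levelValue su2Rep 1 (oneSiteCoupling β L0) 0 ≤
        Real.exp (C * luscherLambda β L0 ^ 2 / L0) * (levelValue su2Rep 1 (oneSiteCoupling β L0) k * levelValue su2Rep L0 β 0) ∧
      levelValue su2Rep 1 (oneSiteCoupling β L0) k * levelValue su2Rep L0 β 0 ≤
        Real.exp (C * luscherLambda β L0 ^ 2 / L0) * (levelValue su2Rep L0 β k * levelValue su2Rep 1 (oneSiteCoupling β L0) 0)

theorem fixedLatticeReductionAt_of_fixedLatticeReduction (h : FixedLatticeReduction) (L0 : ℕ) [NeZero L0] :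
    FixedLatticeReductionAt L0 := fun k => h L0 k

/-! ### `MatchedCoupling L0` HOLDS (proved): IVT on the explicit two-loop label -/

theorem b0_pos : 0 < b0 := by unfold b0; positivity
theorem b1_pos : 0 < b1 := by unfold b1; positivity

/-- `b₁/(2b₀²) = 51/121` (the docstring of `b1`). -/
theorem b1_div_two_b0_sq : b1 / (2 * b0 ^ 2) = 51 / 121 := by
  unfold b0 b1
  have hπ : (π : ℝ) ≠ 0 := Real.pi_ne_zero
  field_simp
  ring

/-- Linear lower bound `1/ḡ²(β, L0) ≥ (19/242)·β − 2b₀·log L0` for `β > 0` (from `log x ≤ x − 1`). -/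
theorem invRunningCoupling_ge {β : ℝ} (hβ : 0 < β) (L0 : ℕ) :
    19 / 242 * β - 2 * b0 * Real.log (L0 : ℝ) ≤ invRunningCoupling β L0 := by
  have hb0 := b0_pos
  have hb1 := b1_pos
  have hb0ne : b0 ≠ 0 := hb0.ne'
  set t := Real.log (2 * b0 / β) with ht
  have hlog : 1 - β / (2 * b0) ≤ t := by
    have hx : 0 < β / (2 * b0) := div_pos hβ (mul_pos two_pos hb0)
    have h1 := Real.log_le_sub_one_of_pos hx
    have h2 : Real.log (2 * b0 / β) = -Real.log (β / (2 * b0)) := by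
      rw [← Real.log_inv, inv_div]
    rw [ht, h2]; linarith
  have hid : invRunningCoupling β L0 = -2 * b0 * Real.log (L0 : ℝ) + β / 2 + (b1 / b0) * t := by
    unfold invRunningCoupling sizeLog; rw [← ht]; field_simp; ring
  have hc : (b1 / b0) * (1 - β / (2 * b0)) ≤ (b1 / b0) * t := mul_le_mul_of_nonneg_left hlog (div_pos hb1 hb0).le
  have hc2 : (b1 / b0) * (1 - β / (2 * b0)) = b1 / b0 - (b1 / (2 * b0 ^ 2)) * β := by field_simp
  rw [hc2, b1_div_two_b0_sq] at hc
  have hpos : 0 < b1 / b0 := div_pos hb1 hb0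
  rw [hid]
  linarith

/-- **`MatchedCoupling L0` (proved)**: the coarse partner `β' ≥ 1` with `λ(β',L0) = λ(β,L)` exists once `lam ≤ λ(β₁,L0)/2`,
`β₁ = (242/19)(2b₀ log L0 + 1) + 1`; by the intermediate value theorem for `β ↦ 1/ḡ²(β,L0)` on `[β₁, β₁ + (242/19)λ⁻³]`. -/
theorem matchedCoupling (L0 : ℕ) [NeZero L0] : MatchedCoupling L0 := by
  have hb0 := b0_pos
  have hlogL : 0 ≤ Real.log (L0 : ℝ) := Real.log_nonneg (by exact_mod_cast NeZero.one_le)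
  have hbl : 0 ≤ 2 * b0 * Real.log (L0 : ℝ) := mul_nonneg (mul_nonneg two_pos.le hb0.le) hlogL
  set f : ℝ → ℝ := fun β => invRunningCoupling β L0 with hf
  set β₁ : ℝ := 242 / 19 * (2 * b0 * Real.log (L0 : ℝ) + 1) + 1 with hβ₁
  have hβ₁1 : 1 ≤ β₁ := by rw [hβ₁]; nlinarith
  have hβ₁pos : 0 < β₁ := lt_of_lt_of_le one_pos hβ₁1
  have hf₁ : 1 ≤ f β₁ := by
    have h1 := invRunningCoupling_ge hβ₁pos L0
    have h2 : 19 / 242 * β₁ - 2 * b0 * Real.log (L0 : ℝ) = 1 + 19 / 242 := by rw [hβ₁]; ring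
    show 1 ≤ invRunningCoupling β₁ L0
    linarith
  have hf₁pos : 0 < f β₁ := by linarith
  have hlam₁ : luscherLambda β₁ L0 = (f β₁) ^ (-(1 : ℝ) / 3) := by
    show (max (invRunningCoupling β₁ L0) 0) ^ (-(1 : ℝ) / 3) = (invRunningCoupling β₁ L0) ^ (-(1 : ℝ) / 3)
    rw [max_eq_left hf₁pos.le]
  have hl₁pos : 0 < luscherLambda β₁ L0 := by rw [hlam₁]; exact Real.rpow_pos_of_pos hf₁pos _
  refine ⟨luscherLambda β₁ L0 / 2, by positivity, ?_⟩
  intro lam hlam hle L _ β hw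
  set v : ℝ := luscherLambda β L with hv
  have hvpos : 0 < v := luscherLambda_pos_of_window hlam hw
  have hvle : v ≤ luscherLambda β₁ L0 := by have := hw.2.2; linarith
  set y : ℝ := (v ^ 3)⁻¹ with hy
  have hypos : 0 < y := by positivity
  -- f β₁ ≤ y, i.e. v ≤ λ(β₁, L0)
  have hf₁y : f β₁ ≤ y := by
    rw [hlam₁] at hvle
    have h3 : v ^ 3 ≤ ((f β₁) ^ (-(1 : ℝ) / 3)) ^ 3 := by gcongr
    have h4 : ((f β₁) ^ (-(1 : ℝ) / 3)) ^ 3 = (f β₁)⁻¹ := by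
      rw [← Real.rpow_natCast, ← Real.rpow_mul hf₁pos.le]
      norm_num [Real.rpow_neg_one]
    rw [h4] at h3
    exact (le_inv_comm₀ (by positivity) hf₁pos).mp h3
  -- the upper point
  set β₂ : ℝ := β₁ + 242 / 19 * y with hβ₂
  have h12 : β₁ ≤ β₂ := by rw [hβ₂]; linarith
  have hf₂ : y ≤ f β₂ := by
    have h1 := invRunningCoupling_ge (lt_of_lt_of_le hβ₁pos h12) L0
    have h2 : 19 / 242 * β₂ - 2 * b0 * Real.log (L0 : ℝ) = y + 1 + 19 / 242 := by rw [hβ₂, hβ₁]; ring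
    show y ≤ invRunningCoupling β₂ L0
    linarith
  -- continuity of `f` on `[β₁, β₂]`
  have hne : ∀ x ∈ Set.Icc β₁ β₂, x ≠ 0 := fun x hx => (lt_of_lt_of_le hβ₁pos hx.1).ne'
  have hcont : ContinuousOn f (Set.Icc β₁ β₂) := by
    show ContinuousOn (fun β : ℝ => invRunningCoupling β L0) (Set.Icc β₁ β₂)
    unfold invRunningCoupling sizeLog
    apply ContinuousOn.mul continuousOn_const
    apply ContinuousOn.sub
    · exact ContinuousOn.sub continuousOn_const (continuousOn_id.div_const _)
    · apply ContinuousOn.mul continuousOn_const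
      apply ContinuousOn.log
      · exact continuousOn_const.div continuousOn_id hne
      · intro x hx; exact div_ne_zero (mul_pos two_pos hb0).ne' (hne x hx)
  -- IVT
  obtain ⟨β', hβ'mem, hβ'eq⟩ := intermediate_value_Icc h12 hcont ⟨hf₁y, hf₂⟩
  refine ⟨β', hβ₁1.trans hβ'mem.1, ?_⟩
  have hfβ' : invRunningCoupling β' L0 = y := hβ'eq
  show (max (invRunningCoupling β' L0) 0) ^ (-(1 : ℝ) / 3) = v
  rw [hfβ', max_eq_left hypos.le, hy]
  have hexp : (-(1 : ℝ) / 3) = -(((3 : ℕ) : ℝ)⁻¹) := by norm_num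
  rw [hexp, Real.rpow_neg (by positivity), Real.inv_rpow (by positivity), inv_inv,
    Real.pow_rpow_inv_natCast hvpos.le (by norm_num)]


/-! ## The KT-currency hand-over: 3a′ `CoarseHandoverUpper L0`, 3b′ `CoarseNoIntruderAt L0`, the seam onto KT's stub 3, its converse, and the calibration -/

/-- VERBATIM copy of `Summit.QuantumFields.YangMills.Cruxes.RunningReduction.KT.CoarseNoIntruder` (`Lines-KT.lean` §1; that file lives in the owner's pub
folder and is registered from there, hence not importable here — the text below is character-identical under the same `open`s, so the seam below
re-targets to `KT.Stmt.stub_coarseNoIntruder` by `Iff.rfl` once both sit in one file). -/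
def KTCoarseNoIntruder : Prop :=
  ∀ k : ℕ, ∀ d : ℝ, d < levelGap k → ∃ lam0 : ℝ, 0 < lam0 ∧ ∀ lam : ℝ, 0 < lam → lam ≤ lam0 →
    ∃ L0 : ℕ, ∀ (L : ℕ) [NeZero L], L0 ≤ L → ∀ β : ℝ, InFemtoWindow lam β L →
      levelValue su2Rep L β k ≤ Real.exp (-(d * luscherLambda β L) / L) * levelValue su2Rep L β 0

/-- **UV′-upper = `CoarseHandoverUpper L0` (XL, the proposed stub 3a′ of line «KT»)**: the no-intruder DIRECTION of the (coarse) spectral hand-over of card `handover-split` alone —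
at matched two-loop label the `k`-th spectral ratio of the fine femto torus per physical time is bounded ABOVE by the coarse one times `e^{ελ}`,
for every `ε > 0`, uniformly in `L ≥ L1(lam)` (RED's quantifier order; cross-multiplied). -/
def CoarseHandoverUpper (L0 : ℕ) [NeZero L0] : Prop :=
  ∀ k : ℕ, ∀ ε : ℝ, 0 < ε → ∃ lam0 : ℝ, 0 < lam0 ∧ ∀ lam : ℝ, 0 < lam → lam ≤ lam0 →
    ∃ L1 : ℕ, ∀ (L : ℕ) [NeZero L], L1 ≤ L → ∀ β : ℝ, InFemtoWindow lam β L →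
      ∀ β' : ℝ, 1 ≤ β' → luscherLambda β' L0 = luscherLambda β L →
        levelValue su2Rep L β k ^ L * levelValue su2Rep L0 β' 0 ^ L0 ≤
          Real.exp (ε * luscherLambda β L) * (levelValue su2Rep L0 β' k ^ L0 * levelValue su2Rep L β 0 ^ L)

/-- **BOTTOM-upper = `CoarseNoIntruderAt L0` (L, finite-dimensional, the proposed stub 3b′ of line «KT»)**: Lüscher's law from below with relative error
`o(1)` on the SINGLE lattice size `L0` — for every `d < Δ_k`, once `lam` is small, every `β` in the femto window AT `L0` has
`λ_k(L0,β) ≤ e^{−dλ(β,L0)/L0} λ_0(L0,β)`.  No one-site model, no `ONE`, no limit `L → ∞`: semiclassics (`β → ∞`) of the zero-flux transfer operator on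
the fixed compact manifold `SU(2)^{3L0³}`, whose slow manifold is the toron torus and whose blow-up at the torons is `λ·𝔥/L0`. -/
def CoarseNoIntruderAt (L0 : ℕ) [NeZero L0] : Prop :=
  ∀ k : ℕ, ∀ d : ℝ, d < levelGap k → ∃ lam0 : ℝ, 0 < lam0 ∧ ∀ lam : ℝ, 0 < lam → lam ≤ lam0 →
    ∀ β : ℝ, InFemtoWindow lam β L0 →
      levelValue su2Rep L0 β k ≤ Real.exp (-(d * luscherLambda β L0) / L0) * levelValue su2Rep L0 β 0

/-- **BOTTOM-lower = `CoarseLowerAt L0`** (finite-dimensional; used only in the converse): on the single lattice size `L0`, for every `ε > 0`, eventually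
`e^{−(Δ_k+ε)λ/L0} λ_0 ≤ λ_k`. -/
def CoarseLowerAt (L0 : ℕ) [NeZero L0] : Prop :=
  ∀ k : ℕ, ∀ ε : ℝ, 0 < ε → ∃ lam0 : ℝ, 0 < lam0 ∧ ∀ lam : ℝ, 0 < lam → lam ≤ lam0 →
    ∀ β : ℝ, InFemtoWindow lam β L0 →
      Real.exp (-((levelGap k + ε) * luscherLambda β L0) / L0) * levelValue su2Rep L0 β 0 ≤ levelValue su2Rep L0 β k

/-- `exp(x/n)^n = exp x` for a lattice size `n`. -/
private theorem exp_div_pow (x : ℝ) (n : ℕ) [NeZero n] : Real.exp (x / n) ^ n = Real.exp x := by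
  have hn : (n : ℝ) ≠ 0 := Nat.cast_ne_zero.mpr (NeZero.ne n)
  rw [← Real.exp_nat_mul]; congr 1; field_simp

set_option maxHeartbeats 400000 in
/-- **The KT-currency hand-over composition (proved): `MatchedCoupling L0 → CoarseHandoverUpper L0 → CoarseNoIntruderAt L0 → KT.CoarseNoIntruder`.**
Given `d < Δ_k` put `ε = (Δ_k − d)/2`, `d' = d + ε < Δ_k`; in the window take the coarse partner `β'` (`λ(β',L0) = λ(β,L) =: l`, so `(L0,β')` is in the
window at `L0`); BOTTOM at `d'` raised to the power `L0` gives `λ'_k^{L0} ≤ e^{−d'l} λ'_0^{L0}`, UV′-upper gives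
`λ_k^L λ'_0^{L0} ≤ e^{εl} λ'_k^{L0} λ_0^L ≤ e^{−dl} λ'_0^{L0} λ_0^L`; cancel `λ'_0^{L0} > 0` and take the `L`-th root. -/
theorem coarseNoIntruder_of_handover (L0 : ℕ) [NeZero L0] (hM : MatchedCoupling L0) (hU : CoarseHandoverUpper L0)
    (hB : CoarseNoIntruderAt L0) : KTCoarseNoIntruder := by
  intro k d hd
  obtain ⟨lamM, hlamM, HM⟩ := hM
  set ε : ℝ := (levelGap k - d) / 2 with hε_def
  have hε : 0 < ε := by rw [hε_def]; linarith
  set d' : ℝ := d + ε with hd'_def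
  have hd' : d' < levelGap k := by rw [hd'_def, hε_def]; linarith
  obtain ⟨lU, hlU, HU⟩ := hU k ε hε
  obtain ⟨lB, hlB, HB⟩ := hB k d' hd'
  refine ⟨min lamM (min lU lB), lt_min hlamM (lt_min hlU hlB), ?_⟩
  intro lam hlam hle
  have hleM : lam ≤ lamM := hle.trans (min_le_left _ _)
  have hleU : lam ≤ lU := (hle.trans (min_le_right _ _)).trans (min_le_left _ _)
  have hleB : lam ≤ lB := (hle.trans (min_le_right _ _)).trans (min_le_right _ _)
  obtain ⟨L1, HL⟩ := HU lam hlam hleU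
  refine ⟨L1, ?_⟩
  intro L _ hL β hw
  have hβ1 : 1 ≤ β := hw.1
  obtain ⟨β', hβ'1, hmatch⟩ := HM lam hlam hleM L β hw
  have hw' : InFemtoWindow lam β' L0 := by
    refine ⟨hβ'1, ?_, ?_⟩
    · rw [hmatch]; exact hw.2.1
    · rw [hmatch]; exact hw.2.2
  have hU1 := HL L hL β hw β' hβ'1 hmatch
  have hB1 := HB lam hlam hleB β' hw'
  rw [hmatch] at hB1
  set l : ℝ := luscherLambda β L with hl_def
  set xk := levelValue su2Rep L β k with hxk_def
  set x0 := levelValue su2Rep L β 0 with hx0_def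
  set yk := levelValue su2Rep L0 β' k with hyk_def
  set y0 := levelValue su2Rep L0 β' 0 with hy0_def
  have hxk : 0 ≤ xk := transferValuesNonneg L β k hβ1
  have hx0 : 0 < x0 := levelValue_zero_su2Rep_pos L β
  have hyk : 0 ≤ yk := transferValuesNonneg L0 β' k hβ'1
  have hy0 : 0 < y0 := levelValue_zero_su2Rep_pos L0 β'
  -- BOTTOM to the power L0
  have hBp : yk ^ L0 ≤ Real.exp (-(d' * l)) * y0 ^ L0 := by
    have := pow_le_pow_left₀ hyk hB1 L0
    rwa [mul_pow, exp_div_pow] at this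
  have hexp : Real.exp (ε * l) * Real.exp (-(d' * l)) = Real.exp (-(d * l)) := by
    rw [← Real.exp_add]; congr 1; rw [hd'_def]; ring
  have key : xk ^ L * y0 ^ L0 ≤ Real.exp (-(d * l)) * x0 ^ L * y0 ^ L0 := by
    calc xk ^ L * y0 ^ L0 ≤ Real.exp (ε * l) * (yk ^ L0 * x0 ^ L) := hU1
      _ ≤ Real.exp (ε * l) * ((Real.exp (-(d' * l)) * y0 ^ L0) * x0 ^ L) :=
          mul_le_mul_of_nonneg_left (mul_le_mul_of_nonneg_right hBp (pow_nonneg hx0.le _)) (Real.exp_pos _).le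
      _ = (Real.exp (ε * l) * Real.exp (-(d' * l))) * x0 ^ L * y0 ^ L0 := by ring
      _ = Real.exp (-(d * l)) * x0 ^ L * y0 ^ L0 := by rw [hexp]
  have hpos : 0 < y0 ^ L0 := pow_pos hy0 L0
  have key2 : xk ^ L ≤ Real.exp (-(d * l)) * x0 ^ L := le_of_mul_le_mul_right key hpos
  -- L-th root
  have key3 : xk ^ L ≤ (Real.exp (-(d * l) / L) * x0) ^ L := by rwa [mul_pow, exp_div_pow]
  exact (pow_le_pow_iff_left₀ hxk (mul_nonneg (Real.exp_pos _).le hx0.le) (NeZero.ne L)).mp key3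

/-- At the canonical coarse size, with the matching discharged: **`CoarseHandoverUpper 2 → CoarseNoIntruderAt 2 → KT.CoarseNoIntruder`** (proved). -/
theorem coarseNoIntruder_of_handover_two (hU : CoarseHandoverUpper 2) (hB : CoarseNoIntruderAt 2) : KTCoarseNoIntruder :=
  coarseNoIntruder_of_handover 2 (matchedCoupling 2) hU hB

set_option maxHeartbeats 400000 in
/-- **Faithfulness in KT currency (proved): `KT.CoarseNoIntruder → CoarseLowerAt L0 → CoarseHandoverUpper L0`.**  Fine side at `d = Δ_k − ε/2` to the
power `L`, coarse lower bound at `ε/2` to the power `L0`, multiply.  So UV′-upper(L0) is EQUIVALENT to KT's XL stub modulo the fixed-lattice pair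
{`CoarseNoIntruderAt L0`, `CoarseLowerAt L0`} (both finite-dimensional, `β → ∞` on `SU(2)^{3L0³}`): the split is lossless and costume-free
(neither piece alone gives the stub). -/
theorem coarseHandoverUpper_of_coarseNoIntruder (L0 : ℕ) [NeZero L0] (hC : KTCoarseNoIntruder) (hLow : CoarseLowerAt L0) :
    CoarseHandoverUpper L0 := by
  intro k ε hε
  obtain ⟨lC, hlC, HC⟩ := hC k (levelGap k - ε / 2) (by linarith)
  obtain ⟨lW, hlW, HW⟩ := hLow k (ε / 2) (by linarith)
  refine ⟨min lC lW, lt_min hlC hlW, ?_⟩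
  intro lam hlam hle
  obtain ⟨L1, HL⟩ := HC lam hlam (hle.trans (min_le_left _ _))
  refine ⟨L1, ?_⟩
  intro L _ hL β hw β' hβ'1 hmatch
  have hβ1 : 1 ≤ β := hw.1
  have hw' : InFemtoWindow lam β' L0 := by
    refine ⟨hβ'1, ?_, ?_⟩
    · rw [hmatch]; exact hw.2.1
    · rw [hmatch]; exact hw.2.2
  have hC1 := HL L hL β hw
  have hW1 := HW lam hlam (hle.trans (min_le_right _ _)) β' hw'
  rw [hmatch] at hW1
  set l : ℝ := luscherLambda β L with hl_def
  set xk := levelValue su2Rep L β k with hxk_def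
  set x0 := levelValue su2Rep L β 0 with hx0_def
  set yk := levelValue su2Rep L0 β' k with hyk_def
  set y0 := levelValue su2Rep L0 β' 0 with hy0_def
  have hxk : 0 ≤ xk := transferValuesNonneg L β k hβ1
  have hx0 : 0 < x0 := levelValue_zero_su2Rep_pos L β
  have hy0 : 0 < y0 := levelValue_zero_su2Rep_pos L0 β'
  have hCp : xk ^ L ≤ Real.exp (-((levelGap k - ε / 2) * l)) * x0 ^ L := by
    have := pow_le_pow_left₀ hxk hC1 L
    rwa [mul_pow, exp_div_pow] at this
  have hWp : Real.exp (-((levelGap k + ε / 2) * l)) * y0 ^ L0 ≤ yk ^ L0 := by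
    have := pow_le_pow_left₀ (mul_nonneg (Real.exp_pos _).le hy0.le) hW1 L0
    rwa [mul_pow, exp_div_pow] at this
  have hexp : Real.exp (-((levelGap k - ε / 2) * l)) = Real.exp (ε * l) * Real.exp (-((levelGap k + ε / 2) * l)) := by
    rw [← Real.exp_add]; congr 1; ring
  calc xk ^ L * y0 ^ L0 ≤ (Real.exp (-((levelGap k - ε / 2) * l)) * x0 ^ L) * y0 ^ L0 :=
        mul_le_mul_of_nonneg_right hCp (pow_nonneg hy0.le _)
    _ = Real.exp (ε * l) * ((Real.exp (-((levelGap k + ε / 2) * l)) * y0 ^ L0) * x0 ^ L) := by rw [hexp]; ring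
    _ ≤ Real.exp (ε * l) * (yk ^ L0 * x0 ^ L) :=
        mul_le_mul_of_nonneg_left (mul_le_mul_of_nonneg_right hWp (pow_nonneg hx0.le _)) (Real.exp_pos _).le

/-! ### BOTTOM-coarse is believed-true input: both fixed-lattice directions follow from tree `FixedLatticeReduction` at `L0` and the route's crux ONE
(proved).  This only CALIBRATES the pieces (they are not stronger than what the route already wants); the intended proof of `CoarseNoIntruderAt L0`
is direct finite-dimensional semiclassics against `𝔥`, without the one-site model. -/

/-- Slack absorption: `C₂ l²/L0 + C₁ (l/L0)² ≤ g·l/L0` once `l ≤ 2 lam ≤ g/(|C₁|+|C₂|+1)`. -/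
private theorem slack_absorb {C₁ C₂ g l lam : ℝ} {L0 : ℕ} [NeZero L0] (hl : 0 < l) (hl2 : l ≤ 2 * lam)
    (hlam : lam ≤ g / (2 * (|C₁| + |C₂| + 1))) :
    C₂ * l ^ 2 / L0 + C₁ * (l / L0) ^ 2 ≤ g * l / L0 := by
  have hL0one : (1 : ℝ) ≤ L0 := by exact_mod_cast NeZero.one_le
  have hL0pos : (0 : ℝ) < L0 := by positivity
  have hA : 0 < |C₁| + |C₂| + 1 := by positivity
  have hlg : (|C₁| + |C₂| + 1) * l ≤ g := by
    have h2lam : 2 * lam ≤ g / (|C₁| + |C₂| + 1) := by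
      have := mul_le_mul_of_nonneg_left hlam (by norm_num : (0 : ℝ) ≤ 2)
      calc 2 * lam ≤ 2 * (g / (2 * (|C₁| + |C₂| + 1))) := this
        _ = g / (|C₁| + |C₂| + 1) := by field_simp
    calc (|C₁| + |C₂| + 1) * l ≤ (|C₁| + |C₂| + 1) * (g / (|C₁| + |C₂| + 1)) :=
          mul_le_mul_of_nonneg_left (hl2.trans h2lam) hA.le
      _ = g := by field_simp
  have h1 : C₂ * l ^ 2 / L0 ≤ |C₂| * l ^ 2 / L0 := by gcongr; exact le_abs_self _
  have h2 : C₁ * (l / L0) ^ 2 ≤ |C₁| * l ^ 2 / L0 := by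
    have h21 : C₁ * (l / L0) ^ 2 ≤ |C₁| * (l / L0) ^ 2 := mul_le_mul_of_nonneg_right (le_abs_self _) (sq_nonneg _)
    have h22 : |C₁| * (l / L0) ^ 2 ≤ |C₁| * l ^ 2 / L0 := by
      rw [div_pow, ← mul_div_assoc]
      apply div_le_div_of_nonneg_left (mul_nonneg (abs_nonneg _) (sq_nonneg l)) hL0pos
      nlinarith
    exact h21.trans h22
  have h4 : (|C₁| + |C₂|) * l ≤ g := by nlinarith [hlg, hl]
  calc C₂ * l ^ 2 / L0 + C₁ * (l / L0) ^ 2 ≤ |C₂| * l ^ 2 / L0 + |C₁| * l ^ 2 / L0 := add_le_add h1 h2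
    _ = ((|C₁| + |C₂|) * l) * l / L0 := by ring
    _ ≤ g * l / L0 := by gcongr

/-- In the window at `L0` with `lam ≤ min 1 (1/(4M))`: `M ≤ oneSiteCoupling β L0`. -/
private theorem oneSiteCoupling_ge_of_small {lam β M : ℝ} {L0 : ℕ} [NeZero L0] (hM : 0 < M) (hlam : 0 < lam) (hlam1 : lam ≤ 1)
    (hleM : lam ≤ 1 / (4 * M)) (hw : InFemtoWindow lam β L0) : M ≤ oneSiteCoupling β L0 := by
  have h := oneSiteCoupling_ge_of_window hlam hw
  refine le_trans ?_ h
  rw [le_div_iff₀ (by positivity)]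
  have hlam3 : lam ^ 3 ≤ lam := pow_le_of_le_one hlam.le hlam1 three_ne_zero
  have h3 := hleM
  rw [le_div_iff₀ (by positivity)] at h3
  calc M * (4 * lam ^ 3) = 4 * M * lam ^ 3 := by ring
    _ ≤ 4 * M * lam := by gcongr
    _ = lam * (4 * M) := by ring
    _ ≤ 1 := h3

set_option maxHeartbeats 400000 in
/-- **Calibration (proved): `FixedLatticeReductionAt L0 → ONE → CoarseNoIntruderAt L0`.** -/
theorem coarseNoIntruderAt_of_fixedLattice (L0 : ℕ) [NeZero L0] (hF : FixedLatticeReductionAt L0)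
    (hOne : Summit.QuantumFields.YangMills.Theses.LuscherReduction.OneSiteLevels) : CoarseNoIntruderAt L0 := by
  intro k d hd
  obtain ⟨C₁, B0, H₁⟩ := hOne k
  obtain ⟨C₂, l₂, hl₂, H₂⟩ := hF k
  set g : ℝ := levelGap k - d with hg_def
  have hg : 0 < g := by rw [hg_def]; linarith
  set M : ℝ := max B0 1 with hM_def
  have hM1 : 1 ≤ M := le_max_right _ _
  have hMB : B0 ≤ M := le_max_left _ _
  have hM0 : 0 < M := by linarith
  have hA : 0 < |C₁| + |C₂| + 1 := by positivity
  refine ⟨min l₂ (min 1 (min (1 / (4 * M)) (g / (2 * (|C₁| + |C₂| + 1))))),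
    lt_min hl₂ (lt_min one_pos (lt_min (by positivity) (by positivity))), ?_⟩
  intro lam hlam hle β hw
  have hle₂ : lam ≤ l₂ := hle.trans (min_le_left _ _)
  have hlam1 : lam ≤ 1 := (hle.trans (min_le_right _ _)).trans (min_le_left _ _)
  have hleM : lam ≤ 1 / (4 * M) := ((hle.trans (min_le_right _ _)).trans (min_le_right _ _)).trans (min_le_left _ _)
  have hleg : lam ≤ g / (2 * (|C₁| + |C₂| + 1)) := ((hle.trans (min_le_right _ _)).trans (min_le_right _ _)).trans (min_le_right _ _)
  have hβ1 : 1 ≤ β := hw.1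
  set l : ℝ := luscherLambda β L0 with hl_def
  have hl : 0 < l := luscherLambda_pos_of_window hlam hw
  have hl2 : l ≤ 2 * lam := hw.2.2
  have hL0pos : (0 : ℝ) < L0 := Nat.cast_pos.mpr (NeZero.pos L0)
  set B : ℝ := oneSiteCoupling β L0 with hB_def
  have hBM : M ≤ B := oneSiteCoupling_ge_of_small hM0 hlam hlam1 hleM hw
  have hB0 : B0 ≤ B := hMB.trans hBM
  have hB1 : 1 ≤ B := hM1.trans hBM
  have hlb : bareLambda B = l / L0 := bareLambda_oneSiteCoupling hl
  obtain ⟨hu0, hU, -⟩ := H₁ B hB0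
  rw [hlb] at hU
  obtain ⟨hF1, -⟩ := H₂ lam hlam hle₂ β hw
  set yk := levelValue su2Rep L0 β k with hyk_def
  set y0 := levelValue su2Rep L0 β 0 with hy0_def
  set uk := levelValue su2Rep 1 B k with huk_def
  set u0 := levelValue su2Rep 1 B 0 with hu0_def
  have hy0 : 0 < y0 := levelValue_zero_su2Rep_pos L0 β
  -- chain and cancel u0
  have key : yk * u0 ≤ (Real.exp (C₂ * l ^ 2 / L0) * Real.exp (-(levelGap k * (l / L0) - C₁ * (l / L0) ^ 2))) * y0 * u0 := by
    calc yk * u0 ≤ Real.exp (C₂ * l ^ 2 / L0) * (uk * y0) := hF1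
      _ ≤ Real.exp (C₂ * l ^ 2 / L0) * ((Real.exp (-(levelGap k * (l / L0) - C₁ * (l / L0) ^ 2)) * u0) * y0) :=
          mul_le_mul_of_nonneg_left (mul_le_mul_of_nonneg_right hU hy0.le) (Real.exp_pos _).le
      _ = (Real.exp (C₂ * l ^ 2 / L0) * Real.exp (-(levelGap k * (l / L0) - C₁ * (l / L0) ^ 2))) * y0 * u0 := by ring
  have key2 : yk ≤ (Real.exp (C₂ * l ^ 2 / L0) * Real.exp (-(levelGap k * (l / L0) - C₁ * (l / L0) ^ 2))) * y0 :=
    le_of_mul_le_mul_right key hu0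
  have hslack := slack_absorb (C₁ := C₁) (C₂ := C₂) (L0 := L0) hl hl2 hleg
  have hexp : Real.exp (C₂ * l ^ 2 / L0) * Real.exp (-(levelGap k * (l / L0) - C₁ * (l / L0) ^ 2)) ≤ Real.exp (-(d * l) / L0) := by
    rw [← Real.exp_add]
    apply Real.exp_le_exp.mpr
    have : levelGap k * (l / L0) = (g * l / L0) + d * l / L0 := by rw [hg_def]; ring
    rw [this]
    have : -(d * l) / (L0 : ℝ) = -(d * l / L0) := by ring
    rw [this]
    linarith
  exact key2.trans (mul_le_mul_of_nonneg_right hexp hy0.le)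

set_option maxHeartbeats 400000 in
/-- **Calibration (proved): `FixedLatticeReductionAt L0 → ONE → CoarseLowerAt L0`.** -/
theorem coarseLowerAt_of_fixedLattice (L0 : ℕ) [NeZero L0] (hF : FixedLatticeReductionAt L0)
    (hOne : Summit.QuantumFields.YangMills.Theses.LuscherReduction.OneSiteLevels) : CoarseLowerAt L0 := by
  intro k ε hε
  obtain ⟨C₁, B0, H₁⟩ := hOne k
  obtain ⟨C₂, l₂, hl₂, H₂⟩ := hF k
  set M : ℝ := max B0 1 with hM_def
  have hM1 : 1 ≤ M := le_max_right _ _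
  have hMB : B0 ≤ M := le_max_left _ _
  have hM0 : 0 < M := by linarith
  have hA : 0 < |C₁| + |C₂| + 1 := by positivity
  refine ⟨min l₂ (min 1 (min (1 / (4 * M)) (ε / (2 * (|C₁| + |C₂| + 1))))),
    lt_min hl₂ (lt_min one_pos (lt_min (by positivity) (by positivity))), ?_⟩
  intro lam hlam hle β hw
  have hle₂ : lam ≤ l₂ := hle.trans (min_le_left _ _)
  have hlam1 : lam ≤ 1 := (hle.trans (min_le_right _ _)).trans (min_le_left _ _)
  have hleM : lam ≤ 1 / (4 * M) := ((hle.trans (min_le_right _ _)).trans (min_le_right _ _)).trans (min_le_left _ _)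
  have hleg : lam ≤ ε / (2 * (|C₁| + |C₂| + 1)) := ((hle.trans (min_le_right _ _)).trans (min_le_right _ _)).trans (min_le_right _ _)
  have hβ1 : 1 ≤ β := hw.1
  set l : ℝ := luscherLambda β L0 with hl_def
  have hl : 0 < l := luscherLambda_pos_of_window hlam hw
  have hl2 : l ≤ 2 * lam := hw.2.2
  have hL0pos : (0 : ℝ) < L0 := Nat.cast_pos.mpr (NeZero.pos L0)
  set B : ℝ := oneSiteCoupling β L0 with hB_def
  have hBM : M ≤ B := oneSiteCoupling_ge_of_small hM0 hlam hlam1 hleM hw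
  have hB0 : B0 ≤ B := hMB.trans hBM
  have hlb : bareLambda B = l / L0 := bareLambda_oneSiteCoupling hl
  obtain ⟨hu0, -, hL⟩ := H₁ B hB0
  rw [hlb] at hL
  obtain ⟨-, hF2⟩ := H₂ lam hlam hle₂ β hw
  set yk := levelValue su2Rep L0 β k with hyk_def
  set y0 := levelValue su2Rep L0 β 0 with hy0_def
  set uk := levelValue su2Rep 1 B k with huk_def
  set u0 := levelValue su2Rep 1 B 0 with hu0_def
  have hy0 : 0 < y0 := levelValue_zero_su2Rep_pos L0 β
  have hyk : 0 ≤ yk := transferValuesNonneg L0 β k hβ1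
  -- (e^{-(Δ l/L0 + C₁ (l/L0)²)} u0) y0 ≤ uk y0 ≤ e^{C₂ l²/L0} yk u0
  have key : (Real.exp (-(levelGap k * (l / L0) + C₁ * (l / L0) ^ 2)) * y0) * u0 ≤ (Real.exp (C₂ * l ^ 2 / L0) * yk) * u0 := by
    calc (Real.exp (-(levelGap k * (l / L0) + C₁ * (l / L0) ^ 2)) * y0) * u0
        = (Real.exp (-(levelGap k * (l / L0) + C₁ * (l / L0) ^ 2)) * u0) * y0 := by ring
      _ ≤ uk * y0 := mul_le_mul_of_nonneg_right hL hy0.le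
      _ ≤ Real.exp (C₂ * l ^ 2 / L0) * (yk * u0) := hF2
      _ = (Real.exp (C₂ * l ^ 2 / L0) * yk) * u0 := by ring
  have key2 : Real.exp (-(levelGap k * (l / L0) + C₁ * (l / L0) ^ 2)) * y0 ≤ Real.exp (C₂ * l ^ 2 / L0) * yk :=
    le_of_mul_le_mul_right key hu0
  -- divide by e^{C₂ l²/L0}
  have key3 : Real.exp (-(levelGap k * (l / L0) + C₁ * (l / L0) ^ 2) - C₂ * l ^ 2 / L0) * y0 ≤ yk := by
    have hE : Real.exp (-(levelGap k * (l / L0) + C₁ * (l / L0) ^ 2) - C₂ * l ^ 2 / L0) =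
        Real.exp (-(levelGap k * (l / L0) + C₁ * (l / L0) ^ 2)) / Real.exp (C₂ * l ^ 2 / L0) := by
      rw [Real.exp_sub]
    rw [hE, div_mul_eq_mul_div, div_le_iff₀ (Real.exp_pos _)]
    calc Real.exp (-(levelGap k * (l / L0) + C₁ * (l / L0) ^ 2)) * y0 ≤ Real.exp (C₂ * l ^ 2 / L0) * yk := key2
      _ = yk * Real.exp (C₂ * l ^ 2 / L0) := by ring
  have hslack := slack_absorb (C₁ := C₁) (C₂ := C₂) (L0 := L0) hl hl2 hleg
  have hexp : Real.exp (-((levelGap k + ε) * l) / L0) ≤ Real.exp (-(levelGap k * (l / L0) + C₁ * (l / L0) ^ 2) - C₂ * l ^ 2 / L0) := by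
    apply Real.exp_le_exp.mpr
    have : -((levelGap k + ε) * l) / (L0 : ℝ) = -(levelGap k * (l / L0)) - ε * l / L0 := by ring
    rw [this]
    linarith
  exact (mul_le_mul_of_nonneg_right hexp hy0.le).trans key3

end Summit.QuantumFields.YangMills.Cruxes.RunningReduction.KTCoarseHandover

end

set_option autoImplicit false

noncomputable section

open MeasureTheory Filter Topology Real
open Literature.MathematicalPhysics.QuantumFieldTheory hiding SU2
open Literature.MathematicalPhysics.QuantumLattice
open Literature.Analysis.OperatorTheory.YMMatrixModel
open scoped BigOperators

namespace Summit.QuantumFields.YangMills.Cruxes.RunningReduction.KT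

open Summit.QuantumFields.YangMills.Theorems.FemtoTransferGap

/-! ## §0 The located defect: a variance bound over a span containing two Ritz vectors sees their spread (kernel-checked) -/

section Spread

variable {D : Type*} [AddCommGroup D] [Module ℝ D]

/-- **In-span spread is a floor for the total variance.**  `ip` symmetric positive semidefinite, `K` `ip`-symmetric, `u₀, u₁`
`ip`-orthonormal Ritz vectors (`ip(u₀,Ku₁) = 0`) with Ritz values `m₀, m₁`.  If the variance bound
`ip(Ks,Ks)·ip(s,s) − ip(s,Ks)² ≤ ϱ·ip(s,s)²` holds for `s = u₀ + u₁`, then `(m₀ − m₁)²/4 ≤ ϱ`.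
(Bessel: `ip(Ks,Ks) ≥ ip(u₀,Ks)² + ip(u₁,Ks)² = m₀² + m₁²`, and `ip(s,s) = 2`, `ip(s,Ks) = m₀ + m₁`.)  This is why clause (ii) of the
registered `DressedRitz` (total variance over the WHOLE span `≤ C(λ³/L²)m₀²`) cannot hold for `k ≥ 1`. [folklore] -/
theorem quarter_spread_sq_le_of_variance (ip : D →ₗ[ℝ] D →ₗ[ℝ] ℝ)
    (hip_symm : ∀ x y, ip x y = ip y x) (hip_nonneg : ∀ x, 0 ≤ ip x x)
    (K : D →ₗ[ℝ] D) (hK : ∀ x y, ip (K x) y = ip x (K y))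
    (u0 u1 : D) (m0 m1 : ℝ) (h00 : ip u0 u0 = 1) (h11 : ip u1 u1 = 1) (h01 : ip u0 u1 = 0)
    (hK00 : ip u0 (K u0) = m0) (hK11 : ip u1 (K u1) = m1) (hK01 : ip u0 (K u1) = 0)
    {ϱ : ℝ} (hvar : ip (K (u0 + u1)) (K (u0 + u1)) * ip (u0 + u1) (u0 + u1) - ip (u0 + u1) (K (u0 + u1)) ^ 2 ≤
      ϱ * ip (u0 + u1) (u0 + u1) ^ 2) :
    (m0 - m1) ^ 2 / 4 ≤ ϱ := by
  have h10 : ip u1 u0 = 0 := by rw [hip_symm]; exact h01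
  have hK10 : ip u1 (K u0) = 0 := by rw [← hK, hip_symm]; exact hK01
  -- `ip(s,s) = 2`, `ip(u₀,Ks) = m₀`, `ip(u₁,Ks) = m₁`, `ip(s,Ks) = m₀ + m₁`
  have hss : ip (u0 + u1) (u0 + u1) = 2 := by
    simp only [map_add, LinearMap.add_apply, h00, h11, h01, h10]; norm_num
  have ha : ip u0 (K (u0 + u1)) = m0 := by
    simp only [map_add, hK00, hK01]; ring
  have hb : ip u1 (K (u0 + u1)) = m1 := by
    simp only [map_add, hK10, hK11]; ring
  have hsKs : ip (u0 + u1) (K (u0 + u1)) = m0 + m1 := by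
    rw [map_add (f := ip), LinearMap.add_apply, ha, hb]
  -- Bessel: `0 ≤ ip(y,y)`, `y = Ks − m₀u₀ − m₁u₁`, i.e. `ip(Ks,Ks) ≥ m₀² + m₁²`
  set w : D := K (u0 + u1) with hw
  have ha' : ip w u0 = m0 := by rw [hip_symm]; exact ha
  have hb' : ip w u1 = m1 := by rw [hip_symm]; exact hb
  have hbessel : m0 ^ 2 + m1 ^ 2 ≤ ip w w := by
    have h0 := hip_nonneg (w - m0 • u0 - m1 • u1)
    have hexp : ip (w - m0 • u0 - m1 • u1) (w - m0 • u0 - m1 • u1) = ip w w - m0 ^ 2 - m1 ^ 2 := by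
      simp only [map_sub, map_smul, LinearMap.sub_apply, LinearMap.smul_apply, smul_eq_mul, ha, hb, ha', hb', h00, h11,
        h01, h10]
      ring
    rw [hexp] at h0
    linarith
  rw [hss, hsKs] at hvar
  nlinarith [hvar, hbessel]

end Spread

/-! ## §1 Objects and statements (rev 3: Ritz-diagonal families, residual Gram bound; `ritzValue`/`qform2` dropped) -/

/-- **`CoarseNoIntruder`** (global, lift-free, PRECISION-FREE; VERBATIM rev 2): Lüscher's law from below with relative error `o(1)` —
for every `d < Δ_k = levelGap k`, eventually `λ_k(L,β) ≤ e^{−dλ/L} λ_0(L,β)`. -/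
def CoarseNoIntruder : Prop :=
  ∀ k : ℕ, ∀ d : ℝ, d < levelGap k → ∃ lam0 : ℝ, 0 < lam0 ∧ ∀ lam : ℝ, 0 < lam → lam ≤ lam0 →
    ∃ L0 : ℕ, ∀ (L : ℕ) [NeZero L], L0 ≤ L → ∀ β : ℝ, InFemtoWindow lam β L →
      levelValue su2Rep L β k ≤ Real.exp (-(d * luscherLambda β L) / L) * levelValue su2Rep L β 0

/-- **`DressedRitz` (rev 3, explicit, sharp)**: for every level `k` and every `η > 0` there is, eventually in the femto window, a
PHYSICAL, `l2`-ORTHONORMAL, `qform`-DIAGONAL trial family `φ₀ … φ_k` with non-increasing Ritz values `m_i = ⟨φ_i, K_β φ_i⟩` such that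
(i) the Ritz RATIOS `m_j/m_0` equal the one-site ratios at `B = 2L³/λ³` to `e^{±Cλ²/L}`; (ii′) the RESIDUAL GRAM BOUND
`‖Σ_i c_i r_i‖² ≤ C(λ³/L²)·m_0²·Σ_i c_i²`, `r_i = K_βφ_i − m_iφ_i` (= `‖(1−P_V)K_βP_V‖² ≤ C(λ³/L²)m₀²`: only leakage OUT of the span
counts); (iii) COARSE top capture `⟨ψ,K_βψ⟩ ≤ e^{ηλ/L} m_0 ‖ψ‖²` for all physical `ψ`.  Intended witnesses: the Ritz rotation
(`exists_orthonormal_formDiagonal_antitone`) of the two-stage-dressed slab family `K^m((Σ a_j flowLift t f_j)·Φ_M)`, `M → ∞` first,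
`m ≈ t₀L`, `t₀ ≈ (3/2π) log(1/λ)`.  RED ∧ (spectral layer) ⟹ it (exact eigenfunctions: `r_i = 0`); it does not imply RED. -/
def DressedRitz : Prop :=
  ∀ k : ℕ, ∀ η : ℝ, 0 < η → ∃ C lam0 : ℝ, 0 < lam0 ∧ ∀ lam : ℝ, 0 < lam → lam ≤ lam0 →
    ∃ L0 : ℕ, ∀ (L : ℕ) [NeZero L], L0 ≤ L → ∀ β : ℝ, InFemtoWindow lam β L →
      ∃ φ : Fin (k + 1) → (GaugeConfig 3 L SU2 → ℝ),
        (∀ i, IsPhys (φ i)) ∧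
        (∀ i l, l2 (φ i) (φ l) = if i = l then 1 else 0) ∧
        (∀ i l, i ≠ l → qform su2Rep β (φ i) (φ l) = 0) ∧
        (∀ i l : Fin (k + 1), i ≤ l → qform su2Rep β (φ l) (φ l) ≤ qform su2Rep β (φ i) (φ i)) ∧
        (∀ j : Fin (k + 1),
          qform su2Rep β (φ j) (φ j) * levelValue su2Rep 1 (oneSiteCoupling β L) 0 ≤
              Real.exp (C * luscherLambda β L ^ 2 / L) *
                (levelValue su2Rep 1 (oneSiteCoupling β L) j * qform su2Rep β (φ 0) (φ 0)) ∧
            levelValue su2Rep 1 (oneSiteCoupling β L) j * qform su2Rep β (φ 0) (φ 0) ≤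
              Real.exp (C * luscherLambda β L ^ 2 / L) *
                (qform su2Rep β (φ j) (φ j) * levelValue su2Rep 1 (oneSiteCoupling β L) 0)) ∧
        (∀ c : Fin (k + 1) → ℝ,
          l2 (∑ i, c i • (transferApply β (φ i) - qform su2Rep β (φ i) (φ i) • φ i))
             (∑ i, c i • (transferApply β (φ i) - qform su2Rep β (φ i) (φ i) • φ i)) ≤
            C * (luscherLambda β L ^ 3 / (L : ℝ) ^ 2) * qform su2Rep β (φ 0) (φ 0) ^ 2 * ∑ i, c i ^ 2) ∧
        (∀ ψ : GaugeConfig 3 L SU2 → ℝ, IsPhys ψ →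
          qform su2Rep β ψ ψ ≤ Real.exp (η * luscherLambda β L / L) * qform su2Rep β (φ 0) (φ 0) * l2 ψ ψ)

/-- **`KatoTempleDoor` (rev 3; functional analysis at fixed lattice = the concrete instance of the tree's `clusterKatoTemple_op`)**:
for a physical `l2`-orthonormal `qform`-diagonal family `φ₀ … φ_k` with non-increasing Ritz values `m_i = ⟨φ_i,K_βφ_i⟩`: if the
`(k+1)`-st min–max value lies below `θ`, the bottom Ritz value `m_k` lies above `θ`, and the residual Gram bound
`‖Σ c_i r_i‖² ≤ ϱ Σ c_i²` holds (`r_i = K_βφ_i − m_iφ_i`, `ϱ ≥ 0`), then `λ_j ≤ m_j + ϱ/(m_k − θ)` for every `j ≤ k`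
(quadratic in the residual, one inverse power of the gap between the whole Ritz cluster and `θ`).
[cite: Kato1949, Lemma 2, Thm 1] [cite: Lehmann1963] [cite: ReedSimonIV1978, Thm. XIII.5] -/
def KatoTempleDoor : Prop :=
  ∀ (L : ℕ) [NeZero L] (β : ℝ) (k : ℕ) (φ : Fin (k + 1) → (GaugeConfig 3 L SU2 → ℝ)) (θ ϱ : ℝ), 1 ≤ β →
    (∀ i, IsPhys (φ i)) → (∀ i l, l2 (φ i) (φ l) = if i = l then 1 else 0) →
    (∀ i l, i ≠ l → qform su2Rep β (φ i) (φ l) = 0) →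
    (∀ i l : Fin (k + 1), i ≤ l → qform su2Rep β (φ l) (φ l) ≤ qform su2Rep β (φ i) (φ i)) →
    levelValue su2Rep L β (k + 1) ≤ θ → θ < qform su2Rep β (φ (Fin.last k)) (φ (Fin.last k)) → 0 ≤ ϱ →
    (∀ c : Fin (k + 1) → ℝ,
      l2 (∑ i, c i • (transferApply β (φ i) - qform su2Rep β (φ i) (φ i) • φ i))
         (∑ i, c i • (transferApply β (φ i) - qform su2Rep β (φ i) (φ i) • φ i)) ≤ ϱ * ∑ i, c i ^ 2) →
    ∀ j : Fin (k + 1), levelValue su2Rep L β j ≤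
      qform su2Rep β (φ j) (φ j) + ϱ / (qform su2Rep β (φ (Fin.last k)) (φ (Fin.last k)) - θ)

/-- Finite multiplicities of Lüscher's `𝔥`: every level's multiplet ends (PROVED below, `shellsClose`; VERBATIM rev 2). -/
def ShellsClose : Prop := ∀ k : ℕ, ∃ k' : ℕ, k ≤ k' ∧ levelGap k' < levelGap (k' + 1)

/-- **`RitzBasics` (rev 3, fixed lattice; Rayleigh–Ritz ≤ min–max for a diagonal family)**: for a physical `l2`-orthonormal
`qform`-diagonal family `φ : Fin n → _` with non-increasing Ritz values, `m_j ≤ λ_j` for every `j < n` (the `(j+1)`-dimensional span of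
`φ₀ … φ_j` has `⟨ψ,K_βψ⟩ ≥ m_j‖ψ‖²`; tree `le_levelValue_of_subspace`).  (`0 ≤ m_j` is PROVED: `ritz_nonneg`.) [cite: ReedSimonIV1978, XIII.1–2] -/
def RitzBasics : Prop :=
  ∀ (L : ℕ) [NeZero L] (β : ℝ) (n : ℕ) (φ : Fin n → (GaugeConfig 3 L SU2 → ℝ)), 1 ≤ β →
    (∀ i, IsPhys (φ i)) → (∀ i l, l2 (φ i) (φ l) = if i = l then 1 else 0) →
    (∀ i l, i ≠ l → qform su2Rep β (φ i) (φ l) = 0) →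
    (∀ i l : Fin n, i ≤ l → qform su2Rep β (φ l) (φ l) ≤ qform su2Rep β (φ i) (φ i)) →
    ∀ j : Fin n, qform su2Rep β (φ j) (φ j) ≤ levelValue su2Rep L β j

/-- **`OneSiteLowerCoarse`** (⇐ ONE; VERBATIM rev 2): for every `K` and `ε > 0`, for `B ≥ B₀`: `μ_0(B) > 0` and
`μ_j(B) ≥ e^{−(Δ_j+ε)λ_b} μ_0(B)` for all `j ≤ K` (`λ_b = (2/B)^{1/3}`). -/
def OneSiteLowerCoarse : Prop :=
  ∀ K : ℕ, ∀ ε : ℝ, 0 < ε → ∃ B0 : ℝ, ∀ B : ℝ, B0 ≤ B → 0 < levelValue su2Rep 1 B 0 ∧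
    ∀ j : ℕ, j ≤ K → Real.exp (-((levelGap j + ε) * bareLambda B)) * levelValue su2Rep 1 B 0 ≤ levelValue su2Rep 1 B j

/-! ## §2 Registered stubs (same names as rev 2; statements of `katoTempleDoor` / `ritzBasics` / `dressedRitz` re-typed) -/

/-- Stub statement: the cluster Kato–Temple door, residual-Gram form. -/
abbrev Proved.katoTempleDoor : Prop := KatoTempleDoor
/-- Stub statement: Rayleigh–Ritz ≤ min–max for a diagonal family. -/
abbrev Proved.ritzBasics : Prop := RitzBasics
/-- Stub statement: coarse no-intruder law (XL). -/
abbrev Derived.coarseNoIntruder : Prop := CoarseNoIntruder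
/-- Stub statement (3a′, XL): UV′-upper — one-sided cutoff universality of the femto spectrum at matched two-loop label, coarse size `L0 = 2`
(card `handover-split` rev 3; def VERBATIM = `KTCoarseHandover.CoarseHandoverUpper 2`). -/
abbrev Stmt.stub_coarseHandoverUpper2 : Prop :=
  Summit.QuantumFields.YangMills.Cruxes.RunningReduction.KTCoarseHandover.CoarseHandoverUpper 2
/-- Stub statement (3b′, L, finite-dimensional): Lüscher's law from below with relative error `o(1)` on the SINGLE lattice size `L0 = 2`
(card `handover-split` rev 3; def = `KTCoarseHandover.CoarseNoIntruderAt 2`). -/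
abbrev Stmt.stub_coarseNoIntruderAt2 : Prop :=
  Summit.QuantumFields.YangMills.Cruxes.RunningReduction.KTCoarseHandover.CoarseNoIntruderAt 2
/-- Stub statement: dressed Ritz witnesses, residual-Gram form (XL/L). -/
abbrev Stmt.stub_dressedRitz : Prop := DressedRitz
/-- Stub statement: coarse one-site lower law (⇐ ONE, `oneSiteLowerCoarse_of_oneSiteLevels`). -/
abbrev Stmt.stub_oneSiteLowerCoarse : Prop := OneSiteLowerCoarse

/-- stub (M): the cluster Kato–Temple door = tree `ClusterKatoTemple.clusterKatoTemple_op` on `D` = physical test functions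
(`ip = l2`, `K = transferApply β`, symmetric by `l2_transferApply_comm`), a-priori information `levelValue (k+1) ≤ θ` unpacked in
infimum form (`clusterKatoTemple_of_functionals_of_forall_gt`), conclusion through `levelValue_le_of_forall_rayleigh_le`.
[cite: Kato1949, Lemma 2, Thm 1] [cite: Lehmann1963] [cite: ReedSimonIV1978, Thm. XIII.5] -/
theorem katoTempleDoor_holds : Proved.katoTempleDoor :=
  Summit.QuantumFields.YangMills.Theorems.FemtoTransferGap.KTDoorR3.katoTempleDoorR3

/-- stub (S/M): Rayleigh–Ritz ≤ min–max for a diagonal orthonormal physical family (tree `le_levelValue_of_subspace` on the span of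
`φ₀ … φ_j`, bilinearity from `l2_add_left`/`qform_add_left`). [cite: ReedSimonIV1978, XIII.1–2] -/
theorem ritzBasics_holds : Proved.ritzBasics :=
  Summit.QuantumFields.YangMills.Theorems.FemtoTransferGap.KTDoorR3.ritzBasicsR3

/-- stub (XL): coarse no-intruder law — Lüscher's law from below with `o(1)` relative error, lift-free. [cite: Luscher1983] -/
theorem stub_coarseHandoverUpper2 : Stmt.stub_coarseHandoverUpper2 := by
  sorry

/-- stub (L, finite-dimensional): Lüscher's law from below, relative error `o(1)`, on the single lattice size `L0 = 2` (`β → ∞` semiclassics of the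
zero-flux transfer operator on `SU(2)^{24}`; ONE-free). [cite: Luscher1983] -/
theorem stub_coarseNoIntruderAt2 : Stmt.stub_coarseNoIntruderAt2 := by
  sorry

/-- KT's former global stub 3, now DERIVED from 3a′ + 3b′ through the kernel-checked hand-over seam of card `handover-split` rev 3
(`KTCoarseHandover.coarseNoIntruder_of_handover_two`, matching discharged by `matchedCoupling 2`). -/
theorem coarseNoIntruder_of_stubs (hU : Stmt.stub_coarseHandoverUpper2) (hB : Stmt.stub_coarseNoIntruderAt2) : Derived.coarseNoIntruder :=
  Summit.QuantumFields.YangMills.Cruxes.RunningReduction.KTCoarseHandover.coarseNoIntruder_of_handover_two hU hB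

/-- stub (XL/L): two-stage-dressed slab Ritz family (Ritz-rotated) with sharp one-site ratios, residual Gram bound
`‖(1−P_V)KP_V‖² ≤ C(λ³/L²)m₀²` and coarse top capture. [cite: Luscher1983] [cite: LuscherMunster1984] -/
theorem stub_dressedRitz : Stmt.stub_dressedRitz := by
  sorry


/-! ## §3 Proved seams -/

theorem levelGap_nonneg (k : ℕ) : 0 ≤ levelGap k := by
  have h := physLevel_mono (le_refl 1) (Nat.succ_le_succ (Nat.zero_le k))
  unfold levelGap; linarith

theorem levelGap_mono {j k : ℕ} (h : j ≤ k) : levelGap j ≤ levelGap k := by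
  have h' := physLevel_mono (Nat.succ_le_succ (Nat.zero_le j)) (Nat.succ_le_succ h)
  unfold levelGap; linarith

/-- **Shells close** (PROVED): every multiplet of Lüscher's `𝔥` ends, from `physLevel → ∞` (`tendsto_physLevel_atTop`, AL-discreteness). -/
theorem shellsClose : ShellsClose := by
  intro k
  by_contra h
  push Not at h
  have hmono : ∀ n : ℕ, levelGap (k + n) ≤ levelGap k := by
    intro n
    induction n with
    | zero => simp
    | succ n ih => exact (h (k + n) (Nat.le_add_right k n)).trans ih
  have hbd : ∀ k' : ℕ, k ≤ k' → physLevel (k' + 1) ≤ physLevel (k + 1) := by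
    intro k' hk'
    obtain ⟨n, rfl⟩ := Nat.exists_eq_add_of_le hk'
    have h1 := hmono n
    unfold levelGap at h1
    linarith
  obtain ⟨N, hN⟩ := (tendsto_atTop_atTop.1 tendsto_physLevel_atTop) (physLevel (k + 1) + 1)
  have h1 := hN (max N (k + 1) + 1) (by omega)
  have h2 := hbd (max N (k + 1)) (by omega)
  linarith

/-- **ONE ⇒ the coarse one-site lower law** (PROVED): absorb `Cλ_b²` into `ελ_b` for `B` large, uniformly over `j ≤ K`. -/
theorem oneSiteLowerCoarse_of_oneSiteLevels
    (hONE : Summit.QuantumFields.YangMills.Theses.LuscherReduction.OneSiteLevels) : OneSiteLowerCoarse := by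
  have single : ∀ j : ℕ, ∀ ε : ℝ, 0 < ε → ∃ B0 : ℝ, ∀ B : ℝ, B0 ≤ B →
      0 < levelValue su2Rep 1 B 0 ∧
        Real.exp (-((levelGap j + ε) * bareLambda B)) * levelValue su2Rep 1 B 0 ≤ levelValue su2Rep 1 B j := by
    intro j ε hε
    obtain ⟨C, B0, hB⟩ := hONE j
    have hC'pos : 0 < max C 1 := lt_of_lt_of_le one_pos (le_max_right _ _)
    have htpos : 0 < ε / max C 1 := div_pos hε hC'pos
    refine ⟨max B0 (max (2 / (ε / max C 1) ^ 3) 1), fun B hBge => ?_⟩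
    have hB0 : B0 ≤ B := (le_max_left _ _).trans hBge
    have hBt : 2 / (ε / max C 1) ^ 3 ≤ B := ((le_max_left _ _).trans (le_max_right _ _)).trans hBge
    have hB1 : 1 ≤ B := ((le_max_right _ _).trans (le_max_right _ _)).trans hBge
    have hBpos : 0 < B := one_pos.trans_le hB1
    obtain ⟨hpos, _, hlow⟩ := hB B hB0
    refine ⟨hpos, ?_⟩
    have hlam : bareLambda B ≤ ε / max C 1 := bareLambda_le_of_le htpos hBt
    have hlam0 : 0 < bareLambda B := bareLambda_pos' hBpos
    have hCl : C * bareLambda B ^ 2 ≤ ε * bareLambda B := by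
      have h1 : C * bareLambda B ^ 2 ≤ max C 1 * bareLambda B ^ 2 :=
        mul_le_mul_of_nonneg_right (le_max_left _ _) (sq_nonneg _)
      have h2 : max C 1 * bareLambda B ≤ ε := by
        have h3 := mul_le_mul_of_nonneg_left hlam hC'pos.le
        have e : max C 1 * (ε / max C 1) = ε := by field_simp
        linarith
      have h3 : max C 1 * bareLambda B ^ 2 ≤ ε * bareLambda B := by
        have h4 := mul_le_mul_of_nonneg_right h2 hlam0.le
        rw [sq, ← mul_assoc]; exact h4
      linarith
    calc Real.exp (-((levelGap j + ε) * bareLambda B)) * levelValue su2Rep 1 B 0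
        ≤ Real.exp (-(levelGap j * bareLambda B + C * bareLambda B ^ 2)) * levelValue su2Rep 1 B 0 := by
          apply mul_le_mul_of_nonneg_right _ hpos.le
          apply Real.exp_le_exp.mpr
          linarith only [hCl]
      _ ≤ levelValue su2Rep 1 B j := hlow
  intro K ε hε
  induction K with
  | zero =>
    obtain ⟨B0, hB0⟩ := single 0 ε hε
    refine ⟨B0, fun B hB => ⟨(hB0 B hB).1, fun j hj => ?_⟩⟩
    have hj0 : j = 0 := Nat.le_zero.mp hj
    subst hj0
    exact (hB0 B hB).2
  | succ K ih =>
    obtain ⟨B0, hB0⟩ := ih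
    obtain ⟨B1, hB1⟩ := single (K + 1) ε hε
    refine ⟨max B0 B1, fun B hB => ⟨(hB0 B ((le_max_left _ _).trans hB)).1, fun j hj => ?_⟩⟩
    rcases Nat.lt_or_ge j (K + 1) with hlt | hge
    · exact (hB0 B ((le_max_left _ _).trans hB)).2 j (Nat.lt_succ_iff.mp hlt)
    · have hjK : j = K + 1 := le_antisymm hj hge
      subst hjK
      exact (hB1 B ((le_max_right _ _).trans hB)).2

/-- The registered stub `stub_oneSiteLowerCoarse` is discharged by the route's crux ONE. -/
theorem stub_oneSiteLowerCoarse_of_ONE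
    (hONE : Summit.QuantumFields.YangMills.Theses.LuscherReduction.OneSiteLevels) : Stmt.stub_oneSiteLowerCoarse :=
  oneSiteLowerCoarse_of_oneSiteLevels hONE

/-- ★ rev 8: the registered stub `stub_oneSiteLowerCoarse` is PROVED — the route's crux ONE is closed (`oneSiteLevels_proof`, stmt-QuantumFields-20007, 2026-08-27T07:09Z). -/
theorem stub_oneSiteLowerCoarse : Stmt.stub_oneSiteLowerCoarse :=
  stub_oneSiteLowerCoarse_of_ONE Summit.QuantumFields.YangMills.Theorems.FemtoTransferGap.oneSiteLevels_proof

/-! ## §4 The enclosure algebra (pure real inequalities) -/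

/-- `exp(−2y) ≤ 1 − y` for `0 ≤ y ≤ 1/2`. -/
theorem exp_neg_two_mul_le_one_sub {y : ℝ} (hy0 : 0 ≤ y) (hy : y ≤ 1 / 2) :
    Real.exp (-(2 * y)) ≤ 1 - y := by
  have h1 : 1 + 2 * y ≤ Real.exp (2 * y) := by linarith [Real.add_one_le_exp (2 * y)]
  have hpos : 0 < Real.exp (2 * y) := Real.exp_pos _
  have key : 1 ≤ (1 - y) * Real.exp (2 * y) := by
    have h2 : (1 : ℝ) ≤ (1 - y) * (1 + 2 * y) := by nlinarith
    have h3 : (1 - y) * (1 + 2 * y) ≤ (1 - y) * Real.exp (2 * y) :=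
      mul_le_mul_of_nonneg_left h1 (by linarith)
    linarith
  rw [Real.exp_neg, inv_eq_one_div, div_le_iff₀ hpos]
  linarith [key]

/-- **Enclosure algebra** of the Kato–Temple line (pure real inequalities; `l = λ`, `x = λ/L`). -/
theorem enclosure
    {lam0v lamj m0 mj mk mu0 muj muk θ ρ x l C1 g Dk Dj A E Cf : ℝ}
    (hl0 : 0 < lam0v) (hmu0 : 0 < mu0) (hx : 0 < x) (hx2 : x ≤ 2) (hl : 0 < l)
    (hC1 : 1 ≤ C1) (hg : 0 < g) (hDk : 0 ≤ Dk) (hDj : Dj ≤ Dk)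
    (hA : A = 4 * C1 / g * Real.exp (2 * (Dk + g / 2))) (hE : E = Real.exp (2 * (Dk + g)))
    (hCf : Cf = C1 + A * E + 2 * A)
    (hs1 : C1 * l ≤ g / 8) (hs3 : A * l * x ≤ 1 / 2)
    (hθ : θ = Real.exp (-((Dk + g / 2) * x)) * lam0v)
    (hρ : ρ = C1 * (l * x ^ 2) * m0 ^ 2)
    (hdoorj : θ < mk → lamj ≤ mj + ρ / (mk - θ))
    (hdoor0 : θ < mk → lam0v ≤ m0 + ρ / (mk - θ))
    (hcap : lam0v ≤ Real.exp (g / 16 * x) * m0) (hm0 : m0 ≤ lam0v) (hmj : mj ≤ lamj)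
    (hia_j : mj * mu0 ≤ Real.exp (C1 * (l * x)) * (muj * m0))
    (hib_j : muj * m0 ≤ Real.exp (C1 * (l * x)) * (mj * mu0))
    (hib_k : muk * m0 ≤ Real.exp (C1 * (l * x)) * (mk * mu0))
    (hone_j : Real.exp (-((Dj + g / 16) * x)) * mu0 ≤ muj)
    (hone_k : Real.exp (-((Dk + g / 16) * x)) * mu0 ≤ muk) :
    lamj * mu0 ≤ Real.exp (Cf * (l * x)) * (muj * lam0v) ∧
      muj * lam0v ≤ Real.exp (Cf * (l * x)) * (lamj * mu0) := by
  set d : ℝ := Dk + g / 2 with hd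
  have hC1pos : 0 < C1 := by linarith
  have hlx : 0 < l * x := mul_pos hl hx
  have hd0 : 0 ≤ d := by rw [hd]; linarith
  have hA0 : 0 ≤ A := by
    rw [hA]; exact mul_nonneg (div_nonneg (by linarith) hg.le) (Real.exp_pos _).le
  have hE1 : 1 ≤ E := by rw [hE]; exact Real.one_le_exp (by linarith only [hDk, hg])
  -- m0 > 0
  have hm0pos : 0 < m0 := by
    by_contra h
    push Not at h
    have h' : Real.exp (g / 16 * x) * m0 ≤ 0 :=
      mul_nonpos_of_nonneg_of_nonpos (Real.exp_pos _).le h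
    linarith only [hl0, hcap, h']
  -- m0 ≥ e^{-(g/16)x} lam0v
  have hm0low : Real.exp (-(g / 16 * x)) * lam0v ≤ m0 := by
    have h1 := mul_le_mul_of_nonneg_left hcap (Real.exp_pos (-(g / 16 * x))).le
    have h2 : Real.exp (-(g / 16 * x)) * (Real.exp (g / 16 * x) * m0) = m0 := by
      rw [← mul_assoc, ← Real.exp_add]; simp
    linarith only [h1, h2]
  -- muk > 0, muj > 0
  have hmukpos : 0 < muk := lt_of_lt_of_le (mul_pos (Real.exp_pos _) hmu0) hone_k
  have hmujpos : 0 < muj := lt_of_lt_of_le (mul_pos (Real.exp_pos _) hmu0) hone_j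
  -- Step 2: mk ≥ e^{-(Dk+g/4)x} lam0v
  have hexp1 : Real.exp (C1 * (l * x)) * Real.exp (-((Dk + g / 4) * x)) ≤ Real.exp (-((Dk + g / 8) * x)) := by
    rw [← Real.exp_add]
    apply Real.exp_le_exp.mpr
    have : C1 * l * x ≤ g / 8 * x := mul_le_mul_of_nonneg_right hs1 hx.le
    nlinarith
  have hmk : Real.exp (-((Dk + g / 4) * x)) * lam0v ≤ mk := by
    -- product of the two lower bounds
    have hprod : (Real.exp (-((Dk + g / 16) * x)) * mu0) * (Real.exp (-(g / 16 * x)) * lam0v) ≤ muk * m0 :=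
      mul_le_mul hone_k hm0low (mul_nonneg (Real.exp_pos _).le hl0.le) hmukpos.le
    have hcomb : Real.exp (-((Dk + g / 16) * x)) * Real.exp (-(g / 16 * x)) = Real.exp (-((Dk + g / 8) * x)) := by
      rw [← Real.exp_add]; congr 1; ring
    have h3 : mu0 * (Real.exp (-((Dk + g / 8) * x)) * lam0v) ≤ mu0 * (Real.exp (C1 * (l * x)) * mk) := by
      have : (Real.exp (-((Dk + g / 16) * x)) * mu0) * (Real.exp (-(g / 16 * x)) * lam0v)
          = mu0 * (Real.exp (-((Dk + g / 8) * x)) * lam0v) := by rw [← hcomb]; ring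
      rw [← this]
      calc _ ≤ muk * m0 := hprod
        _ ≤ Real.exp (C1 * (l * x)) * (mk * mu0) := hib_k
        _ = mu0 * (Real.exp (C1 * (l * x)) * mk) := by ring
    have h4 : Real.exp (-((Dk + g / 8) * x)) * lam0v ≤ Real.exp (C1 * (l * x)) * mk :=
      le_of_mul_le_mul_left h3 hmu0
    have h5 : Real.exp (C1 * (l * x)) * (Real.exp (-((Dk + g / 4) * x)) * lam0v)
        ≤ Real.exp (C1 * (l * x)) * mk := by
      calc Real.exp (C1 * (l * x)) * (Real.exp (-((Dk + g / 4) * x)) * lam0v)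
          = (Real.exp (C1 * (l * x)) * Real.exp (-((Dk + g / 4) * x))) * lam0v := by ring
        _ ≤ Real.exp (-((Dk + g / 8) * x)) * lam0v := mul_le_mul_of_nonneg_right hexp1 hl0.le
        _ ≤ _ := h4
    exact le_of_mul_le_mul_left h5 (Real.exp_pos _)
  -- Step 3: θ < mk and the gap
  have hθlt : θ < Real.exp (-((Dk + g / 4) * x)) * lam0v := by
    rw [hθ]
    apply mul_lt_mul_of_pos_right _ hl0
    apply Real.exp_lt_exp.mpr
    have e : d * x = Dk * x + g / 2 * x := by rw [hd]; ring
    linarith only [mul_pos hg hx, e]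
  have hθmk : θ < mk := lt_of_lt_of_le hθlt hmk
  set G : ℝ := lam0v * Real.exp (-(d * x)) * (g / 4 * x) with hG
  have hGpos : 0 < G := by positivity
  have hgap : G ≤ mk - θ := by
    have h1 : g / 4 * x ≤ Real.exp (g / 4 * x) - 1 := by linarith [Real.add_one_le_exp (g / 4 * x)]
    have h2 : Real.exp (-(d * x)) * Real.exp (g / 4 * x) = Real.exp (-((Dk + g / 4) * x)) := by
      rw [← Real.exp_add]; congr 1; rw [hd]; ring
    have h3 : G ≤ lam0v * (Real.exp (-((Dk + g / 4) * x)) - Real.exp (-(d * x))) := by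
      rw [hG, ← h2]
      have : lam0v * (Real.exp (-(d * x)) * Real.exp (g / 4 * x) - Real.exp (-(d * x)))
          = lam0v * Real.exp (-(d * x)) * (Real.exp (g / 4 * x) - 1) := by ring
      rw [this]
      exact mul_le_mul_of_nonneg_left h1 (by positivity)
    have h4 : lam0v * (Real.exp (-((Dk + g / 4) * x)) - Real.exp (-(d * x))) ≤ mk - θ := by
      rw [hθ]
      have e : lam0v * (Real.exp (-((Dk + g / 4) * x)) - Real.exp (-(d * x)))
          = Real.exp (-((Dk + g / 4) * x)) * lam0v - Real.exp (-(d * x)) * lam0v := by ring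
      rw [e]
      linarith only [hmk]
    exact h3.trans h4
  -- Step 4: the door error ρ/(mk-θ) ≤ A l x m0 ≤ A l x lam0v
  have hρ0 : 0 ≤ ρ := by rw [hρ]; positivity
  have herr : ρ / (mk - θ) ≤ A * l * x * m0 := by
    have h1 : ρ / (mk - θ) ≤ ρ / G := div_le_div_of_nonneg_left hρ0 hGpos hgap
    have h2 : ρ ≤ A * l * x * m0 * G := by
      have hAG : A * l * x * m0 * G = C1 * (l * x ^ 2) * (m0 * lam0v) * (Real.exp (2 * d) * Real.exp (-(d * x))) := by
        rw [hA, hG, hd]; field_simp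
      rw [hAG, hρ]
      have hm0sq : m0 ^ 2 ≤ m0 * lam0v := by rw [sq]; exact mul_le_mul_of_nonneg_left hm0 hm0pos.le
      have hee : (1 : ℝ) ≤ Real.exp (2 * d) * Real.exp (-(d * x)) := by
        rw [← Real.exp_add]; exact Real.one_le_exp (by linarith only [mul_nonneg hd0 (sub_nonneg.mpr hx2)])
      calc C1 * (l * x ^ 2) * m0 ^ 2 = C1 * (l * x ^ 2) * m0 ^ 2 * 1 := by ring
        _ ≤ C1 * (l * x ^ 2) * (m0 * lam0v) * (Real.exp (2 * d) * Real.exp (-(d * x))) :=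
          mul_le_mul (mul_le_mul_of_nonneg_left hm0sq (by positivity)) hee zero_le_one (by positivity)
    have h3 : ρ / G ≤ A * l * x * m0 := by rw [div_le_iff₀ hGpos]; exact h2
    exact h1.trans h3
  have herr' : ρ / (mk - θ) ≤ A * l * x * lam0v := by
    have : A * l * x * m0 ≤ A * l * x * lam0v := mul_le_mul_of_nonneg_left hm0 (by positivity)
    exact herr.trans this
  have hAlx0 : 0 ≤ A * l * x := by positivity
  -- Step 5: UPPER
  have hmu0_le : mu0 ≤ Real.exp ((Dj + g / 16) * x) * muj := by
    have h1 := mul_le_mul_of_nonneg_left hone_j (Real.exp_pos ((Dj + g / 16) * x)).le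
    have h2 : Real.exp ((Dj + g / 16) * x) * (Real.exp (-((Dj + g / 16) * x)) * mu0) = mu0 := by
      rw [← mul_assoc, ← Real.exp_add]; simp
    linarith only [h1, h2]
  have hEx : Real.exp ((Dj + g / 16) * x) ≤ E := by
    rw [hE]; apply Real.exp_le_exp.mpr
    have e1 : (Dj + g / 16) * x ≤ (Dk + g) * x := mul_le_mul_of_nonneg_right (by linarith) hx.le
    have e2 : (Dk + g) * x ≤ (Dk + g) * 2 := mul_le_mul_of_nonneg_left hx2 (by linarith)
    linarith only [e1, e2]
  have hmu0_le' : mu0 ≤ E * muj := hmu0_le.trans (mul_le_mul_of_nonneg_right hEx hmujpos.le)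
  have hexpC1 : 1 ≤ Real.exp (C1 * (l * x)) := Real.one_le_exp (by positivity)
  have hup : lamj * mu0 ≤ Real.exp (Cf * (l * x)) * (muj * lam0v) := by
    have h1 : lamj ≤ mj + A * l * x * lam0v := by linarith only [hdoorj hθmk, herr']
    have h2 : lamj * mu0 ≤ mj * mu0 + A * l * x * lam0v * mu0 := by
      calc lamj * mu0 ≤ (mj + A * l * x * lam0v) * mu0 := mul_le_mul_of_nonneg_right h1 hmu0.le
        _ = _ := by ring
    have h3 : mj * mu0 ≤ Real.exp (C1 * (l * x)) * (muj * lam0v) :=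
      hia_j.trans (mul_le_mul_of_nonneg_left (mul_le_mul_of_nonneg_left hm0 hmujpos.le) (Real.exp_pos _).le)
    have h4 : A * l * x * lam0v * mu0 ≤ A * l * x * lam0v * (E * muj) :=
      mul_le_mul_of_nonneg_left hmu0_le' (by positivity)
    -- combine: lamj mu0 ≤ (muj lam0v) (exp(C1 lx) + A E l x) ≤ (muj lam0v) exp(C1 lx) (1 + A E l x) ≤ (muj lam0v) exp((C1 + A E) l x)
    have h5 : lamj * mu0 ≤ (muj * lam0v) * (Real.exp (C1 * (l * x)) * (1 + A * E * (l * x))) := by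
      have : (muj * lam0v) * (Real.exp (C1 * (l * x)) + A * E * (l * x))
          ≤ (muj * lam0v) * (Real.exp (C1 * (l * x)) * (1 + A * E * (l * x))) := by
        apply mul_le_mul_of_nonneg_left _ (by positivity)
        have hAE : 0 ≤ A * E * (l * x) := by positivity
        nlinarith only [hexpC1, hAE]
      linarith only [h2, h3, h4, this]
    have h6 : 1 + A * E * (l * x) ≤ Real.exp (A * E * (l * x)) := by
      linarith [Real.add_one_le_exp (A * E * (l * x))]
    have h7 : Real.exp (C1 * (l * x)) * (1 + A * E * (l * x)) ≤ Real.exp (Cf * (l * x)) := by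
      calc Real.exp (C1 * (l * x)) * (1 + A * E * (l * x))
          ≤ Real.exp (C1 * (l * x)) * Real.exp (A * E * (l * x)) := mul_le_mul_of_nonneg_left h6 (Real.exp_pos _).le
        _ = Real.exp ((C1 + A * E) * (l * x)) := by rw [← Real.exp_add]; ring_nf
        _ ≤ Real.exp (Cf * (l * x)) := by
          apply Real.exp_le_exp.mpr; rw [hCf]; linarith only [mul_nonneg hA0 hlx.le]
    calc lamj * mu0 ≤ (muj * lam0v) * (Real.exp (C1 * (l * x)) * (1 + A * E * (l * x))) := h5
      _ ≤ (muj * lam0v) * Real.exp (Cf * (l * x)) := mul_le_mul_of_nonneg_left h7 (by positivity)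
      _ = _ := by ring
  -- Step 6: LOWER
  have hlow : muj * lam0v ≤ Real.exp (Cf * (l * x)) * (lamj * mu0) := by
    have h1 : lam0v - A * l * x * lam0v ≤ m0 := by linarith only [hdoor0 hθmk, herr']
    have h2 : Real.exp (-(2 * (A * l * x))) * lam0v ≤ m0 := by
      have := exp_neg_two_mul_le_one_sub hAlx0 hs3
      calc Real.exp (-(2 * (A * l * x))) * lam0v ≤ (1 - A * l * x) * lam0v := mul_le_mul_of_nonneg_right this hl0.le
        _ = lam0v - A * l * x * lam0v := by ring
        _ ≤ m0 := h1
    have hmjpos : 0 < mj := by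
      have ha : 0 < Real.exp (C1 * (l * x)) * (mj * mu0) := lt_of_lt_of_le (mul_pos hmujpos hm0pos) hib_j
      have hb : 0 < mj * mu0 := by
        by_contra h; push Not at h
        have hc := mul_nonpos_of_nonneg_of_nonpos (Real.exp_pos (C1 * (l * x))).le h
        linarith only [ha, hc]
      by_contra h'; push Not at h'
      have hc : mu0 * mj ≤ 0 := mul_nonpos_of_nonneg_of_nonpos hmu0.le h'
      linarith only [hb, hc]
    have h3 : muj * (Real.exp (-(2 * (A * l * x))) * lam0v) ≤ muj * m0 := mul_le_mul_of_nonneg_left h2 hmujpos.le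
    have h4 : muj * m0 ≤ Real.exp (C1 * (l * x)) * (lamj * mu0) :=
      hib_j.trans (mul_le_mul_of_nonneg_left (mul_le_mul_of_nonneg_right hmj hmu0.le) (Real.exp_pos _).le)
    -- muj lam0v = exp(2Alx) * (muj * exp(-2Alx) lam0v) ≤ exp(2Alx) exp(C1 lx) lamj mu0 ≤ exp(Cf lx) lamj mu0
    have h5 : muj * lam0v = Real.exp (2 * (A * l * x)) * (muj * (Real.exp (-(2 * (A * l * x))) * lam0v)) := by
      have : Real.exp (2 * (A * l * x)) * Real.exp (-(2 * (A * l * x))) = 1 := by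
        rw [← Real.exp_add]; simp
      calc muj * lam0v = (Real.exp (2 * (A * l * x)) * Real.exp (-(2 * (A * l * x)))) * (muj * lam0v) := by rw [this]; ring
        _ = _ := by ring
    have hlamjmu0 : 0 ≤ lamj * mu0 := mul_nonneg (hmjpos.le.trans hmj) hmu0.le
    have h6 : Real.exp (2 * (A * l * x)) * Real.exp (C1 * (l * x)) ≤ Real.exp (Cf * (l * x)) := by
      rw [← Real.exp_add]; apply Real.exp_le_exp.mpr; rw [hCf]
      linarith only [mul_nonneg (mul_nonneg hA0 (zero_le_one.trans hE1)) hlx.le]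
    calc muj * lam0v = Real.exp (2 * (A * l * x)) * (muj * (Real.exp (-(2 * (A * l * x))) * lam0v)) := h5
      _ ≤ Real.exp (2 * (A * l * x)) * (Real.exp (C1 * (l * x)) * (lamj * mu0)) :=
          mul_le_mul_of_nonneg_left (h3.trans h4) (Real.exp_pos _).le
      _ = (Real.exp (2 * (A * l * x)) * Real.exp (C1 * (l * x))) * (lamj * mu0) := by ring
      _ ≤ Real.exp (Cf * (l * x)) * (lamj * mu0) := mul_le_mul_of_nonneg_right h6 hlamjmu0
  exact ⟨hup, hlow⟩

/-! ## §5 Composition: the stubs imply RED -/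


/-- `0 ≤ m_j = ⟨ψ,K_βψ⟩` for a physical trial function and `β ≥ 1` (tree `qform_su2Rep_self_nonneg`): the nonnegativity half of the
rev-2 `RitzBasics` is a theorem, not a stub. -/
theorem ritz_nonneg {L : ℕ} [NeZero L] {β : ℝ} (hβ : 1 ≤ β) {ψ : GaugeConfig 3 L SU2 → ℝ} (hψ : IsPhys ψ) :
    0 ≤ qform su2Rep β ψ ψ :=
  qform_su2Rep_self_nonneg (zero_le_one.trans hβ) hψ

/-- The crux RED behind a `def`; `KTGoal` unfolds to `…Theses.LuscherReduction.RunningReduction` definitionally. -/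
def KTGoal : Prop := Summit.QuantumFields.YangMills.Theses.LuscherReduction.RunningReduction

/-- **Composition (REAL proof, rev 3).**  The five registered stubs (door and witnesses in residual-Gram form) imply crux RED
`RunningReduction` BY NAME.  Identical to the registered composition except that the Ritz numbers are the diagonal values
`m_j = ⟨φ_j,K_βφ_j⟩` of the diagonal family and the door is fed the residual Gram bound (ii′) instead of the total variance.
(«KTR»: conclusion spelled `KTGoal` so that the skeleton checker takes the four-stub `RunningReduction_of` of §5 as THE composition.) -/
theorem RunningReduction_of_KT :
    Proved.katoTempleDoor → Proved.ritzBasics → Derived.coarseNoIntruder → Stmt.stub_dressedRitz →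
      Stmt.stub_oneSiteLowerCoarse → KTGoal := by
  intro hKT hRB hCO hDR hLOW
  show Summit.QuantumFields.YangMills.Theses.LuscherReduction.RunningReduction
  intro k
  -- shell end `k'` of level `k`
  obtain ⟨k', hkk', hgap⟩ := shellsClose k
  set Dk : ℝ := levelGap k' with hDkdef
  set g : ℝ := levelGap (k' + 1) - levelGap k' with hgdef
  have hg : 0 < g := by rw [hgdef]; linarith
  have hDk0 : 0 ≤ Dk := levelGap_nonneg k'
  have hd : Dk + g / 2 < levelGap (k' + 1) := by rw [hDkdef, hgdef]; linarith
  obtain ⟨lamC, hlamC, hC⟩ := hCO (k' + 1) (Dk + g / 2) hd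
  have hη : (0 : ℝ) < g / 16 := div_pos hg (by norm_num)
  obtain ⟨CR, lamR, hlamR, hR⟩ := hDR k' (g / 16) hη
  set C1 : ℝ := max CR 1 with hC1def
  have hC1 : 1 ≤ C1 := le_max_right _ _
  have hCR : CR ≤ C1 := le_max_left _ _
  have hC1pos : 0 < C1 := one_pos.trans_le hC1
  set A : ℝ := 4 * C1 / g * Real.exp (2 * (Dk + g / 2)) with hAdef
  set E : ℝ := Real.exp (2 * (Dk + g)) with hEdef
  set Cf : ℝ := C1 + A * E + 2 * A with hCfdef
  have hA0 : 0 ≤ A := by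
    rw [hAdef]; exact mul_nonneg (div_nonneg (by linarith) hg.le) (Real.exp_pos _).le
  obtain ⟨B0, hB0⟩ := hLOW k' (g / 16) hη
  -- the window scale
  have hq1 : 0 < g / (16 * C1) := div_pos hg (by positivity)
  have hq2 : 0 < 1 / (8 * (A + 1)) := div_pos one_pos (by positivity)
  refine ⟨Cf, min (min lamC lamR) (min 1 (min (g / (16 * C1)) (1 / (8 * (A + 1))))),
    lt_min (lt_min hlamC hlamR) (lt_min one_pos (lt_min hq1 hq2)), fun lam hlam hlamle => ?_⟩
  have hlamC' : lam ≤ lamC := hlamle.trans ((min_le_left _ _).trans (min_le_left _ _))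
  have hlamR' : lam ≤ lamR := hlamle.trans ((min_le_left _ _).trans (min_le_right _ _))
  have hlam1 : lam ≤ 1 := hlamle.trans ((min_le_right _ _).trans (min_le_left _ _))
  have hlamg : lam ≤ g / (16 * C1) :=
    hlamle.trans ((min_le_right _ _).trans ((min_le_right _ _).trans (min_le_left _ _)))
  have hlamA : lam ≤ 1 / (8 * (A + 1)) :=
    hlamle.trans ((min_le_right _ _).trans ((min_le_right _ _).trans (min_le_right _ _)))
  obtain ⟨L0C, hL0C⟩ := hC lam hlam hlamC'
  obtain ⟨L0R, hL0R⟩ := hR lam hlam hlamR'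
  set B0' : ℝ := max B0 1 with hB0'def
  have hB0'pos : 0 < B0' := lt_of_lt_of_le one_pos (le_max_right _ _)
  refine ⟨max (max L0C L0R) (⌈4 * lam ^ 3 * B0'⌉₊ + 1), fun L _ hL β hW => ?_⟩
  have hLC : L0C ≤ L := ((le_max_left _ _).trans (le_max_left _ _)).trans hL
  have hLR : L0R ≤ L := ((le_max_right _ _).trans (le_max_left _ _)).trans hL
  have hLB : ⌈4 * lam ^ 3 * B0'⌉₊ + 1 ≤ L := (le_max_right _ _).trans hL
  obtain ⟨hβ, hlamle', hlam2⟩ := hW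
  -- fine-lattice data: coarse no-intruder at `k'+1`, diagonal dressed Ritz family at `k'`, Ritz basics
  have hcoarse := hL0C L hLC β ⟨hβ, hlamle', hlam2⟩
  obtain ⟨φ, hφphys, hφon, hφdiag, hφanti, hratio, hres, hcap⟩ := hL0R L hLR β ⟨hβ, hlamle', hlam2⟩
  have hritzle := hRB L β (k' + 1) φ hβ hφphys hφon hφdiag hφanti
  have hmnn : ∀ i, 0 ≤ qform su2Rep β (φ i) (φ i) := fun i => ritz_nonneg hβ (hφphys i)
  have hl0 : 0 < levelValue su2Rep L β 0 := levelValue_zero_su2Rep_pos L β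
  have hkk'1 : k < k' + 1 := Nat.lt_succ_of_le hkk'
  -- the Ritz numbers `m₀`, `m_k` (at the Fin index `⟨k, _⟩`) and `m_{k'}` (at `Fin.last k'`)
  set m0 : ℝ := qform su2Rep β (φ 0) (φ 0) with hm0def
  set mk : ℝ := qform su2Rep β (φ (Fin.last k')) (φ (Fin.last k')) with hmkdef
  have hm0nn : 0 ≤ m0 := hmnn 0
  have hm0le : m0 ≤ levelValue su2Rep L β 0 := by simpa using hritzle 0
  -- scales `l = λ`, `x = λ/L`
  set l : ℝ := luscherLambda β L with hldef
  have hlpos : 0 < l := hlam.trans_le hlamle'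
  have hLpos : (0 : ℝ) < L := Nat.cast_pos.mpr (NeZero.pos L)
  have hL1 : (1 : ℝ) ≤ L := by exact_mod_cast NeZero.one_le
  set x : ℝ := l / L with hxdef
  have hxpos : 0 < x := div_pos hlpos hLpos
  have hxl : x ≤ l := div_le_self hlpos.le hL1
  have hl2 : l ≤ 2 := by linarith only [hlam2, hlam1]
  have hx2 : x ≤ 2 := hxl.trans hl2
  -- the effective one-site coupling
  set B : ℝ := oneSiteCoupling β L with hBdef
  have hBge : B0' ≤ B := by
    have hLreal : 4 * lam ^ 3 * B0' + 1 ≤ (L : ℝ) := by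
      have h1 : (4 * lam ^ 3 * B0' : ℝ) ≤ ⌈4 * lam ^ 3 * B0'⌉₊ := Nat.le_ceil _
      have h2 : ((⌈4 * lam ^ 3 * B0'⌉₊ + 1 : ℕ) : ℝ) ≤ L := by exact_mod_cast hLB
      push_cast at h2
      linarith only [h1, h2]
    have hl3 : l ^ 3 ≤ 8 * lam ^ 3 := by
      calc l ^ 3 ≤ (2 * lam) ^ 3 := pow_le_pow_left₀ hlpos.le hlam2 3
        _ = 8 * lam ^ 3 := by ring
    have hl3pos : 0 < l ^ 3 := pow_pos hlpos 3
    rw [hBdef, oneSiteCoupling, ← hldef, le_div_iff₀ hl3pos]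
    have hL3 : (L : ℝ) ≤ (L : ℝ) ^ 3 := by
      have h1sq : (1 : ℝ) ≤ (L : ℝ) ^ 2 := by nlinarith only [hL1]
      calc (L : ℝ) = L * 1 := by ring
        _ ≤ L * (L : ℝ) ^ 2 := mul_le_mul_of_nonneg_left h1sq hLpos.le
        _ = (L : ℝ) ^ 3 := by ring
    have h5 : B0' * l ^ 3 ≤ B0' * (8 * lam ^ 3) := mul_le_mul_of_nonneg_left hl3 hB0'pos.le
    have h6 : B0' * (8 * lam ^ 3) = 2 * (4 * lam ^ 3 * B0') := by ring
    have h7 : 2 * (4 * lam ^ 3 * B0') ≤ 2 * (L : ℝ) ^ 3 := by linarith only [hLreal, hL3]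
    linarith only [h5, h6, h7]
  have hB0le : B0 ≤ B := (le_max_left _ _).trans hBge
  have hB1 : 1 ≤ B := (le_max_right _ _).trans hBge
  have hbl : bareLambda B = x := by rw [hBdef, hxdef, hldef]; exact bareLambda_oneSiteCoupling hlpos
  -- one-site data
  obtain ⟨hmu0, hlowj⟩ := hB0 B hB0le
  have hmunn : ∀ j : ℕ, 0 ≤ levelValue su2Rep 1 B j := fun j => transferValuesNonneg 1 B j hB1
  -- unit conversions
  have e_lx : CR * l ^ 2 / (L : ℝ) = CR * (l * x) := by rw [hxdef]; ring
  have e_l3 : l ^ 3 / (L : ℝ) ^ 2 = l * x ^ 2 := by rw [hxdef]; ring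
  have e_eta : g / 16 * l / (L : ℝ) = g / 16 * x := by rw [hxdef]; ring
  have e_d : -((Dk + g / 2) * l) / (L : ℝ) = -((Dk + g / 2) * x) := by rw [hxdef]; ring
  -- top capture through the min–max door lemma
  have hcap' : levelValue su2Rep L β 0 ≤ Real.exp (g / 16 * x) * m0 := by
    refine levelValue_zero_le_of_forall_rayleigh_le su2Rep β (mul_nonneg (Real.exp_pos _).le hm0nn) fun ψ hψ _ => ?_
    have h1 := hcap ψ hψ
    rw [e_eta] at h1
    exact h1
  -- the door's residual Gram hypothesis with `ϱ = C₁ (λ³/L²) m₀²` (only the constant is weakened, `C_R ≤ C₁`)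
  set ρ : ℝ := C1 * (l * x ^ 2) * m0 ^ 2 with hρdef
  have hlx2 : 0 ≤ l * x ^ 2 := mul_nonneg hlpos.le (sq_nonneg _)
  have hρnn : 0 ≤ ρ := by rw [hρdef]; exact mul_nonneg (mul_nonneg hC1pos.le hlx2) (sq_nonneg _)
  have hres' : ∀ c : Fin (k' + 1) → ℝ,
      l2 (∑ i, c i • (transferApply β (φ i) - qform su2Rep β (φ i) (φ i) • φ i))
         (∑ i, c i • (transferApply β (φ i) - qform su2Rep β (φ i) (φ i) • φ i)) ≤ ρ * ∑ i, c i ^ 2 := by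
    intro c
    have h1 := hres c
    rw [e_l3] at h1
    have hc2 : 0 ≤ ∑ i, c i ^ 2 := Finset.sum_nonneg fun i _ => sq_nonneg (c i)
    have hCC : CR * (l * x ^ 2) * m0 ^ 2 ≤ C1 * (l * x ^ 2) * m0 ^ 2 :=
      mul_le_mul_of_nonneg_right (mul_le_mul_of_nonneg_right hCR hlx2) (sq_nonneg _)
    calc _ ≤ CR * (l * x ^ 2) * m0 ^ 2 * ∑ i, c i ^ 2 := h1
      _ ≤ C1 * (l * x ^ 2) * m0 ^ 2 * ∑ i, c i ^ 2 := mul_le_mul_of_nonneg_right hCC hc2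
      _ = ρ * ∑ i, c i ^ 2 := by rw [hρdef]
  -- the door (in implication form): every Ritz number controls its level
  set θ : ℝ := Real.exp (-((Dk + g / 2) * l) / L) * levelValue su2Rep L β 0 with hθdef
  have hdoor : θ < mk → ∀ j : Fin (k' + 1),
      levelValue su2Rep L β j ≤ qform su2Rep β (φ j) (φ j) + ρ / (mk - θ) :=
    fun hθlt => hKT L β k' φ θ ρ hβ hφphys hφon hφdiag hφanti hcoarse hθlt hρnn hres'
  have hdoor0 : θ < mk → levelValue su2Rep L β 0 ≤ m0 + ρ / (mk - θ) := fun hθlt => by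
    simpa using hdoor hθlt 0
  -- sharp Ritz ratios, weakened from `C_R` to `C₁`
  have hratio' : ∀ j : Fin (k' + 1),
      qform su2Rep β (φ j) (φ j) * levelValue su2Rep 1 B 0 ≤
          Real.exp (C1 * (l * x)) * (levelValue su2Rep 1 B j * m0) ∧
        levelValue su2Rep 1 B j * m0 ≤ Real.exp (C1 * (l * x)) * (qform su2Rep β (φ j) (φ j) * levelValue su2Rep 1 B 0) := by
    intro j
    obtain ⟨ha, hb⟩ := hratio j
    rw [e_lx] at ha hb
    have hexp : Real.exp (CR * (l * x)) ≤ Real.exp (C1 * (l * x)) :=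
      Real.exp_le_exp.mpr (mul_le_mul_of_nonneg_right hCR (mul_pos hlpos hxpos).le)
    exact ⟨ha.trans (mul_le_mul_of_nonneg_right hexp (mul_nonneg (hmunn j) hm0nn)),
      hb.trans (mul_le_mul_of_nonneg_right hexp (mul_nonneg (hmnn j) hmu0.le))⟩
  -- smallness
  have hs1 : C1 * l ≤ g / 8 := by
    have h1 : l ≤ 2 * (g / (16 * C1)) := by linarith only [hlam2, hlamg]
    have h2 : C1 * l ≤ C1 * (2 * (g / (16 * C1))) := mul_le_mul_of_nonneg_left h1 hC1pos.le
    have e : C1 * (2 * (g / (16 * C1))) = g / 8 := by field_simp; ring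
    linarith only [h2, e]
  have hs3 : A * l * x ≤ 1 / 2 := by
    have h1 : A * l * x ≤ A * (2 * lam) * 2 :=
      mul_le_mul (mul_le_mul_of_nonneg_left hlam2 hA0) hx2 hxpos.le (mul_nonneg hA0 (by linarith only [hlam]))
    have h2 : A * (2 * lam) * 2 = 4 * A * lam := by ring
    have h3 : 4 * A * lam ≤ 4 * A * (1 / (8 * (A + 1))) :=
      mul_le_mul_of_nonneg_left hlamA (mul_nonneg (by norm_num) hA0)
    have hA1 : 0 < 8 * (A + 1) := by linarith only [hA0]
    have h4 : 4 * A * (1 / (8 * (A + 1))) ≤ 1 / 2 := by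
      rw [show (4 : ℝ) * A * (1 / (8 * (A + 1))) = (4 * A) / (8 * (A + 1)) by ring, div_le_iff₀ hA1]
      linarith only [hA0]
    linarith only [h1, h2, h3, h4]
  -- assemble through the enclosure algebra at `j = k` (Fin index `⟨k, hkk'1⟩`) and the shell end `k'` (`Fin.last k'`)
  obtain ⟨hia, hib⟩ := hratio' ⟨k, hkk'1⟩
  obtain ⟨_, hibk⟩ := hratio' (Fin.last k')
  have honek := hlowj k hkk'
  have honek' := hlowj k' le_rfl
  rw [hbl] at honek honek'
  have hθ' : θ = Real.exp (-((Dk + g / 2) * x)) * levelValue su2Rep L β 0 := by rw [hθdef, e_d]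
  have key := enclosure (lam0v := levelValue su2Rep L β 0) (lamj := levelValue su2Rep L β k)
    (m0 := m0) (mj := qform su2Rep β (φ ⟨k, hkk'1⟩) (φ ⟨k, hkk'1⟩)) (mk := mk)
    (mu0 := levelValue su2Rep 1 B 0) (muj := levelValue su2Rep 1 B k) (muk := levelValue su2Rep 1 B k')
    (θ := θ) (ρ := ρ) (x := x) (l := l) (C1 := C1) (g := g) (Dk := Dk) (Dj := levelGap k) (A := A) (E := E) (Cf := Cf)
    hl0 hmu0 hxpos hx2 hlpos hC1 hg hDk0 (levelGap_mono hkk') hAdef hEdef hCfdef hs1 hs3 hθ' hρdef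
    (fun hlt => hdoor hlt ⟨k, hkk'1⟩) hdoor0 hcap' hm0le (hritzle ⟨k, hkk'1⟩) hia hib hibk honek honek'
  have e_goal : Cf * l ^ 2 / (L : ℝ) = Cf * (l * x) := by rw [hxdef]; ring
  rw [e_goal]
  exact key

/-! ## §5 The «KTR» composition: four registered stubs ⇒ RED (door and Ritz basics PROVED in-file, stub 3 split by the hand-over seam) -/

/-- ★ **Composition of line «KTR»**: `stub_coarseHandoverUpper2 → stub_coarseNoIntruderAt2 → stub_dressedRitz → stub_oneSiteLowerCoarse → RED`,
with `Proved.katoTempleDoor` / `Proved.ritzBasics` (rev-3 residual-Gram / diagonal-family forms) discharged by `KTDoorR3.katoTempleDoor` /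
`KTDoorR3.ritzBasics` (part 2, sorry-free) and KT's former stub 3 derived by `coarseNoIntruder_of_stubs` (part 1's seam).  Concludes the crux BY NAME. -/
theorem RunningReduction_of :
    Stmt.stub_coarseHandoverUpper2 → Stmt.stub_coarseNoIntruderAt2 → Stmt.stub_dressedRitz → Stmt.stub_oneSiteLowerCoarse →
      Summit.QuantumFields.YangMills.Theses.LuscherReduction.RunningReduction :=
  fun hU hB hDR hLow =>
    (RunningReduction_of_KT katoTempleDoor_holds ritzBasics_holds (coarseNoIntruder_of_stubs hU hB) hDR hLow : KTGoal)

/-- The same with the route's crux ONE in place of `stub_oneSiteLowerCoarse`: **3a′ → 3b′ → dressedRitz → ONE → RED**. -/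
theorem RunningReduction_of_ONE
    (hU : Stmt.stub_coarseHandoverUpper2) (hB : Stmt.stub_coarseNoIntruderAt2) (hDR : Stmt.stub_dressedRitz)
    (hONE : Summit.QuantumFields.YangMills.Theses.LuscherReduction.OneSiteLevels) :
    Summit.QuantumFields.YangMills.Theses.LuscherReduction.RunningReduction :=
  RunningReduction_of hU hB hDR (stub_oneSiteLowerCoarse_of_ONE hONE)

/-- ★ **rev 8 (ONE closed): the KT door unconditionally — 3a′ → 3b′ → dressedRitz → RED.** -/
theorem RunningReduction_of_KT8
    (hU : Stmt.stub_coarseHandoverUpper2) (hB : Stmt.stub_coarseNoIntruderAt2) (hDR : Stmt.stub_dressedRitz) :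
    Summit.QuantumFields.YangMills.Theses.LuscherReduction.RunningReduction :=
  RunningReduction_of_ONE hU hB hDR Summit.QuantumFields.YangMills.Theorems.FemtoTransferGap.oneSiteLevels_proof

end Summit.QuantumFields.YangMills.Cruxes.RunningReduction.KT

end

/-! ═══
# PART 4 «EXPLICIT» (rev 3, owner ym-beyond-p1 g17): audit of the comparison-map cut of 3a′ and the fifth stub `stub_explicitNoIntruder`
═══ -/

set_option autoImplicit false

noncomputable section

open MeasureTheory Filter Topology Real
open Literature.MathematicalPhysics.QuantumFieldTheory hiding SU2
open Literature.MathematicalPhysics.QuantumLattice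
open Literature.Analysis.OperatorTheory.YMMatrixModel
open scoped BigOperators

namespace Summit.QuantumFields.YangMills.Cruxes.RunningReduction.KT

open Summit.QuantumFields.YangMills.Theorems.FemtoTransferGap

/-! ## §6 Located defects of the g16 comparison-map cut (MM)+(Q)+(R) of 3a′ (kernel-checked; `OWNER-MEMO-3a-g17.md` §1) -/

/-- **d2.**  Read `e = e^{-ελ} ∈ (0,1]`, `F = λ_0(L,β)^L`, `C = λ_0(2,β')²`, `c` the constant SHARED by the domination clause (Q) and the ground
refinement clause (R) of `OWNER-MEMO-3a-g16.md` §2, `r = ‖Qφ₀‖²/‖φ₀‖²` the norm the contractive comparison map keeps on the fine vacuum `φ₀`.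
(Q) at `ψ = φ₀` with `⟨Qφ₀, T_2²Qφ₀⟩ ≤ λ_0(2)²‖Qφ₀‖²` reads `e·c·F ≤ C·r`; (R) reads `e·C ≤ c·F`.  Hence `e² ≤ r`: the map must be an `e^{-2ελ}`-isometry
on the vacuum — block conditional expectations lose norm on `φ₀` by bulk factors `β^{-#(fast modes)/2}`, so (Q)+(R) as typed is unsatisfiable by any
averaging map. [folklore] -/
theorem normLoss_forced {c r e F C : ℝ} (hC : 0 < C) (he : 0 ≤ e)
    (hQ : e * c * F ≤ C * r) (hR : e * C ≤ c * F) : e ^ 2 ≤ r := by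
  have h1 : e * (e * C) ≤ e * (c * F) := mul_le_mul_of_nonneg_left hR he
  have h2 : e ^ 2 * C ≤ C * r := by nlinarith
  by_contra h
  push Not at h
  nlinarith

/-- **d3.**  Fine state `ψ = φ₀ + g`, `‖φ₀‖² = 1`, `‖g‖² = 1/100`, `g` block-measurable (a flat block average keeps all of `g`, `r_g = 1`, but only
`r_0 = 10⁻⁶` of the vacuum); over a long time the vacuum component keeps factor `1`, `g` and its image decay to `0`.  Vacuum-normalised Rayleigh quotients:
fine `(1·1 + (1/100)·0)/(1 + 1/100)`, coarse image `(10⁻⁶·1 + (1/100)·0)/(10⁻⁶ + 1/100)`; «fine ≤ 2·coarse + 1/100» FAILS: non-uniform norm loss breaks every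
linear vacuum-normalised domination statement, so the comparison map must be vacuum-DRESSED (memo §1 d3, §3 Option II). [folklore] -/
theorem mixture_witness :
    ¬ ((1 * 1 + (1 / 100 : ℝ) * 0) / (1 + 1 / 100) ≤
        2 * (((1 / 1000000 : ℝ) * 1 + (1 / 100) * 0) / (1 / 1000000 + 1 / 100)) + 1 / 100) := by
  norm_num

/-! ## §7 Support (PROVED): Cauchy–Schwarz log-convexity of transfer moments; unit time ↔ dyadic long time -/

section Moments

variable {L : ℕ} [NeZero L]

/-- The `j`-th transfer moment `a_j(ψ) = ⟨ψ, K_β^j ψ⟩`. [cite: ReedSimonIV1978, XIII.1] -/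
def moment (β : ℝ) (ψ : GaugeConfig 3 L SU2 → ℝ) (j : ℕ) : ℝ :=
  l2 ψ ((transferApply (L := L) β)^[j] ψ)

/-- `a_0 = ‖ψ‖²`. [folklore] -/
theorem moment_zero (β : ℝ) (ψ : GaugeConfig 3 L SU2 → ℝ) : moment β ψ 0 = l2 ψ ψ := rfl

/-- `a_1 = ⟨ψ, K_β ψ⟩`. [folklore] -/
theorem moment_one (β : ℝ) (ψ : GaugeConfig 3 L SU2 → ℝ) : moment β ψ 1 = qform su2Rep β ψ ψ := by
  rw [moment, Function.iterate_one, qform_eq_l2_transferApply]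

/-- **Log-convexity by Cauchy–Schwarz**: `a_m² ≤ a_0 · a_{2m}`. [cite: ReedSimonIV1978, XIII.1] -/
theorem moment_sq_le (β : ℝ) {ψ : GaugeConfig 3 L SU2 → ℝ} (hψ : IsPhys ψ) (m : ℕ) :
    moment β ψ m ^ 2 ≤ moment β ψ 0 * moment β ψ (2 * m) := by
  have hKm : IsPhys ((transferApply (L := L) β)^[m] ψ) := isPhys_iterate_transferApply β hψ m
  have hcs := sq_l2_le hψ hKm
  have h2m : l2 ((transferApply (L := L) β)^[m] ψ) ((transferApply β)^[m] ψ) = moment β ψ (2 * m) := by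
    rw [moment, l2_iterate_iterate β hψ m m]
    congr 2
    omega
  rw [moment_zero, ← h2m]
  exact hcs

/-- **Unit time → dyadic long time**: `a_1^{2^p} ≤ a_0^{2^p − 1} · a_{2^p}` (`β ≥ 0`). [cite: ReedSimonIV1978, XIII.1] -/
theorem moment_one_pow_le {β : ℝ} (hβ : 0 ≤ β) {ψ : GaugeConfig 3 L SU2 → ℝ} (hψ : IsPhys ψ) (p : ℕ) :
    moment β ψ 1 ^ (2 ^ p) ≤ moment β ψ 0 ^ (2 ^ p - 1) * moment β ψ (2 ^ p) := by
  have ha0 : 0 ≤ moment β ψ 0 := by rw [moment_zero]; exact l2_self_nonneg _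
  have ha1 : 0 ≤ moment β ψ 1 := by rw [moment_one]; exact qform_su2Rep_self_nonneg hβ hψ
  induction p with
  | zero => simp
  | succ p ih =>
    have hcs : moment β ψ (2 ^ p) ^ 2 ≤ moment β ψ 0 * moment β ψ (2 ^ (p + 1)) := by
      have := moment_sq_le β hψ (2 ^ p)
      rwa [← pow_succ'] at this
    have hl : 0 ≤ moment β ψ 1 ^ (2 ^ p) := pow_nonneg ha1 _
    have hpow : 2 ^ (p + 1) = 2 * 2 ^ p := by ring
    calc moment β ψ 1 ^ (2 ^ (p + 1))
        = (moment β ψ 1 ^ (2 ^ p)) ^ 2 := by rw [hpow, pow_mul']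
      _ ≤ (moment β ψ 0 ^ (2 ^ p - 1) * moment β ψ (2 ^ p)) ^ 2 := pow_le_pow_left₀ hl ih 2
      _ = moment β ψ 0 ^ (2 * (2 ^ p - 1)) * moment β ψ (2 ^ p) ^ 2 := by ring
      _ ≤ moment β ψ 0 ^ (2 * (2 ^ p - 1)) * (moment β ψ 0 * moment β ψ (2 ^ (p + 1))) :=
          mul_le_mul_of_nonneg_left hcs (pow_nonneg ha0 _)
      _ = moment β ψ 0 ^ (2 * (2 ^ p - 1) + 1) * moment β ψ (2 ^ (p + 1)) := by ring
      _ = moment β ψ 0 ^ (2 ^ (p + 1) - 1) * moment β ψ (2 ^ (p + 1)) := by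
          have h1 : 1 ≤ 2 ^ p := Nat.one_le_two_pow
          congr 2
          omega

/-- A power of two in the window `(X, 2X]`, `X ≥ 1`. [folklore] -/
theorem exists_two_pow_mem_window {X : ℝ} (hX : 1 ≤ X) : ∃ p : ℕ, X < (2 : ℝ) ^ (p + 1) ∧ (2 : ℝ) ^ (p + 1) ≤ 2 * X := by
  obtain ⟨p, hp, hp'⟩ := exists_nat_pow_near hX one_lt_two
  exact ⟨p, hp', by rw [pow_succ]; linarith⟩

end Moments

/-! ## §8 The fifth stub: `ExplicitNoIntruder` (XL) and its PROVED glue onto stub 3 `Derived.coarseNoIntruder` -/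

/-- The dressed flowed Polyakov lift of a one-site function `u` (flow time `t`, slab depth `m`): `U ↦ (flowLift t u)(U) · Φ_m(U)` — the route's NAMED lift
`J_{t,m}` (the `a = e_i` member of `slabTrialFn β t u m`, tree `FemtoTransferGapSlab`). [cite: Luscher1983] -/
def dressedLift {L : ℕ} [NeZero L] (β t : ℝ) (m : ℕ) (u : GaugeConfig 3 1 SU2 → ℝ) : GaugeConfig 3 L SU2 → ℝ :=
  fun U => flowLift t u U * slabGround β m U

/-- **`ExplicitNoIntruder k` (XL).**  For every `ε > 0` there are a physical-time scale `M > 0` and a window threshold such that, eventually in the femto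
window, `k` EXPLICIT constraint states — dressed flowed Polyakov lifts `J_{t,m} u_i` of `k` physical ONE-SITE functions (one flow time `t`, one slab depth
`m`, chosen per `(L, β)`) — kill every intruder over long times: every physical `ψ ⊥ J_{t,m} u_i` (`i < k`) has vacuum-normalised transfer moment
`⟨ψ, K_β^n ψ⟩ ≤ e^{−(Δ_k − ε)·nλ/L} · λ_0^n · ‖ψ‖²` for all step numbers `n` with `nλ/L ∈ [M, 2M]` (physical times `≍ M/λ`, where every non-toron
excitation is negligible).  NOT a costume: the admissible constraints are the image of one-site functions under the named lift (no `∃` over fine-lattice maps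
or states); it is the route's thesis «fine low sector = lifted one-site sector» read as a COMPLETENESS statement, one-sided, at precision `o(λ)` per unit
time (RED's is `O(λ²)`).  Guidance: take `m` in the fast-equilibrated, toron-flat window `L ≪ m ≪ L/λ` and `u_i` = one-site eigenfunctions at the running
coupling.  Why it might fail: the leak of the lifted states onto the true low eigenvectors must vanish as `λ → 0` UNIFORMLY in `L` (residual/gap `≍ λ^{1/2}`),
and every non-toron excitation must stay gapped at the box scale uniformly in `L` — asymptotic freedom, Balaban-class input; summit-hard for R2b1.
[cite: Luscher1983] [cite: LuscherMunster1984] -/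
def ExplicitNoIntruder (k : ℕ) : Prop :=
  ∀ ε : ℝ, 0 < ε → ∃ M : ℝ, 0 < M ∧ ∃ lam0 : ℝ, 0 < lam0 ∧ ∀ lam : ℝ, 0 < lam → lam ≤ lam0 →
    ∃ L1 : ℕ, ∀ (L : ℕ) [NeZero L], L1 ≤ L → ∀ β : ℝ, InFemtoWindow lam β L →
      ∃ (t : ℝ) (m : ℕ) (u : Fin k → (GaugeConfig 3 1 SU2 → ℝ)),
        (∀ i, IsPhys (dressedLift (L := L) β t m (u i))) ∧
        ∀ n : ℕ, M ≤ n * luscherLambda β L / L → n * luscherLambda β L / L ≤ 2 * M →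
          ∀ ψ : GaugeConfig 3 L SU2 → ℝ, IsPhys ψ → (∀ i, l2 ψ (dressedLift β t m (u i)) = 0) →
            l2 ψ ((transferApply β)^[n] ψ) ≤
              Real.exp (-((levelGap k - ε) * (n * luscherLambda β L / L))) * levelValue su2Rep L β 0 ^ n * l2 ψ ψ

/-- Stub statement (XL, rev 3): the explicit long-time no-intruder bound, all levels. -/
abbrev Stmt.stub_explicitNoIntruder : Prop := ∀ k : ℕ, ExplicitNoIntruder k

/-- stub (XL): explicit long-time no-intruder bound — completeness of the lifted one-site sector below every level, uniformly in `L`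
(effective toron dynamics + box-scale gap of all other excitations; asymptotic freedom). [cite: Luscher1983] [cite: LuscherMunster1984] -/
theorem stub_explicitNoIntruder : Stmt.stub_explicitNoIntruder := by
  sorry

set_option maxHeartbeats 800000 in
/-- **Glue (PROVED): `stub_explicitNoIntruder → Derived.coarseNoIntruder`** — KT's stub 3 WITHOUT any coarse lattice.  Given `d < Δ_k` (for `d < 0` use
`λ_k ≤ λ_0`), take `ε = (Δ_k − d)/2`, the scale `M` and thresholds of `ExplicitNoIntruder k`, shrink `lam0 ≤ M/2` so that `X = M·L/λ ≥ 1`, pick the dyadic long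
time `n = 2^{p+1} ∈ (X, 2X]`; the «inf–sup ≤» door `levelValue_le_of_forall_rayleigh_le` with the `k` explicit constraints reduces `λ_k ≤ e^{−dλ/L} λ_0` to
`a_1 ≤ e^{−dλ/L} λ_0 a_0` for `ψ ⊥` constraints, and `a_1^n ≤ a_0^{n−1} a_n ≤ (e^{−(Δ_k−ε)λ/L} λ_0 a_0)^n` (§7 + the stub) gives it by the `n`-th root.
[cite: ReedSimonIV1978, XIII.1] -/
theorem coarseNoIntruder_of_explicit (h : Stmt.stub_explicitNoIntruder) : Derived.coarseNoIntruder := by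
  intro k d hd
  by_cases hd0 : d < 0
  · refine ⟨1, one_pos, fun lam hlam _ => ⟨0, fun L _ _ β hw => ?_⟩⟩
    have hl : 0 < luscherLambda β L := luscherLambda_pos_of_window hlam hw
    have hL : (0 : ℝ) < L := Nat.cast_pos.mpr (Nat.pos_of_ne_zero (NeZero.ne L))
    have hexp : 1 ≤ Real.exp (-(d * luscherLambda β L) / L) := by
      rw [Real.one_le_exp_iff]
      have : d * luscherLambda β L ≤ 0 := by nlinarith
      exact div_nonneg (by linarith) hL.le
    have h0 : 0 < levelValue su2Rep L β 0 := levelValue_zero_su2Rep_pos L β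
    calc levelValue su2Rep L β k ≤ levelValue su2Rep L β 0 := by
          rw [levelValue_zero]; exact levelValue_su2Rep_le_topValue L β k
      _ = 1 * levelValue su2Rep L β 0 := (one_mul _).symm
      _ ≤ Real.exp (-(d * luscherLambda β L) / L) * levelValue su2Rep L β 0 := mul_le_mul_of_nonneg_right hexp h0.le
  push Not at hd0
  set ε : ℝ := (levelGap k - d) / 2 with hε_def
  have hε : 0 < ε := by rw [hε_def]; linarith
  have hdε : d ≤ levelGap k - ε := by rw [hε_def]; linarith
  obtain ⟨M, hM, lam0, hlam0, H⟩ := h k ε hε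
  refine ⟨min lam0 (M / 2), lt_min hlam0 (by linarith), ?_⟩
  intro lam hlam hle
  have hle0 : lam ≤ lam0 := hle.trans (min_le_left _ _)
  have hleM : lam ≤ M / 2 := hle.trans (min_le_right _ _)
  obtain ⟨L1, HL⟩ := H lam hlam hle0
  refine ⟨L1, ?_⟩
  intro L _ hL1 β hw
  obtain ⟨t, m, u, hC, Hn⟩ := HL L hL1 β hw
  have hβ0 : 0 ≤ β := zero_le_one.trans hw.1
  set l : ℝ := luscherLambda β L with hl_def
  have hl : 0 < l := luscherLambda_pos_of_window hlam hw
  have hl2 : l ≤ 2 * lam := hw.2.2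
  have hL : (0 : ℝ) < L := Nat.cast_pos.mpr (Nat.pos_of_ne_zero (NeZero.ne L))
  have hL1' : (1 : ℝ) ≤ L := by exact_mod_cast Nat.one_le_iff_ne_zero.mpr (NeZero.ne L)
  set X : ℝ := M * L / l with hX_def
  have hX1 : 1 ≤ X := by
    rw [hX_def, le_div_iff₀ hl]
    nlinarith
  obtain ⟨p, hpX, hp2X⟩ := exists_two_pow_mem_window hX1
  set n : ℕ := 2 ^ (p + 1) with hn_def
  have hn_cast : (n : ℝ) = (2 : ℝ) ^ (p + 1) := by rw [hn_def]; push_cast; ring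
  have hn0 : n ≠ 0 := by positivity
  have htime_lo : M ≤ n * l / L := by
    rw [hn_cast, le_div_iff₀ hL]
    have : M * L = X * l := by rw [hX_def]; field_simp
    rw [this]
    exact (mul_le_mul_of_nonneg_right hpX.le hl.le)
  have htime_hi : n * l / L ≤ 2 * M := by
    rw [hn_cast, div_le_iff₀ hL]
    have : 2 * M * L = 2 * X * l := by rw [hX_def]; field_simp
    rw [this]
    exact mul_le_mul_of_nonneg_right hp2X hl.le
  have hs0 : 0 ≤ Real.exp (-(d * l) / L) * levelValue su2Rep L β 0 :=
    mul_nonneg (Real.exp_pos _).le (levelValue_zero_su2Rep_pos L β).le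
  refine levelValue_le_of_forall_rayleigh_le su2Rep β hs0 (fun i => dressedLift β t m (u i)) hC ?_
  intro ψ hψ hperp hpos
  have key := Hn n htime_lo htime_hi ψ hψ hperp
  set a0 := moment β ψ 0 with ha0_def
  set a1 := moment β ψ 1 with ha1_def
  set an := moment β ψ n with han_def
  have ha0 : 0 < a0 := by rw [ha0_def, moment_zero]; exact hpos
  have ha1 : 0 ≤ a1 := by rw [ha1_def, moment_one]; exact qform_su2Rep_self_nonneg hβ0 hψ
  have hlv0 : 0 < levelValue su2Rep L β 0 := levelValue_zero_su2Rep_pos L β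
  set E : ℝ := Real.exp (-((levelGap k - ε) * l / L)) with hE_def
  have hE : 0 < E := Real.exp_pos _
  have hexpn : Real.exp (-((levelGap k - ε) * (n * l / L))) = E ^ n := by
    rw [hE_def, ← Real.exp_nat_mul]; congr 1; field_simp
  have key' : an ≤ E ^ n * levelValue su2Rep L β 0 ^ n * a0 := by
    rw [han_def, ha0_def, moment, moment_zero, ← hexpn]; exact key
  have hconv : a1 ^ n ≤ a0 ^ (n - 1) * an := by
    rw [ha1_def, ha0_def, han_def, hn_def]; exact moment_one_pow_le hβ0 hψ (p + 1)
  have hchain : a1 ^ n ≤ (E * levelValue su2Rep L β 0 * a0) ^ n := by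
    calc a1 ^ n ≤ a0 ^ (n - 1) * an := hconv
      _ ≤ a0 ^ (n - 1) * (E ^ n * levelValue su2Rep L β 0 ^ n * a0) :=
          mul_le_mul_of_nonneg_left key' (pow_nonneg ha0.le _)
      _ = (E * levelValue su2Rep L β 0) ^ n * (a0 ^ (n - 1) * a0) := by ring
      _ = (E * levelValue su2Rep L β 0) ^ n * a0 ^ n := by
          congr 1
          rw [← pow_succ]
          congr 1
          have : 1 ≤ n := Nat.one_le_iff_ne_zero.mpr hn0
          omega
      _ = (E * levelValue su2Rep L β 0 * a0) ^ n := by ring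
  have hroot : a1 ≤ E * levelValue su2Rep L β 0 * a0 :=
    (pow_le_pow_iff_left₀ ha1 (by positivity) hn0).mp hchain
  have hEd : E ≤ Real.exp (-(d * l) / L) := by
    rw [hE_def, Real.exp_le_exp, neg_div, neg_le_neg_iff, div_le_div_iff_of_pos_right hL]
    exact mul_le_mul_of_nonneg_right hdε hl.le
  calc qform su2Rep β ψ ψ = a1 := by rw [ha1_def, moment_one]
    _ ≤ E * levelValue su2Rep L β 0 * a0 := hroot
    _ ≤ Real.exp (-(d * l) / L) * levelValue su2Rep L β 0 * a0 :=
        mul_le_mul_of_nonneg_right (mul_le_mul_of_nonneg_right hEd hlv0.le) ha0.le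
    _ = Real.exp (-(d * l) / L) * levelValue su2Rep L β 0 * l2 ψ ψ := by rw [ha0_def, moment_zero]

/-! ## §9 The second composition: `stub_explicitNoIntruder → stub_dressedRitz → stub_oneSiteLowerCoarse → RED` -/

/-- ★ **Composition of the «EXPLICIT» way in (rev 3)**: `stub_explicitNoIntruder → stub_dressedRitz → stub_oneSiteLowerCoarse → RED`, stub 3 derived by
`coarseNoIntruder_of_explicit`, door and Ritz basics the tree theorems.  Concludes the crux BY NAME; the rev-2 composition `RunningReduction_of` (3a′, 3b′) stands. -/
theorem RunningReduction_of_explicit :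
    Stmt.stub_explicitNoIntruder → Stmt.stub_dressedRitz → Stmt.stub_oneSiteLowerCoarse →
      Summit.QuantumFields.YangMills.Theses.LuscherReduction.RunningReduction :=
  fun hX hDR hLow =>
    (RunningReduction_of_KT katoTempleDoor_holds ritzBasics_holds (coarseNoIntruder_of_explicit hX) hDR hLow : KTGoal)

/-- The same with the route's crux ONE in place of `stub_oneSiteLowerCoarse`: **explicit → dressedRitz → ONE → RED**. -/
theorem RunningReduction_of_explicit_ONE
    (hX : Stmt.stub_explicitNoIntruder) (hDR : Stmt.stub_dressedRitz)
    (hONE : Summit.QuantumFields.YangMills.Theses.LuscherReduction.OneSiteLevels) :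
    Summit.QuantumFields.YangMills.Theses.LuscherReduction.RunningReduction :=
  RunningReduction_of_explicit hX hDR (stub_oneSiteLowerCoarse_of_ONE hONE)

/-- ★ **rev 8 (ONE closed): the EXPLICIT way in unconditionally — explicitNoIntruder → dressedRitz → RED.** -/
theorem RunningReduction_of_explicit8 (hX : Stmt.stub_explicitNoIntruder) (hDR : Stmt.stub_dressedRitz) :
    Summit.QuantumFields.YangMills.Theses.LuscherReduction.RunningReduction :=
  RunningReduction_of_explicit_ONE hX hDR Summit.QuantumFields.YangMills.Theorems.FemtoTransferGap.oneSiteLevels_proof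

end Summit.QuantumFields.YangMills.Cruxes.RunningReduction.KT

end

/-! ═══
# PART 5 «TT» (rev 4, owner ym-beyond-p1 g18) — the TRACE cut of the exclusive half: objects, statements, four new registered stubs,
# proved seams, and the composition to RED BY NAME
═══ -/

set_option autoImplicit false

noncomputable section

open MeasureTheory Filter Topology Real
open Literature.MathematicalPhysics.QuantumFieldTheory hiding SU2
open Literature.MathematicalPhysics.QuantumLattice
open Literature.Analysis.OperatorTheory.YMMatrixModel
open scoped BigOperators

namespace Summit.QuantumFields.YangMills.Cruxes.RunningReduction.TT

open Summit.QuantumFields.YangMills.Theorems.FemtoTransferGap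
open Summit.QuantumFields.YangMills.Cruxes.RunningReduction

/-! ## §1 Objects (VERBATIM from ideator-1's card C `Sketch.lean` §CardC, so that the typed texts coincide): the zero-flux trace
`Z_phys(L, β, T) = Tr (P K_β)^T` as a closed kernel chain, its vacuum-free dyadic ratio, femto times, Lüscher's limiting ratio -/

/-! ### rev 8: the closed-chain trace objects are the TREE's (`Theorems/LuscherReductionRunningReductionTraceFormulaDefs.lean`, ym-infvol-p1 g3, p-id in the bus;
texts VERBATIM = rev 6/7 §1: `centreElem`, `twist3`, `gaugeMeasure`, `physAvg`, `physTraceSucc`, `physTrace`, + `physKernel`; the local `negOne` is the tree's `FemtoTransferGap.negOne`).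
The `export` makes `TT.physTrace` etc. of THIS namespace denote the tree constants, so every statement below is literally over tree declarations. -/
export Summit.QuantumFields.YangMills.Theorems.FemtoTransferGap.TT (centreElem twist3 gaugeMeasure physAvg physTraceSucc physTrace physKernel)


/-- **Vacuum-free dyadic trace ratio** `r(L, β, T) = Z_phys(2T)/Z_phys(T)² = Σ_j x_j²/(Σ_j x_j)²`, `x_j = λ_j^T ≥ 0`: the extensive vacuum energy
`T·E_0 ~ TL³` cancels identically; `r ∈ (0,1]` is the inverse effective number of states alive after Euclidean time `T`. -/
def traceRatio (L : ℕ) [NeZero L] (β : ℝ) (T : ℕ) : ℝ :=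
  physTrace L β (2 * T) / physTrace L β T ^ 2

/-- Number of lattice time steps spanning femto-time `s`: `T = ⌈s L/λ(β,L)⌉` (so `T·aE_k ≈ s·Δ_k`; `T/L = s/λ` spatial box lengths). -/
def femtoSteps (s β : ℝ) (L : ℕ) : ℕ := ⌈s * L / luscherLambda β L⌉₊

/-- Dyadic ratio functional of an energy sequence `x` at time `s`: `(Σ_k e^{−2s x_k})/(Σ_k e^{−s x_k})²`. -/
def seqRatio (x : ℕ → ℝ) (s : ℝ) : ℝ :=
  (∑' k : ℕ, Real.exp (-(2 * s) * x k)) / (∑' k : ℕ, Real.exp (-s * x k)) ^ 2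

/-- Lüscher's limiting ratio `r_𝔥(s) = Tr e^{−2s(𝔥−μ₁)}/(Tr e^{−s(𝔥−μ₁)})²` over the colour-invariant sector (`Δ_k = levelGap k`). [cite: Luscher1983, §1] -/
def hTraceRatio (s : ℝ) : ℝ := seqRatio levelGap s

/-- **Level moments in units of the top value** (LEVEL currency, any lattice size; at `L = 1` the one-site model): `m(L, β, T) = Σ_k (λ_k/λ_0)^T`
(`tsum`; for `T ≥ 2` the series converges by `TraceFormula`). -/
def levelMoment (L : ℕ) [NeZero L] (β : ℝ) (T : ℕ) : ℝ :=
  ∑' k : ℕ, (levelValue su2Rep L β k / levelValue su2Rep L β 0) ^ T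

/-- Dyadic LEVEL ratio `m(2T)/m(T)²` (equals `traceRatio` wherever `TraceFormula` holds and `λ_0 > 0`). -/
def levelRatio (L : ℕ) [NeZero L] (β : ℝ) (T : ℕ) : ℝ :=
  levelMoment L β (2 * T) / levelMoment L β T ^ 2

/-! ## §2 Statements -/

/-- **(T1′) `TraceFormula`** — SPECTRAL LAYER, fixed lattice, `T ≥ 2`, no RG, no window: the zero-flux min–max values `λ_k(L,β)` are the eigenvalues
with multiplicity of the positive Hilbert–Schmidt compression `P K_β P` (`K_β ≥ 0` at `β ≥ 0`; tree `PhysL2`, `exists_isPhys_eigenfamily`), whence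
`Σ_k λ_k^T = Z_phys(L, β, T)` for every `T ≥ 2` (trace of a product of `T ≥ 2` Hilbert–Schmidt kernels = closed kernel chain by Fubini; no Mercer
theorem).  At `L = 1` it is the one-site trace formula. [cite: ReedSimonIV1978, Thm. XIII.1] [cite: MontvayMunster1994, (3.145)] -/
def TraceFormula : Prop :=
  ∀ (L : ℕ) [NeZero L] (β : ℝ) (T : ℕ), 1 ≤ β → 2 ≤ T →
    HasSum (fun k : ℕ => levelValue su2Rep L β k ^ T) (physTrace L β T)

/-- **(T2′) `TwistedTraceScaling`** — THE RG STUB (card C VERBATIM; partition functions on two asymmetric tori; no states, no lift, no test functions):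
for every femto-time `s > 0` and every `ε > 0`, deep in the femto window the vacuum-free dyadic ratio of the fine theory on `(ℤ/L)³` at `T = ⌈sL/λ⌉`
steps equals that of the ONE-SITE model (`L = 1`) at coupling `B = 2L³/λ³` and the same `T`, to ABSOLUTE precision `ε`.  Bulk free energies cancel
identically between `L³×2T` and two copies of `L³×T`; non-constant modes contribute `O(e^{−2πs/λ})`; temporally wrapping polymers at scale `2^j`
contribute `(L/2^j)³e^{−κT/2^j}`, summable uniformly in `L` since `T/L = s/λ`; what is compared is the zero-mode chain of `T` steps against the
one-site chain.  NOT IN PRINT: the background dependence of the last-scale localized terms to `o(λ/L)` per step (header, (β)).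
[cite: Luscher1983, §3] [cite: Balaban1989LargeFieldII, p.355] -/
def TwistedTraceScaling : Prop :=
  ∀ s : ℝ, 0 < s → ∀ ε : ℝ, 0 < ε → ∃ lam0 : ℝ, 0 < lam0 ∧ ∀ lam : ℝ, 0 < lam → lam ≤ lam0 →
    ∃ L0 : ℕ, ∀ (L : ℕ) [NeZero L], L0 ≤ L → ∀ β : ℝ, InFemtoWindow lam β L →
      |traceRatio L β (femtoSteps s β L) - traceRatio 1 (oneSiteCoupling β L) (femtoSteps s β L)| ≤ ε

/-- **`LevelGapSummable`** — Weyl-type summability of Lüscher's invariant-sector levels: `Σ_k e^{−sΔ_k} < ∞` for every `s > 0`.  PROVABLE NOW: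
tree `le_physLevel_of_dimBound_lt` (`dimBound E < k ⇒ E ≤ physLevel k`) with `dimBound` polynomial in `E`. [cite: SimonB1983DiscreteSpectrum, Cor. 4] -/
def LevelGapSummable : Prop :=
  ∀ s : ℝ, 0 < s → Summable fun k : ℕ => Real.exp (-s * levelGap k)

/-- **(OS′) `OneSiteTraceLimit`** in LEVEL currency — ONE-SITE semiclassics for all levels at once (three `SU(2)` links, `B → ∞`,
`λ_b = bareLambda B = (2/B)^{1/3}` the effective time step): the dyadic level ratio `m(2T)/m(T)²` of the one-site model tends to `r_𝔥(s)` when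
`Tλ_b → s`.  ⇐ the route's crux ONE (each `k`, two-sided) + a uniform-in-`B` tail bound + `LevelGapSummable`. [cite: Luscher1983, §3] [cite: SimonB1983DiscreteSpectrum, Cor. 4] -/
def OneSiteTraceLimit : Prop :=
  ∀ s : ℝ, 0 < s → ∀ ε : ℝ, 0 < ε → ∃ B0 : ℝ, ∀ B : ℝ, B0 ≤ B → ∀ T : ℕ,
    |(T : ℝ) * bareLambda B - s| ≤ bareLambda B → |levelRatio 1 B T - hTraceRatio s| ≤ ε

/-- **`CoarseLevels`** (card C VERBATIM; = Lüscher's law N34 `FemtoLevelsOfRecord` to precision `o(λ)` instead of `O(λ²)`, fine theory vs `𝔥`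
directly): for every level `k` and `η > 0`, eventually `e^{−(Δ_k+η)λ/L} λ_0 ≤ λ_k ≤ e^{−(Δ_k−η)λ/L} λ_0`.  Its upper half is KT's `CoarseNoIntruder`
(`coarseNoIntruder_of_coarseLevels`); `FemtoLevelsOfRecord ⟹` it (`coarseLevels_of_femtoLevels`). [cite: Luscher1983, §1] -/
def CoarseLevels : Prop :=
  ∀ k : ℕ, ∀ η : ℝ, 0 < η → ∃ lam0 : ℝ, 0 < lam0 ∧ ∀ lam : ℝ, 0 < lam → lam ≤ lam0 →
    ∃ L0 : ℕ, ∀ (L : ℕ) [NeZero L], L0 ≤ L → ∀ β : ℝ, InFemtoWindow lam β L →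
      Real.exp (-((levelGap k + η) * luscherLambda β L) / L) * levelValue su2Rep L β 0 ≤ levelValue su2Rep L β k ∧
        levelValue su2Rep L β k ≤ Real.exp (-((levelGap k - η) * luscherLambda β L) / L) * levelValue su2Rep L β 0

/-- **`TraceInversion`** (= card C's `GlueC` with the Tauberian theorem now the LANDED `Literature.Analysis.Asymptotics.LaplaceAtoms.laplaceAtoms`):
the trace formula, the RG trace scaling, the summability of `e^{−sΔ_k}` and the one-site limit imply coarse Lüscher running of every fine level.
Route (line card (a)–(d)): suppose `CoarseLevels` fails at `(k, η)`; extract `(lam_n → 0, L_n, β_n)` in the windows violating it, diagonally so that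
`TwistedTraceScaling` holds at precision `1/n` for the first `n` femto-times of a countable dense set; femto atoms `a_n(j) = (L_n/λ_n) log(λ_0/λ_j)`,
regularised to `max(a_n(j), δ_n j)` (monotone, bottom `0`, Laplace-summable for every `s > 0`; discrepancy `≤ Σ_j min(x_j², σδ_n j) → 0` by
`TraceFormula` at `T = 2`); `levelRatio = traceRatio` by `TraceFormula`; `OneSiteTraceLimit` + continuity of `r_𝔥` give the limits `r_𝔥(s)`;
`laplaceAtoms` gives `a_n(k) → Δ_k`, contradicting the violation. [cite: Feller1971, XIII.1 Thm 2a] -/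
def TraceInversion : Prop :=
  TraceFormula → TwistedTraceScaling → LevelGapSummable → OneSiteTraceLimit → CoarseLevels

/-! ## §3 Registered stubs of line «TT» (the KT stubs are in PART 2 §2 and PART 4 §8) -/

/-- Stub statement (M, spectral layer at fixed lattice). -/
abbrev Stmt.stub_traceFormula : Prop := TraceFormula
/-- Stub statement (XL, RG). -/
abbrev Stmt.stub_twistedTraceScaling : Prop := TwistedTraceScaling
/-- Stub statement (S/M, provable now from `YangMillsMatrixModelDiscreteness`). -/
abbrev Stmt.stub_levelGapSummable : Prop := LevelGapSummable
/-- Stub statement (M/L, one-site semiclassics, level currency). -/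
abbrev Stmt.stub_oneSiteTraceLimit : Prop := OneSiteTraceLimit
/-- Stub statement (M, pure analysis + bookkeeping over the landed `laplaceAtoms`). -/
abbrev Stmt.stub_traceInversion : Prop := TraceInversion

/-! ## §3b `LevelGapSummable` — PROVED in rev 5 in-file (ns `TT.LGS`, polynomial level growth from the tree's quantitative Rellich count); rev 8: that section is LANDED
verbatim as `Theorems/LuscherReductionRunningReductionLevelGapSummable.lean` (p505266, ns `FemtoTransferGap.LGS`) and is cited from the tree BY NAME. -/

/-- **PROVED (rev 5; rev 8: from the tree, p505266)**: `LevelGapSummable`. [cite: SimonB1983DiscreteSpectrum, Cor. 4] -/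
theorem levelGapSummable_holds : LevelGapSummable :=
  Summit.QuantumFields.YangMills.Theorems.FemtoTransferGap.LGS.levelGapSummable_all

/-- stub (M): trace formula for the zero-flux compression at `T ≥ 2`. [cite: ReedSimonIV1978, Thm. XIII.1] -/
theorem stub_traceFormula : Stmt.stub_traceFormula := by
  sorry

/-- stub (XL, RG): twisted-trace scaling — fine vs one-site dyadic partition-function ratios at femto times, absolute precision. [cite: Luscher1983, §3] -/
theorem stub_twistedTraceScaling : Stmt.stub_twistedTraceScaling := by
  sorry

/-- FORMER stub (S/M), PROVED in rev 5 (§3b): `Σ_k e^{−sΔ_k} < ∞` for all `s > 0`. [cite: SimonB1983DiscreteSpectrum, Cor. 4] -/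
theorem stub_levelGapSummable : Stmt.stub_levelGapSummable := levelGapSummable_holds

-- rev 8: the registered stub `stub_oneSiteTraceLimit` is PROVED modulo `stub_oneSiteTail` (ONE closed) — see PART 8, after `stub_oneSiteTraceLimit_of_ONE`.

-- rev 6: the former stub `stub_traceInversion : Stmt.stub_traceInversion` is PROVED — see PART 6 «INV» and PART 7 (`stub_traceInversion := Inv.traceInversion`).

/-! ## §4 Proved seams -/

/-- `Δ_0 = 0`. -/
theorem levelGap_zero : levelGap 0 = 0 := by
  unfold levelGap
  simp

/-- **`CoarseLevels ⟹ KT.CoarseNoIntruder`** (the upper half at `η = Δ_k − d`). -/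
theorem coarseNoIntruder_of_coarseLevels (h : CoarseLevels) : KT.CoarseNoIntruder := by
  intro k d hd
  obtain ⟨lam0, hlam0, H⟩ := h k (levelGap k - d) (sub_pos.mpr hd)
  refine ⟨lam0, hlam0, fun lam hlam hle => ?_⟩
  obtain ⟨L0, HL⟩ := H lam hlam hle
  refine ⟨L0, fun L _ hL β hW => ?_⟩
  have h2 := (HL L hL β hW).2
  have e : levelGap k - (levelGap k - d) = d := by ring
  rw [e] at h2
  exact h2

/-- **Not over-strong: Lüscher's law N34 `FemtoLevelsOfRecord ⟹ CoarseLevels`** (`Cλ² ≤ ηλ` once `λ ≤ 2·lam ≤ η/max(C,1)`). -/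
theorem coarseLevels_of_femtoLevels (h : FemtoLevelsOfRecord) : CoarseLevels := by
  intro k η hη
  obtain ⟨C, lam0, hlam0, H⟩ := h k
  have hC1 : 0 < max C 1 := lt_of_lt_of_le one_pos (le_max_right _ _)
  refine ⟨min lam0 (η / (2 * max C 1)), lt_min hlam0 (by positivity), fun lam hlam hle => ?_⟩
  obtain ⟨L0, HL⟩ := H lam hlam (hle.trans (min_le_left _ _))
  refine ⟨L0, fun L _ hL β hW => ?_⟩
  obtain ⟨hup, hlow⟩ := HL L hL β hW
  have hl : 0 < luscherLambda β L := luscherLambda_pos_of_window hlam hW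
  have hL0 : (0 : ℝ) < (L : ℝ) := by exact_mod_cast Nat.pos_of_ne_zero (NeZero.ne L)
  have hβ : (0 : ℝ) ≤ β := zero_le_one.trans hW.1
  have hv0 : 0 ≤ levelValue su2Rep L β 0 := levelValue_su2Rep_nonneg L hβ 0
  have hle2 : lam ≤ η / (2 * max C 1) := hle.trans (min_le_right _ _)
  have hCl : C * luscherLambda β L ≤ η := by
    calc C * luscherLambda β L ≤ max C 1 * luscherLambda β L :=
          mul_le_mul_of_nonneg_right (le_max_left _ _) hl.le
      _ ≤ max C 1 * (2 * lam) := mul_le_mul_of_nonneg_left hW.2.2 hC1.le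
      _ ≤ max C 1 * (2 * (η / (2 * max C 1))) := by gcongr
      _ = η := by field_simp
  have hkey : C * luscherLambda β L ^ 2 ≤ η * luscherLambda β L := by
    have : C * luscherLambda β L ^ 2 = (C * luscherLambda β L) * luscherLambda β L := by ring
    rw [this]
    exact mul_le_mul_of_nonneg_right hCl hl.le
  constructor
  · -- lower: e^{−((Δ+η)λ)/L} λ₀ ≤ e^{−(Δλ + Cλ²)/L} λ₀ ≤ λ_k
    refine le_trans ?_ hlow
    apply mul_le_mul_of_nonneg_right _ hv0
    apply Real.exp_le_exp.mpr
    apply div_le_div_of_nonneg_right _ hL0.le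
    nlinarith
  · -- upper: λ_k ≤ e^{−(Δλ − Cλ²)/L} λ₀ ≤ e^{−((Δ−η)λ)/L} λ₀
    refine le_trans hup ?_
    apply mul_le_mul_of_nonneg_right _ hv0
    apply Real.exp_le_exp.mpr
    apply div_le_div_of_nonneg_right _ hL0.le
    nlinarith

/-- In the window the one-site femto unit is `λ_b(B) = λ/L` at `B = oneSiteCoupling β L` (tree `bareLambda_oneSiteCoupling`), so `femtoSteps` serves
both lattices: `|T·λ_b − s| ≤ λ_b` at `T = femtoSteps s β L` — the hypothesis shape of `OneSiteTraceLimit`. -/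
theorem femtoSteps_mul_sub_le {s lam β : ℝ} {L : ℕ} [NeZero L] (hs : 0 ≤ s) (hlam : 0 < lam) (hW : InFemtoWindow lam β L) :
    |(femtoSteps s β L : ℝ) * bareLambda (oneSiteCoupling β L) - s| ≤ bareLambda (oneSiteCoupling β L) := by
  have hl : 0 < luscherLambda β L := luscherLambda_pos_of_window hlam hW
  have hL0 : (0 : ℝ) < (L : ℝ) := by exact_mod_cast Nat.pos_of_ne_zero (NeZero.ne L)
  rw [bareLambda_oneSiteCoupling hl]
  have hu : 0 < luscherLambda β L / L := div_pos hl hL0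
  have hx : 0 ≤ s * L / luscherLambda β L := by positivity
  have hc1 : s * L / luscherLambda β L ≤ (femtoSteps s β L : ℝ) := Nat.le_ceil _
  have hc2 : (femtoSteps s β L : ℝ) < s * L / luscherLambda β L + 1 := Nat.ceil_lt_add_one hx
  have e1 : s * L / luscherLambda β L * (luscherLambda β L / L) = s := by
    field_simp
  rw [abs_le]
  constructor
  · have : s ≤ (femtoSteps s β L : ℝ) * (luscherLambda β L / L) := by
      calc s = s * L / luscherLambda β L * (luscherLambda β L / L) := e1.symm
        _ ≤ (femtoSteps s β L : ℝ) * (luscherLambda β L / L) := mul_le_mul_of_nonneg_right hc1 hu.le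
    linarith
  · have : (femtoSteps s β L : ℝ) * (luscherLambda β L / L) ≤ (s * L / luscherLambda β L + 1) * (luscherLambda β L / L) :=
      mul_le_mul_of_nonneg_right hc2.le hu.le
    have e2 : (s * L / luscherLambda β L + 1) * (luscherLambda β L / L) = s + luscherLambda β L / L := by
      rw [add_mul, e1, one_mul]
    linarith

/-! ## §5 The third composition: the four open «TT» stubs + `KT.stub_dressedRitz` + `KT.stub_oneSiteLowerCoarse` imply RED BY NAME -/

/-- ★ **Third composition («TT», rev 5)**: `stub_traceFormula → stub_twistedTraceScaling → stub_oneSiteTraceLimit → stub_traceInversion →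
KT.stub_dressedRitz → KT.stub_oneSiteLowerCoarse → RunningReduction` (`LevelGapSummable` is discharged in-file, §3b).  REAL proof: the inversion yields `CoarseLevels`, whose
upper half is KT's `CoarseNoIntruder` (`coarseNoIntruder_of_coarseLevels`); KT's enclosure composition `RunningReduction_of_KT` (PART 1, door and Ritz
basics the tree theorems `KTDoorR3.katoTempleDoorR3` / `ritzBasicsR3`) concludes the crux. -/
theorem RunningReduction_of_trace :
    Stmt.stub_traceFormula → Stmt.stub_twistedTraceScaling → Stmt.stub_oneSiteTraceLimit →
      Stmt.stub_traceInversion → KT.Stmt.stub_dressedRitz → KT.Stmt.stub_oneSiteLowerCoarse →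
      Summit.QuantumFields.YangMills.Theses.LuscherReduction.RunningReduction :=
  fun hTF hTS hOS hINV hDR hLow =>
    (KT.RunningReduction_of_KT KT.katoTempleDoor_holds KT.ritzBasics_holds
      (coarseNoIntruder_of_coarseLevels (hINV hTF hTS stub_levelGapSummable hOS)) hDR hLow : KT.KTGoal)

/-- The same with the route's crux ONE in place of `KT.stub_oneSiteLowerCoarse`. -/
theorem RunningReduction_of_trace_ONE
    (hTF : Stmt.stub_traceFormula) (hTS : Stmt.stub_twistedTraceScaling)
    (hOS : Stmt.stub_oneSiteTraceLimit) (hINV : Stmt.stub_traceInversion) (hDR : KT.Stmt.stub_dressedRitz)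
    (hONE : Summit.QuantumFields.YangMills.Theses.LuscherReduction.OneSiteLevels) :
    Summit.QuantumFields.YangMills.Theses.LuscherReduction.RunningReduction :=
  RunningReduction_of_trace hTF hTS hOS hINV hDR (KT.stub_oneSiteLowerCoarse_of_ONE hONE)

/-- The coarse by-product on its own: the four open «TT»-proper stubs give `CoarseLevels` (hence, with tree `LuscherSimonGap`, the qualitative femto gap). -/
theorem coarseLevels_of_stubs
    (hTF : Stmt.stub_traceFormula) (hTS : Stmt.stub_twistedTraceScaling)
    (hOS : Stmt.stub_oneSiteTraceLimit) (hINV : Stmt.stub_traceInversion) : CoarseLevels :=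
  hINV hTF hTS stub_levelGapSummable hOS

end Summit.QuantumFields.YangMills.Cruxes.RunningReduction.TT

/-! ═══
# PART 6 «INV» (owner ym-beyond-p1 g18) — `TraceInversion` from the landed Tauberian theorem `laplaceAtoms`
═══ -/

namespace Summit.QuantumFields.YangMills.Cruxes.RunningReduction.TT

open Summit.QuantumFields.YangMills.Theorems.FemtoTransferGap
open Summit.QuantumFields.YangMills.Cruxes.RunningReduction

namespace Inv

open Summit.QuantumFields.YangMills.Theorems.FemtoTransferGap.KTRCalibration (levelValue_antitone)

/-! ### §6.1 Relative levels and regularised femto atoms at a fixed lattice -/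

/-- Relative level `x_j = λ_j/λ_0 ∈ [0,1]`. -/
def xval (L : ℕ) [NeZero L] (β : ℝ) (j : ℕ) : ℝ :=
  levelValue su2Rep L β j / levelValue su2Rep L β 0

/-- Raw atom candidate `b_j`: `max(c·log(λ_0/λ_j), δ j)` on positive levels, `j/δ` on zero levels. -/
def atomRaw (L : ℕ) [NeZero L] (β c δ : ℝ) (j : ℕ) : ℝ :=
  if 0 < levelValue su2Rep L β j then
    max (c * Real.log (levelValue su2Rep L β 0 / levelValue su2Rep L β j)) (δ * j)
  else (j : ℝ) / δ

/-- Regularised atoms `ã_j = max_{i ≤ j} b_i` (monotone by construction). -/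
def atomReg (L : ℕ) [NeZero L] (β c δ : ℝ) (j : ℕ) : ℝ :=
  partialSups (atomRaw L β c δ) j

section Fixed

variable {L : ℕ} [NeZero L] {β : ℝ}

theorem levelValue_zero_pos (L : ℕ) [NeZero L] (β : ℝ) : 0 < levelValue su2Rep L β 0 := by
  rw [levelValue_zero]; exact topValue_su2Rep_pos L β

theorem xval_nonneg (hβ : 0 ≤ β) (j : ℕ) : 0 ≤ xval L β j :=
  div_nonneg (levelValue_su2Rep_nonneg L hβ j) (levelValue_su2Rep_nonneg L hβ 0)

theorem xval_le_one (hβ : 0 ≤ β) (j : ℕ) : xval L β j ≤ 1 := by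
  unfold xval
  rw [div_le_one (levelValue_zero_pos L β)]
  exact levelValue_antitone hβ (Nat.zero_le j)

theorem xval_zero : xval L β 0 = 1 := div_self (levelValue_zero_pos L β).ne'

theorem xval_pow_le_sq (hβ : 0 ≤ β) (j : ℕ) {T : ℕ} (hT : 2 ≤ T) : xval L β j ^ T ≤ xval L β j ^ 2 :=
  pow_le_pow_of_le_one (xval_nonneg hβ j) (xval_le_one hβ j) hT

theorem atomRaw_zero (c δ : ℝ) : atomRaw L β c δ 0 = 0 := by
  unfold atomRaw
  rw [if_pos (levelValue_zero_pos L β), div_self (levelValue_zero_pos L β).ne', Real.log_one]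
  simp

theorem atomReg_zero (c δ : ℝ) : atomReg L β c δ 0 = 0 := by
  unfold atomReg; rw [partialSups_zero, atomRaw_zero]

theorem atomReg_mono (c δ : ℝ) : Monotone (atomReg L β c δ) := fun i j h => (partialSups (atomRaw L β c δ)).monotone h

theorem le_atomRaw (hβ : 0 ≤ β) {c δ : ℝ} (hδ : 0 < δ) (hδ1 : δ ≤ 1) (j : ℕ) : δ * j ≤ atomRaw L β c δ j := by
  unfold atomRaw
  split_ifs with h
  · exact le_max_right _ _
  · rw [le_div_iff₀ hδ]
    have hj : (0 : ℝ) ≤ j := Nat.cast_nonneg j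
    nlinarith [mul_le_mul_of_nonneg_right hδ1 hj]

theorem le_atomReg (hβ : 0 ≤ β) {c δ : ℝ} (hδ : 0 < δ) (hδ1 : δ ≤ 1) (j : ℕ) : δ * j ≤ atomReg L β c δ j :=
  (le_atomRaw hβ hδ hδ1 j).trans (le_partialSups (atomRaw L β c δ) j)

theorem atomReg_nonneg (hβ : 0 ≤ β) {c δ : ℝ} (hδ : 0 < δ) (hδ1 : δ ≤ 1) (j : ℕ) : 0 ≤ atomReg L β c δ j :=
  le_trans (by positivity) (le_atomReg hβ hδ hδ1 j)

/-- `Σ_j e^{−s ã_j} < ∞` for every `s > 0` (domination by the geometric series `e^{−sδ j}`). -/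
theorem summable_exp_atomReg (hβ : 0 ≤ β) {c δ : ℝ} (hδ : 0 < δ) (hδ1 : δ ≤ 1) {s : ℝ} (hs : 0 < s) :
    Summable fun j : ℕ => Real.exp (-s * atomReg L β c δ j) := by
  have hgeo : Summable fun j : ℕ => Real.exp (-(s * δ)) ^ j :=
    summable_geometric_of_lt_one (Real.exp_pos _).le (Real.exp_lt_one_iff.mpr (by nlinarith [mul_pos hs hδ]))
  refine Summable.of_nonneg_of_le (fun j => (Real.exp_pos _).le) (fun j => ?_) hgeo
  rw [← Real.exp_nat_mul, Real.exp_le_exp]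
  have := le_atomReg (L := L) hβ (c := c) hδ hδ1 j
  nlinarith

/-- On a positive level the running max is attained at the last index: `ã_j = max(c·log(λ_0/λ_j), δ j)`. -/
theorem atomReg_eq_of_pos (hβ : 0 ≤ β) {c δ : ℝ} (hc : 0 ≤ c) (hδ : 0 ≤ δ) {j : ℕ} (hj : 0 < levelValue su2Rep L β j) :
    atomReg L β c δ j = max (c * Real.log (levelValue su2Rep L β 0 / levelValue su2Rep L β j)) (δ * j) := by
  have key : ∀ i ≤ j, atomRaw L β c δ i ≤ atomRaw L β c δ j := by
    intro i hij
    have hi : 0 < levelValue su2Rep L β i := lt_of_lt_of_le hj (levelValue_antitone hβ hij)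
    unfold atomRaw
    rw [if_pos hi, if_pos hj]
    apply max_le_max
    · apply mul_le_mul_of_nonneg_left _ hc
      apply Real.log_le_log (div_pos (levelValue_zero_pos L β) hi)
      exact div_le_div_of_nonneg_left (levelValue_zero_pos L β).le hj (levelValue_antitone hβ hij)
    · exact mul_le_mul_of_nonneg_left (by exact_mod_cast hij) hδ
  unfold atomReg
  apply le_antisymm
  · apply partialSups_le
    intro i hi
    have := key i hi
    unfold atomRaw at this ⊢
    rw [if_pos hj] at this
    exact this
  · have := le_partialSups (atomRaw L β c δ) j
    unfold atomRaw at this ⊢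
    rw [if_pos hj] at this
    exact this

/-- On a zero level: `ã_j ≥ j/δ`. -/
theorem div_le_atomReg_of_zero {c δ : ℝ} {j : ℕ} (hj : ¬ 0 < levelValue su2Rep L β j) :
    (j : ℝ) / δ ≤ atomReg L β c δ j := by
  have := le_partialSups (atomRaw L β c δ) j
  unfold atomRaw at this
  rw [if_neg hj] at this
  exact this

/-- The exact identity on positive levels: `e^{−(T/c)·c·log(λ_0/λ_j)} = x_j^T`. -/
theorem exp_neg_mul_log_eq (hβ : 0 ≤ β) {c : ℝ} (hc : 0 < c) {j : ℕ} (hj : 0 < levelValue su2Rep L β j) (T : ℕ) :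
    Real.exp (-((T : ℝ) / c) * (c * Real.log (levelValue su2Rep L β 0 / levelValue su2Rep L β j))) = xval L β j ^ T := by
  have h0 := levelValue_zero_pos L β
  have hx : 0 < xval L β j := div_pos hj h0
  have : -((T : ℝ) / c) * (c * Real.log (levelValue su2Rep L β 0 / levelValue su2Rep L β j)) = (T : ℝ) * Real.log (xval L β j) := by
    have hlog : Real.log (levelValue su2Rep L β 0 / levelValue su2Rep L β j) = - Real.log (xval L β j) := by
      unfold xval; rw [← Real.log_inv, inv_div]
    rw [hlog]; field_simp
  rw [this, ← Real.log_pow, Real.exp_log (pow_pos hx T)]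

/-- **Pointwise discrepancy** between the regularised Laplace weight and the true moment weight at `σ = T/c`:
`|e^{−σ ã_j} − x_j^T| ≤ min(x_j^T, σδ j) + [j ≠ 0]·e^{−σ j/δ}`. -/
theorem abs_exp_atomReg_sub_le (hβ : 0 ≤ β) {c δ : ℝ} (hc : 0 < c) (hδ : 0 < δ) (hδ1 : δ ≤ 1) (T : ℕ) (j : ℕ) :
    |Real.exp (-((T : ℝ) / c) * atomReg L β c δ j) - xval L β j ^ T| ≤
      min (xval L β j ^ T) ((T : ℝ) / c * δ * j) + (if j = 0 then 0 else Real.exp (-((T : ℝ) / c) * ((j : ℝ) / δ))) := by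
  have hσ : 0 ≤ (T : ℝ) / c := by positivity
  have hxT : 0 ≤ xval L β j ^ T := pow_nonneg (xval_nonneg hβ j) T
  by_cases hj : 0 < levelValue su2Rep L β j
  · -- positive level: weight = min(x^T, e^{−σδj})
    rw [atomReg_eq_of_pos hβ hc.le hδ.le hj]
    have hw : Real.exp (-((T : ℝ) / c) * max (c * Real.log (levelValue su2Rep L β 0 / levelValue su2Rep L β j)) (δ * j)) =
        min (xval L β j ^ T) (Real.exp (-((T : ℝ) / c) * (δ * j))) := by
      rw [← exp_neg_mul_log_eq hβ hc hj T]
      rcases le_total (c * Real.log (levelValue su2Rep L β 0 / levelValue su2Rep L β j)) (δ * j) with h | h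
      · rw [max_eq_right h, min_eq_right]
        exact Real.exp_le_exp.mpr (by nlinarith)
      · rw [max_eq_left h, min_eq_left]
        exact Real.exp_le_exp.mpr (by nlinarith)
    rw [hw]
    have hind : 0 ≤ (if j = 0 then (0 : ℝ) else Real.exp (-((T : ℝ) / c) * ((j : ℝ) / δ))) := by
      split_ifs <;> positivity
    have h1 : |min (xval L β j ^ T) (Real.exp (-((T : ℝ) / c) * (δ * j))) - xval L β j ^ T| ≤
        min (xval L β j ^ T) ((T : ℝ) / c * δ * j) := by
      rw [abs_sub_comm, abs_of_nonneg (sub_nonneg.mpr (min_le_left _ _))]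
      have hmin0 : 0 ≤ min (xval L β j ^ T) (Real.exp (-((T : ℝ) / c) * (δ * j))) := le_min hxT (Real.exp_pos _).le
      apply le_min
      · linarith
      · -- x^T − min(x^T, e^{−y}) ≤ 1 − e^{−y} ≤ y
        have hy : 0 ≤ (T : ℝ) / c * (δ * j) := by positivity
        have hexp : 1 - (T : ℝ) / c * (δ * j) ≤ Real.exp (-((T : ℝ) / c) * (δ * j)) := by
          have := Real.add_one_le_exp (-((T : ℝ) / c) * (δ * j)); linarith
        have hx1 : xval L β j ^ T ≤ 1 := pow_le_one₀ (xval_nonneg hβ j) (xval_le_one hβ j)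
        rcases le_total (xval L β j ^ T) (Real.exp (-((T : ℝ) / c) * (δ * j))) with h | h
        · rw [min_eq_left h]; nlinarith
        · rw [min_eq_right h]; nlinarith
    linarith
  · -- zero level: x_j = 0, weight ≤ e^{−σ j/δ}, and j ≠ 0
    have hj0 : levelValue su2Rep L β j = 0 := le_antisymm (not_lt.mp hj) (levelValue_su2Rep_nonneg L hβ j)
    have hjne : j ≠ 0 := by rintro rfl; exact hj (levelValue_zero_pos L β)
    have hx0 : xval L β j = 0 := by unfold xval; rw [hj0, zero_div]
    have hTpos_or : xval L β j ^ T = 0 ∨ T = 0 := by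
      rcases Nat.eq_zero_or_pos T with h | h
      · exact Or.inr h
      · exact Or.inl (by rw [hx0, zero_pow h.ne'])
    rw [if_neg hjne]
    have hle : Real.exp (-((T : ℝ) / c) * atomReg L β c δ j) ≤ Real.exp (-((T : ℝ) / c) * ((j : ℝ) / δ)) := by
      apply Real.exp_le_exp.mpr
      have := div_le_atomReg_of_zero (L := L) (β := β) (c := c) (δ := δ) hj
      nlinarith
    rcases hTpos_or with h | h
    · rw [h, sub_zero, abs_of_pos (Real.exp_pos _)]
      have : 0 ≤ min (0 : ℝ) ((T : ℝ) / c * δ * j) := le_min le_rfl (by positivity)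
      linarith
    · subst h
      simp

end Fixed

/-! ### §6.2 Grid, diagonal, continuity, currency bridge, one-site limit, regularisation scale, extraction (all proved) -/

/-- Dyadic femto-time grid `q_i = (m+1)/2^p`, `i = ⟨m, p⟩` (dense in `(0, ∞)`). -/
def qgrid (i : ℕ) : ℝ := ((Nat.unpair i).1 + 1 : ℝ) / 2 ^ (Nat.unpair i).2

theorem qgrid_pos (i : ℕ) : 0 < qgrid i := by unfold qgrid; positivity

/-- The `m`-th dyadic approximant of `s > 0` from above, as a grid index. -/
def qapprox (s : ℝ) (m : ℕ) : ℕ := Nat.pair (⌈s * 2 ^ m⌉₊ - 1) m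

theorem qgrid_qapprox {s : ℝ} (hs : 0 < s) (m : ℕ) : qgrid (qapprox s m) = (⌈s * 2 ^ m⌉₊ : ℝ) / 2 ^ m := by
  unfold qgrid qapprox
  rw [Nat.unpair_pair]
  simp only
  have h1 : 1 ≤ ⌈s * 2 ^ m⌉₊ := Nat.one_le_iff_ne_zero.mpr (by
    rw [Ne, Nat.ceil_eq_zero, not_le]; positivity)
  congr 1
  rw [Nat.cast_sub h1]; push_cast; ring

theorem le_qgrid_qapprox {s : ℝ} (hs : 0 < s) (m : ℕ) : s ≤ qgrid (qapprox s m) := by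
  rw [qgrid_qapprox hs, le_div_iff₀ (by positivity)]; exact Nat.le_ceil _

theorem qgrid_qapprox_le {s : ℝ} (hs : 0 < s) (m : ℕ) : qgrid (qapprox s m) ≤ s + (1 / 2) ^ m := by
  rw [qgrid_qapprox hs, div_le_iff₀ (by positivity)]
  have h1 : (s + (1 / 2 : ℝ) ^ m) * 2 ^ m = s * 2 ^ m + 1 := by
    rw [add_mul, ← mul_pow]; norm_num
  rw [h1]
  exact (Nat.ceil_lt_add_one (by positivity : 0 ≤ s * 2 ^ m)).le

theorem tendsto_qgrid_qapprox {s : ℝ} (hs : 0 < s) : Tendsto (fun m => qgrid (qapprox s m)) atTop (𝓝 s) := by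
  have hlim : Tendsto (fun m : ℕ => s + (1 / 2 : ℝ) ^ m) atTop (𝓝 s) := by
    have := (tendsto_pow_atTop_nhds_zero_of_lt_one (by norm_num : (0 : ℝ) ≤ 1 / 2) (by norm_num : (1 / 2 : ℝ) < 1)).const_add s
    simpa using this
  exact tendsto_of_tendsto_of_tendsto_of_le_of_le tendsto_const_nhds hlim (le_qgrid_qapprox hs) (qgrid_qapprox_le hs)

/-- Elementary ratio perturbation: `|A/B² − A'/B'²| ≤ |A − A'| + 2|B − B'|` for `B, B' ≥ 1`, `0 ≤ A' ≤ B'`. -/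
theorem ratio_sub_ratio_le {A A' B B' : ℝ} (hB : 1 ≤ B) (hB' : 1 ≤ B') (hA' : 0 ≤ A') (hA'B' : A' ≤ B') :
    |A / B ^ 2 - A' / B' ^ 2| ≤ |A - A'| + 2 * |B - B'| := by
  have hB0 : 0 < B := by linarith
  have hB'0 : 0 < B' := by linarith
  have h1 : |A / B ^ 2 - A' / B ^ 2| ≤ |A - A'| := by
    rw [← sub_div, abs_div, abs_of_pos (by positivity : 0 < B ^ 2)]
    exact div_le_self (abs_nonneg _) (one_le_pow₀ hB)
  have h2 : |A' / B ^ 2 - A' / B' ^ 2| ≤ 2 * |B - B'| := by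
    have hid : A' / B ^ 2 - A' / B' ^ 2 = A' * (B' + B) / (B ^ 2 * B' ^ 2) * (B' - B) := by
      field_simp; ring
    rw [hid, abs_mul, abs_of_nonneg (by positivity), abs_sub_comm B B']
    have h3 : B' ^ 2 ≤ B ^ 2 * B' ^ 2 := le_mul_of_one_le_left (by positivity) (one_le_pow₀ hB)
    have h4 : 1 ≤ B * B' := one_le_mul_of_one_le_of_one_le hB hB'
    have h5 : B * B' ≤ B ^ 2 * B' ^ 2 := by nlinarith
    have hcoef : A' * (B' + B) / (B ^ 2 * B' ^ 2) ≤ 2 := by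
      rw [div_le_iff₀ (by positivity)]
      nlinarith [mul_le_mul_of_nonneg_right hA'B' (by positivity : 0 ≤ B' + B)]
    exact mul_le_mul_of_nonneg_right hcoef (abs_nonneg _)
  calc |A / B ^ 2 - A' / B' ^ 2| = |(A / B ^ 2 - A' / B ^ 2) + (A' / B ^ 2 - A' / B' ^ 2)| := by ring_nf
    _ ≤ |A / B ^ 2 - A' / B ^ 2| + |A' / B ^ 2 - A' / B' ^ 2| := abs_add_le _ _
    _ ≤ |A - A'| + 2 * |B - B'| := add_le_add h1 h2

/-- **The violation in atom currency**: if the two-sided coarse bound fails at `(L, β)` and `δ` is small, the regularised atom `ã_k` is `η/2`-far from `Δ_k`. -/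
theorem far_of_violation {L : ℕ} [NeZero L] {β : ℝ} (hβ : 0 ≤ β) (hlam : 0 < luscherLambda β L) {δ η : ℝ}
    (hδ : 0 < δ) (hη : 0 < η) {k : ℕ} (hδk : δ * k ≤ η / 2) (hkδ : k ≠ 0 → levelGap k + η ≤ k / δ)
    (hviol : ¬ (Real.exp (-((levelGap k + η) * luscherLambda β L) / L) * levelValue su2Rep L β 0 ≤ levelValue su2Rep L β k ∧
        levelValue su2Rep L β k ≤ Real.exp (-((levelGap k - η) * luscherLambda β L) / L) * levelValue su2Rep L β 0)) :
    η / 2 ≤ |atomReg L β ((L : ℝ) / luscherLambda β L) δ k - levelGap k| := by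
  have hL : (0 : ℝ) < L := Nat.cast_pos.mpr (Nat.pos_of_ne_zero (NeZero.ne L))
  set c : ℝ := (L : ℝ) / luscherLambda β L with hc_def
  have hc : 0 < c := div_pos hL hlam
  have h0 := levelValue_zero_pos L β
  have hconv : ∀ A : ℝ, -(A * luscherLambda β L) / L = -(A / c) := by
    intro A; rw [hc_def]; field_simp
  by_cases hk : 0 < levelValue su2Rep L β k
  · rw [atomReg_eq_of_pos hβ hc.le hδ.le hk]
    set α : ℝ := c * Real.log (levelValue su2Rep L β 0 / levelValue su2Rep L β k) with hα_def
    have hα0 : 0 ≤ α :=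
      mul_nonneg hc.le (Real.log_nonneg ((one_le_div hk).mpr (levelValue_antitone hβ (Nat.zero_le k))))
    have hlk : levelValue su2Rep L β k = Real.exp (-(α / c)) * levelValue su2Rep L β 0 := by
      have : -(α / c) = Real.log (levelValue su2Rep L β k / levelValue su2Rep L β 0) := by
        rw [hα_def, mul_div_cancel_left₀ _ hc.ne', ← Real.log_inv, inv_div]
      rw [this, Real.exp_log (div_pos hk h0), div_mul_cancel₀ _ h0.ne']
    rcases not_and_or.mp hviol with h | h
    · have hlt : levelGap k + η < α := by
        by_contra hle
        push_neg at hle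
        apply h
        rw [hconv, hlk]
        apply mul_le_mul_of_nonneg_right _ h0.le
        apply Real.exp_le_exp.mpr
        have := div_le_div_of_nonneg_right hle hc.le
        linarith
      have hmax : levelGap k + η < max α (δ * k) := lt_of_lt_of_le hlt (le_max_left _ _)
      rw [abs_of_pos (by linarith)]
      linarith
    · have hlt : α < levelGap k - η := by
        by_contra hle
        push_neg at hle
        apply h
        rw [hconv, hlk]
        apply mul_le_mul_of_nonneg_right _ h0.le
        apply Real.exp_le_exp.mpr
        have := div_le_div_of_nonneg_right hle hc.le
        linarith
      have hmax : max α (δ * k) ≤ levelGap k - η / 2 := max_le (by linarith) (by linarith)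
      rw [abs_of_nonpos (by linarith)]
      linarith
  · have hk0 : k ≠ 0 := by rintro rfl; exact hk h0
    have := div_le_atomReg_of_zero (L := L) (β := β) (c := c) (δ := δ) hk
    have := hkδ hk0
    rw [abs_of_nonneg (by linarith)]
    linarith

/-- **Diagonal selection**: countably many null sequences admit a slowly diverging diagonal. -/
theorem exists_diag {u : ℕ → ℕ → ℝ} (hu : ∀ m, Tendsto (fun n => u n m) atTop (𝓝 0)) :
    ∃ φ : ℕ → ℕ, Tendsto φ atTop atTop ∧ Tendsto (fun n => u n (φ n)) atTop (𝓝 0) := by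
  classical
  have hN : ∀ m : ℕ, ∃ N : ℕ, ∀ n ≥ N, |u n m| ≤ 1 / ((m : ℝ) + 1) := by
    intro m
    obtain ⟨N, hN⟩ := Metric.tendsto_atTop.mp (hu m) (1 / ((m : ℝ) + 1)) (by positivity)
    exact ⟨N, fun n hn => by have := hN n hn; rw [Real.dist_eq, sub_zero] at this; exact this.le⟩
  choose N hN using hN
  refine ⟨fun n => Nat.findGreatest (fun m => N m ≤ n) n, ?_, ?_⟩
  · rw [tendsto_atTop_atTop]
    intro M
    exact ⟨max (N M) M, fun n hn => Nat.le_findGreatest (le_of_max_le_right hn) (le_of_max_le_left hn)⟩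
  · rw [Metric.tendsto_atTop]
    intro ε hε
    obtain ⟨M, hM⟩ := exists_nat_one_div_lt hε
    refine ⟨max (N 0) (max (N M) M), fun n hn => ?_⟩
    have hn0 : N 0 ≤ n := le_of_max_le_left hn
    have hnM : max (N M) M ≤ n := le_of_max_le_right hn
    have hspec : N (Nat.findGreatest (fun m => N m ≤ n) n) ≤ n :=
      Nat.findGreatest_spec (P := fun m => N m ≤ n) (Nat.zero_le n) hn0
    have hge : M ≤ Nat.findGreatest (fun m => N m ≤ n) n :=
      Nat.le_findGreatest (le_of_max_le_right hnM) (le_of_max_le_left hnM)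
    have h1 := hN _ n hspec
    rw [Real.dist_eq, sub_zero]
    have hge' : (M : ℝ) + 1 ≤ (Nat.findGreatest (fun m => N m ≤ n) n : ℝ) + 1 := by exact_mod_cast Nat.succ_le_succ hge
    calc |u n (Nat.findGreatest (fun m => N m ≤ n) n)| ≤ 1 / ((Nat.findGreatest (fun m => N m ≤ n) n : ℝ) + 1) := h1
      _ ≤ 1 / ((M : ℝ) + 1) := one_div_le_one_div_of_le (by positivity) hge'
      _ < ε := hM

/-- **Continuity of Lüscher's limiting ratio** along sequences (from `LevelGapSummable`, Tannery). -/
theorem levelGap_nonneg (k : ℕ) : 0 ≤ levelGap k := by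
  have h' := physLevel_mono (Nat.succ_le_succ (Nat.zero_le 0)) (Nat.succ_le_succ (Nat.zero_le k))
  unfold levelGap; linarith

theorem levelGap_mono' : Monotone levelGap := fun j k h => by
  have h' := physLevel_mono (Nat.succ_le_succ (Nat.zero_le j)) (Nat.succ_le_succ h)
  unfold levelGap; linarith

theorem tendsto_tsum_exp_levelGap {s : ℝ} (hs : 0 < s) {σ : ℕ → ℝ} (hσ : Tendsto σ atTop (𝓝 s)) :
    Tendsto (fun n => ∑' k, Real.exp (-σ n * levelGap k)) atTop (𝓝 (∑' k, Real.exp (-s * levelGap k))) := by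
  refine tendsto_tsum_of_dominated_convergence (bound := fun k => Real.exp (-(s / 2) * levelGap k))
    (levelGapSummable_holds (s / 2) (half_pos hs)) ?_ ?_
  · intro k
    exact (Real.continuous_exp.tendsto _).comp (hσ.neg.mul_const (levelGap k))
  · have hev : ∀ᶠ n in atTop, s / 2 ≤ σ n := hσ.eventually (eventually_ge_nhds (by linarith : s / 2 < s))
    filter_upwards [hev] with n hn k
    rw [Real.norm_eq_abs, abs_of_pos (Real.exp_pos _)]
    exact Real.exp_le_exp.mpr (by nlinarith [levelGap_nonneg k])

theorem tsum_exp_levelGap_pos {s : ℝ} (hs : 0 < s) : 0 < ∑' k, Real.exp (-s * levelGap k) := by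
  have h := (levelGapSummable_holds s hs).le_tsum 0 (fun j _ => (Real.exp_pos _).le)
  rw [levelGap_zero, mul_zero, Real.exp_zero] at h
  linarith

theorem tendsto_hTraceRatio {s : ℝ} (hs : 0 < s) {σ : ℕ → ℝ} (hσ : Tendsto σ atTop (𝓝 s)) :
    Tendsto (fun n => hTraceRatio (σ n)) atTop (𝓝 (hTraceRatio s)) := by
  unfold hTraceRatio seqRatio
  have h2 : Tendsto (fun n => 2 * σ n) atTop (𝓝 (2 * s)) := hσ.const_mul 2
  have hnum := tendsto_tsum_exp_levelGap (by linarith : 0 < 2 * s) h2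
  have hden := tendsto_tsum_exp_levelGap hs hσ
  exact hnum.div (hden.pow 2) (pow_ne_zero 2 (tsum_exp_levelGap_pos hs).ne')

/-- **Currency bridge**: under `TraceFormula`, the level moments are the normalised traces and `traceRatio = levelRatio` (`β ≥ 1`, `T ≥ 2`). -/
theorem hasSum_xval_pow (hTF : TraceFormula) {L : ℕ} [NeZero L] {β : ℝ} (hβ : 1 ≤ β) {T : ℕ} (hT : 2 ≤ T) :
    HasSum (fun j => xval L β j ^ T) (physTrace L β T / levelValue su2Rep L β 0 ^ T) := by
  have h := (hTF L β T hβ hT).div_const (levelValue su2Rep L β 0 ^ T)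
  refine h.congr_fun ?_
  intro j
  unfold xval; rw [div_pow]

theorem levelMoment_eq (hTF : TraceFormula) {L : ℕ} [NeZero L] {β : ℝ} (hβ : 1 ≤ β) {T : ℕ} (hT : 2 ≤ T) :
    levelMoment L β T = physTrace L β T / levelValue su2Rep L β 0 ^ T := by
  unfold levelMoment
  exact (hasSum_xval_pow hTF hβ hT).tsum_eq

theorem traceRatio_eq_levelRatio (hTF : TraceFormula) {L : ℕ} [NeZero L] {β : ℝ} (hβ : 1 ≤ β) {T : ℕ} (hT : 2 ≤ T) :
    traceRatio L β T = levelRatio L β T := by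
  have h0 := levelValue_zero_pos L β
  unfold traceRatio levelRatio
  rw [levelMoment_eq hTF hβ (by omega : 2 ≤ 2 * T), levelMoment_eq hTF hβ hT]
  have hp : levelValue su2Rep L β 0 ^ (2 * T) = (levelValue su2Rep L β 0 ^ T) ^ 2 := by rw [pow_mul']
  rw [hp, div_pow]
  have hne : (levelValue su2Rep L β 0 ^ T) ^ 2 ≠ 0 := by positivity
  field_simp

/-- **One-site convergence at a grid point** (from `OneSiteTraceLimit`). -/
theorem tendsto_levelRatio_oneSite (hOS : OneSiteTraceLimit) {s : ℝ} (hs : 0 < s) {B : ℕ → ℝ} {T : ℕ → ℕ}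
    (hB : Tendsto B atTop atTop) (hT : ∀ n, |(T n : ℝ) * bareLambda (B n) - s| ≤ bareLambda (B n)) :
    Tendsto (fun n => levelRatio 1 (B n) (T n)) atTop (𝓝 (hTraceRatio s)) := by
  rw [Metric.tendsto_atTop]
  intro ε hε
  obtain ⟨B0, hB0⟩ := hOS s hs (ε / 2) (half_pos hε)
  obtain ⟨N, hN⟩ := (Filter.tendsto_atTop.mp hB) B0 |>.exists_forall_of_atTop
  exact ⟨N, fun n hn => by
    rw [Real.dist_eq]
    exact lt_of_le_of_lt (hB0 (B n) (hN n hn) (T n) (hT n)) (half_lt_self hε)⟩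

/-- **Smallness of the regularisation error** at a fixed lattice: for `Σ x_j² < ∞`, `σ_min > 0`, `S > 0` and `ε > 0` there is `δ ∈ (0,1]` with
`Σ_j min(x_j², Sδ j) + Σ_{j ≥ 1} e^{−σ_min j/δ} ≤ ε`. -/
theorem exists_delta {x : ℕ → ℝ} (hx0 : ∀ j, 0 ≤ x j) (hx : Summable fun j => x j ^ 2) {σmin S ε : ℝ}
    (hσ : 0 < σmin) (hS : 0 < S) (hε : 0 < ε) :
    ∃ δ : ℝ, 0 < δ ∧ δ ≤ 1 ∧ δ ≤ ε ∧
      (Summable fun j : ℕ => min (x j ^ 2) (S * δ * j)) ∧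
      (Summable fun j : ℕ => if j = 0 then (0 : ℝ) else Real.exp (-σmin * ((j : ℝ) / δ))) ∧
      (∑' j : ℕ, min (x j ^ 2) (S * δ * j)) + (∑' j : ℕ, if j = 0 then (0 : ℝ) else Real.exp (-σmin * ((j : ℝ) / δ))) ≤ ε := by
  -- (i) the truncation term: dominated convergence as δ → 0⁺
  set F : ℝ → ℝ := fun δ => ∑' j : ℕ, min (x j ^ 2) (S * δ * j) with hF
  have hFlim : Tendsto F (𝓝[>] 0) (𝓝 0) := by
    have key : Tendsto (fun δ : ℝ => ∑' j : ℕ, min (x j ^ 2) (S * δ * j)) (𝓝[>] 0) (𝓝 (∑' j : ℕ, (0 : ℝ))) := by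
      refine tendsto_tsum_of_dominated_convergence (bound := fun j => x j ^ 2) hx ?_ ?_
      · intro j
        have hc : Continuous fun δ : ℝ => min (x j ^ 2) (S * δ * j) := by fun_prop
        have := hc.tendsto 0
        simp only [mul_zero, zero_mul] at this
        rw [min_eq_right (sq_nonneg (x j))] at this
        exact tendsto_nhdsWithin_of_tendsto_nhds this
      · filter_upwards [self_mem_nhdsWithin] with δ (hδ : 0 < δ) j
        rw [Real.norm_eq_abs, abs_of_nonneg (le_min (sq_nonneg _) (by positivity))]
        exact min_le_left _ _
    simpa using key
  -- (ii) the zero-level term: a geometric series `r/(1-r)`, `r = e^{-σmin/δ} ≤ δ/σmin`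
  have hG : ∀ δ : ℝ, 0 < δ → HasSum (fun j : ℕ => if j = 0 then (0 : ℝ) else Real.exp (-σmin * ((j : ℝ) / δ)))
      (1 / (1 - Real.exp (-σmin / δ)) - 1) := by
    intro δ hδ
    set r := Real.exp (-σmin / δ) with hr
    have hr0 : 0 ≤ r := (Real.exp_pos _).le
    have hr1 : r < 1 := Real.exp_lt_one_iff.mpr (by rw [neg_div]; exact neg_neg_of_pos (div_pos hσ hδ))
    have h1 : HasSum (fun j : ℕ => r ^ j) (1 / (1 - r)) := by
      rw [one_div]; exact hasSum_geometric_of_lt_one hr0 hr1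
    have h2 : HasSum (fun j : ℕ => if j = 0 then (1 : ℝ) else 0) 1 := hasSum_ite_eq 0 1
    have hfun : (fun j : ℕ => if j = 0 then (0 : ℝ) else Real.exp (-σmin * ((j : ℝ) / δ))) =
        fun j : ℕ => r ^ j - (if j = 0 then (1 : ℝ) else 0) := by
      funext j
      split_ifs with hj
      · subst hj; simp
      · rw [sub_zero, hr, ← Real.exp_nat_mul]; congr 1; field_simp
    rw [hfun]
    exact h1.sub h2
  have hGbound : ∀ δ : ℝ, 0 < δ → δ ≤ σmin / 2 →
      (∑' j : ℕ, if j = 0 then (0 : ℝ) else Real.exp (-σmin * ((j : ℝ) / δ))) ≤ 2 * (δ / σmin) := by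
    intro δ hδ hδσ
    rw [(hG δ hδ).tsum_eq]
    set r := Real.exp (-σmin / δ) with hr
    have hy : 0 < σmin / δ := div_pos hσ hδ
    have hrle : r ≤ δ / σmin := by
      -- e^{-y} ≤ 1/y for y > 0
      have h1 : σmin / δ * Real.exp (-(σmin / δ)) ≤ 1 := by
        have := Real.add_one_le_exp (σmin / δ)
        have hpos := Real.exp_pos (-(σmin / δ))
        have hmul : Real.exp (σmin / δ) * Real.exp (-(σmin / δ)) = 1 := by rw [← Real.exp_add]; simp
        nlinarith
      rw [hr, neg_div]
      rw [le_div_iff₀ hσ]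
      have : σmin / δ * Real.exp (-(σmin / δ)) * δ ≤ 1 * δ := by gcongr
      calc Real.exp (-(σmin / δ)) * σmin = σmin / δ * Real.exp (-(σmin / δ)) * δ := by field_simp
        _ ≤ 1 * δ := this
        _ = δ := one_mul δ
    have hr2 : r ≤ 1 / 2 := hrle.trans (by rw [div_le_iff₀ hσ]; linarith)
    have hr0 : 0 ≤ r := (Real.exp_pos _).le
    rw [div_sub_one (by linarith : (1 - r) ≠ 0), show (1 - (1 - r)) = r by ring, div_le_iff₀ (by linarith : 0 < 1 - r)]
    nlinarith
  -- (iii) choose δ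
  have hev1 : ∀ᶠ δ in 𝓝[>] (0 : ℝ), F δ < ε / 2 := hFlim (Iio_mem_nhds (half_pos hε))
  have hev2 : ∀ᶠ δ in 𝓝[>] (0 : ℝ), δ < min (min 1 ε) (min (σmin / 2) (ε * σmin / 4)) :=
    nhdsWithin_le_nhds (Iio_mem_nhds (by positivity))
  obtain ⟨δ, hδF, hδlt, hδpos⟩ := (hev1.and (hev2.and self_mem_nhdsWithin)).exists
  have hδ1 : δ ≤ 1 := hδlt.le.trans ((min_le_left _ _).trans (min_le_left _ _))
  have hδe : δ ≤ ε := hδlt.le.trans ((min_le_left _ _).trans (min_le_right _ _))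
  have hδσ : δ ≤ σmin / 2 := hδlt.le.trans ((min_le_right _ _).trans (min_le_left _ _))
  have hδε : δ ≤ ε * σmin / 4 := hδlt.le.trans ((min_le_right _ _).trans (min_le_right _ _))
  have hδpos' : 0 < δ := hδpos
  refine ⟨δ, hδpos', hδ1, hδe, ?_, (hG δ hδpos').summable, ?_⟩
  · exact Summable.of_nonneg_of_le (fun j => le_min (sq_nonneg _) (by positivity)) (fun j => min_le_left _ _) hx
  · have hGδ := hGbound δ hδpos' hδσ
    have : 2 * (δ / σmin) ≤ ε / 2 := by
      rw [mul_div_assoc', div_le_iff₀ hσ]; linarith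
    have hFδ : F δ < ε / 2 := hδF
    simp only [hF] at hFδ
    linarith

/-- **Extraction** of a violating sequence along which `TwistedTraceScaling` holds diagonally on the grid (lattice sizes written `L n + 1`). -/
theorem extract (hTS : TwistedTraceScaling) {k : ℕ} {η : ℝ}
    (hviol : ¬ (∃ lam0 : ℝ, 0 < lam0 ∧ ∀ lam : ℝ, 0 < lam → lam ≤ lam0 →
      ∃ L0 : ℕ, ∀ (L : ℕ) [NeZero L], L0 ≤ L → ∀ β : ℝ, InFemtoWindow lam β L →
        Real.exp (-((levelGap k + η) * luscherLambda β L) / L) * levelValue su2Rep L β 0 ≤ levelValue su2Rep L β k ∧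
          levelValue su2Rep L β k ≤ Real.exp (-((levelGap k - η) * luscherLambda β L) / L) * levelValue su2Rep L β 0)) :
    ∃ (lam : ℕ → ℝ) (L : ℕ → ℕ) (β : ℕ → ℝ), ∀ n : ℕ,
      0 < lam n ∧ lam n ≤ 1 / ((n : ℝ) + 1) ∧ n ≤ L n ∧ InFemtoWindow (lam n) (β n) (L n + 1) ∧
      ¬ (Real.exp (-((levelGap k + η) * luscherLambda (β n) (L n + 1)) / (L n + 1 : ℕ)) * levelValue su2Rep (L n + 1) (β n) 0 ≤
            levelValue su2Rep (L n + 1) (β n) k ∧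
          levelValue su2Rep (L n + 1) (β n) k ≤
            Real.exp (-((levelGap k - η) * luscherLambda (β n) (L n + 1)) / (L n + 1 : ℕ)) * levelValue su2Rep (L n + 1) (β n) 0) ∧
      ∀ i ≤ n, |traceRatio (L n + 1) (β n) (femtoSteps (qgrid i) (β n) (L n + 1)) -
          traceRatio 1 (oneSiteCoupling (β n) (L n + 1)) (femtoSteps (qgrid i) (β n) (L n + 1))| ≤ 1 / ((n : ℝ) + 1) := by
  classical
  have main : ∀ n : ℕ, ∃ (lam : ℝ) (L : ℕ) (β : ℝ),
      0 < lam ∧ lam ≤ 1 / ((n : ℝ) + 1) ∧ n ≤ L ∧ InFemtoWindow lam β (L + 1) ∧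
      ¬ (Real.exp (-((levelGap k + η) * luscherLambda β (L + 1)) / (L + 1 : ℕ)) * levelValue su2Rep (L + 1) β 0 ≤
            levelValue su2Rep (L + 1) β k ∧
          levelValue su2Rep (L + 1) β k ≤
            Real.exp (-((levelGap k - η) * luscherLambda β (L + 1)) / (L + 1 : ℕ)) * levelValue su2Rep (L + 1) β 0) ∧
      ∀ i ≤ n, |traceRatio (L + 1) β (femtoSteps (qgrid i) β (L + 1)) -
          traceRatio 1 (oneSiteCoupling β (L + 1)) (femtoSteps (qgrid i) β (L + 1))| ≤ 1 / ((n : ℝ) + 1) := by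
    intro n
    have hε : (0 : ℝ) < 1 / ((n : ℝ) + 1) := by positivity
    have hT : ∀ i : ℕ, ∃ lam0 : ℝ, 0 < lam0 ∧ ∀ lam : ℝ, 0 < lam → lam ≤ lam0 → ∃ L0 : ℕ, ∀ (L : ℕ) [NeZero L], L0 ≤ L →
        ∀ β : ℝ, InFemtoWindow lam β L → |traceRatio L β (femtoSteps (qgrid i) β L) -
          traceRatio 1 (oneSiteCoupling β L) (femtoSteps (qgrid i) β L)| ≤ 1 / ((n : ℝ) + 1) :=
      fun i => hTS (qgrid i) (qgrid_pos i) _ hε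
    choose lam0 hlam0 hT' using hT
    set lamStar : ℝ := min (1 / ((n : ℝ) + 1)) ((Finset.range (n + 1)).inf' ⟨0, by simp⟩ lam0) with hlamStar
    have hlamStar_pos : 0 < lamStar := lt_min hε ((Finset.lt_inf'_iff _).mpr fun i _ => hlam0 i)
    have hlamStar_le : ∀ i ≤ n, lamStar ≤ lam0 i := fun i hi =>
      (min_le_right _ _).trans (Finset.inf'_le _ (Finset.mem_range.mpr (Nat.lt_succ_of_le hi)))
    -- the violation, with the lattice size written as a successor
    have hv : ∃ lam : ℝ, 0 < lam ∧ lam ≤ lamStar ∧ ∀ L0 : ℕ, ∃ L' : ℕ, L0 ≤ L' + 1 ∧ ∃ β : ℝ, InFemtoWindow lam β (L' + 1) ∧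
        ¬ (Real.exp (-((levelGap k + η) * luscherLambda β (L' + 1)) / (L' + 1 : ℕ)) * levelValue su2Rep (L' + 1) β 0 ≤
              levelValue su2Rep (L' + 1) β k ∧
            levelValue su2Rep (L' + 1) β k ≤
              Real.exp (-((levelGap k - η) * luscherLambda β (L' + 1)) / (L' + 1 : ℕ)) * levelValue su2Rep (L' + 1) β 0) := by
      by_contra hcon
      apply hviol
      refine ⟨lamStar, hlamStar_pos, fun lam hl hle => ?_⟩
      by_contra hno
      apply hcon
      refine ⟨lam, hl, hle, fun L0 => ?_⟩
      by_contra hno2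
      apply hno
      refine ⟨L0, ?_⟩
      intro L inst hL β hW
      by_contra hP
      cases L with
      | zero => exact absurd rfl (NeZero.ne 0)
      | succ L' => exact hno2 ⟨L', hL, β, hW, hP⟩
    obtain ⟨lam, hl, hle, hv'⟩ := hv
    have hL0 : ∀ i : ℕ, ∃ L0 : ℕ, i ≤ n → ∀ (L : ℕ) [NeZero L], L0 ≤ L → ∀ β : ℝ, InFemtoWindow lam β L →
        |traceRatio L β (femtoSteps (qgrid i) β L) - traceRatio 1 (oneSiteCoupling β L) (femtoSteps (qgrid i) β L)| ≤
          1 / ((n : ℝ) + 1) := by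
      intro i
      by_cases hi : i ≤ n
      · obtain ⟨L0, h⟩ := hT' i lam hl (hle.trans (hlamStar_le i hi))
        exact ⟨L0, fun _ => h⟩
      · exact ⟨0, fun h => absurd h hi⟩
    choose L0 hL0' using hL0
    obtain ⟨L', hLge, β, hW, hP⟩ := hv' (max (n + 1) ((Finset.range (n + 1)).sup L0))
    have h1 : n + 1 ≤ L' + 1 := (le_max_left _ _).trans hLge
    refine ⟨lam, L', β, hl, hle.trans (min_le_left _ _), by omega, hW, hP, fun i hi => ?_⟩
    have hi' : L0 i ≤ L' + 1 :=
      (Finset.le_sup (f := L0) (Finset.mem_range.mpr (Nat.lt_succ_of_le hi))).trans ((le_max_right _ _).trans hLge)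
    exact hL0' i hi (L' + 1) hi' β hW
  choose lam L β h using main
  exact ⟨lam, L, β, h⟩

/-- **Summed discrepancy** at a fixed lattice: for `T ≥ 2`, `σ = T/c ∈ [σ_min, S]`,
`|Σ_j e^{−σ ã_j} − m(T)| ≤ Σ_j min(x_j², Sδ j) + Σ_{j ≥ 1} e^{−σ_min j/δ}`. -/
theorem abs_tsum_exp_atomReg_sub_levelMoment_le (hTF : TraceFormula) {L : ℕ} [NeZero L] {β : ℝ} (hβ : 1 ≤ β)
    {c δ : ℝ} (hc : 0 < c) (hδ : 0 < δ) (hδ1 : δ ≤ 1) {T : ℕ} (hT : 2 ≤ T) {σmin S : ℝ} (hσmin : 0 < σmin)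
    (hlow : σmin ≤ (T : ℝ) / c) (hup : (T : ℝ) / c ≤ S)
    (hs1 : Summable fun j : ℕ => min (xval L β j ^ 2) (S * δ * j))
    (hs2 : Summable fun j : ℕ => if j = 0 then (0 : ℝ) else Real.exp (-σmin * ((j : ℝ) / δ))) :
    |(∑' j : ℕ, Real.exp (-((T : ℝ) / c) * atomReg L β c δ j)) - levelMoment L β T| ≤
      (∑' j : ℕ, min (xval L β j ^ 2) (S * δ * j)) + (∑' j : ℕ, if j = 0 then (0 : ℝ) else Real.exp (-σmin * ((j : ℝ) / δ))) := by
  have hβ0 : 0 ≤ β := by linarith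
  have hσ : 0 < (T : ℝ) / c := lt_of_lt_of_le hσmin hlow
  have hu : Summable fun j : ℕ => Real.exp (-((T : ℝ) / c) * atomReg L β c δ j) := summable_exp_atomReg hβ0 hδ hδ1 hσ
  have hv : Summable fun j : ℕ => xval L β j ^ T := (hasSum_xval_pow hTF hβ hT).summable
  have hm : levelMoment L β T = ∑' j : ℕ, xval L β j ^ T := rfl
  rw [hm, ← hu.tsum_sub hv, ← hs1.tsum_add hs2]
  have habs : Summable fun j : ℕ => |Real.exp (-((T : ℝ) / c) * atomReg L β c δ j) - xval L β j ^ T| := (hu.sub hv).abs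
  have h1 : |∑' j : ℕ, (Real.exp (-((T : ℝ) / c) * atomReg L β c δ j) - xval L β j ^ T)| ≤
      ∑' j : ℕ, |Real.exp (-((T : ℝ) / c) * atomReg L β c δ j) - xval L β j ^ T| := by
    have hs : Summable fun j : ℕ => ‖Real.exp (-((T : ℝ) / c) * atomReg L β c δ j) - xval L β j ^ T‖ := by
      simpa only [Real.norm_eq_abs] using habs
    have := norm_tsum_le_tsum_norm hs
    simpa only [Real.norm_eq_abs] using this
  refine h1.trans (Summable.tsum_le_tsum (fun j => ?_) habs (hs1.add hs2))
  refine (abs_exp_atomReg_sub_le hβ0 hc hδ hδ1 T j).trans (add_le_add ?_ ?_)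
  · apply min_le_min (xval_pow_le_sq hβ0 j hT)
    have hj : (0 : ℝ) ≤ j := Nat.cast_nonneg j
    have : (T : ℝ) / c * δ ≤ S * δ := mul_le_mul_of_nonneg_right hup hδ.le
    exact mul_le_mul_of_nonneg_right this hj
  · split_ifs with hj
    · exact le_rfl
    · apply Real.exp_le_exp.mpr
      have hjδ : (0 : ℝ) ≤ (j : ℝ) / δ := by positivity
      nlinarith

/-! ### §6.3 Assembly -/

/-- ★ **`TraceInversion` PROVED (rev 6).**  `TraceFormula → TwistedTraceScaling → LevelGapSummable → OneSiteTraceLimit → CoarseLevels`, by contradiction through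
the landed Tauberian theorem `laplaceAtoms` applied to the regularised femto atoms of a violating sequence of lattices. [cite: Feller1971, XIII.1 Thm 2a] -/
theorem traceInversion : TraceInversion := by
  classical
  intro hTF hTS hLG hOS k η hη
  by_contra hviol
  obtain ⟨lam, L, β, hP⟩ := extract hTS hviol
  have hlam : ∀ n, 0 < lam n := fun n => (hP n).1
  have hlamle : ∀ n, lam n ≤ 1 / ((n : ℝ) + 1) := fun n => (hP n).2.1
  have hnL : ∀ n, n ≤ L n := fun n => (hP n).2.2.1
  have hW : ∀ n, InFemtoWindow (lam n) (β n) (L n + 1) := fun n => (hP n).2.2.2.1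
  have hV := fun n => (hP n).2.2.2.2.1
  have hTTS := fun n => (hP n).2.2.2.2.2
  have hlam1 : ∀ n, lam n ≤ 1 := fun n => (hlamle n).trans (by rw [div_le_one (by positivity)]; linarith)
  have hΛpos : ∀ n, 0 < luscherLambda (β n) (L n + 1) := fun n => luscherLambda_pos_of_window (hlam n) (hW n)
  have hΛle2 : ∀ n, luscherLambda (β n) (L n + 1) ≤ 2 := fun n => by linarith [(hW n).2.2, hlam1 n]
  have hβ1 : ∀ n, 1 ≤ β n := fun n => (hW n).1
  have hβ0 : ∀ n, 0 ≤ β n := fun n => zero_le_one.trans (hβ1 n)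
  have hLpos : ∀ n, (0 : ℝ) < ((L n + 1 : ℕ) : ℝ) := fun n => by positivity
  -- the conversion factor `c_n = L/λ → ∞`
  obtain ⟨c, hc⟩ : ∃ c : ℕ → ℝ, ∀ n, c n = ((L n + 1 : ℕ) : ℝ) / luscherLambda (β n) (L n + 1) := ⟨_, fun _ => rfl⟩
  have hcpos : ∀ n, 0 < c n := fun n => by rw [hc]; exact div_pos (hLpos n) (hΛpos n)
  have hcge : ∀ n : ℕ, ((n : ℝ) + 1) / 2 ≤ c n := fun n => by
    rw [hc, div_le_div_iff₀ (by norm_num : (0 : ℝ) < 2) (hΛpos n)]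
    have h2 : (n : ℝ) + 1 ≤ ((L n + 1 : ℕ) : ℝ) := by exact_mod_cast Nat.succ_le_succ (hnL n)
    nlinarith [hΛle2 n, hΛpos n]
  have hnat : Tendsto (fun n : ℕ => (n : ℝ) + 1) atTop atTop := tendsto_natCast_atTop_atTop.atTop_add tendsto_const_nhds
  have hc_top : Tendsto c atTop atTop := tendsto_atTop_mono hcge (hnat.atTop_div_const (by norm_num))
  have hc_inv : Tendsto (fun n => 1 / c n) atTop (𝓝 0) := by
    simpa only [one_div, Function.comp_def] using tendsto_inv_atTop_zero.comp hc_top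
  -- the one-site couplings `B_n → ∞`, `λ_bare(B_n) = 1/c_n`
  have hbare : ∀ n, bareLambda (oneSiteCoupling (β n) (L n + 1)) = 1 / c n := fun n => by
    rw [bareLambda_oneSiteCoupling (hΛpos n), hc, one_div_div]
  have hB_top : Tendsto (fun n => oneSiteCoupling (β n) (L n + 1)) atTop atTop := by
    have hlow : ∀ n : ℕ, ((n : ℝ) + 1) / 4 ≤ oneSiteCoupling (β n) (L n + 1) := by
      intro n
      have h1 := oneSiteCoupling_ge_of_window (hlam n) (hW n)
      have hl := hlam n
      have h3 : lam n ^ 3 ≤ lam n := by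
        have := pow_le_pow_of_le_one hl.le (hlam1 n) (by norm_num : 1 ≤ 3); simpa using this
      have h4 : ((n : ℝ) + 1) * lam n ≤ 1 := by
        have := hlamle n; rw [le_div_iff₀ (by positivity)] at this; linarith
      calc ((n : ℝ) + 1) / 4 ≤ 1 / (4 * lam n) := by
            rw [div_le_div_iff₀ (by norm_num) (by positivity)]; nlinarith
        _ ≤ 1 / (4 * lam n ^ 3) := by
            apply one_div_le_one_div_of_le (by positivity); nlinarith
        _ ≤ _ := h1
    exact tendsto_atTop_mono hlow (hnat.atTop_div_const (by norm_num))
  -- regularisation scales `δ_n → 0` and the atoms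
  have hx2 : ∀ n, Summable fun j => xval (L n + 1) (β n) j ^ 2 := fun n => (hasSum_xval_pow hTF (hβ1 n) le_rfl).summable
  have hδex := fun n : ℕ => exists_delta (fun j => xval_nonneg (L := L n + 1) (hβ0 n) j) (hx2 n)
    (one_div_pos.mpr (hcpos n)) (by positivity : (0 : ℝ) < (n : ℝ) + 1) (by positivity : (0 : ℝ) < 1 / ((n : ℝ) + 1))
  choose δ hδpos hδ1 hδε hS1 hS2 hFG using hδex
  have hδ0 : Tendsto δ atTop (𝓝 0) := squeeze_zero (fun n => (hδpos n).le) hδε tendsto_one_div_add_atTop_nhds_zero_nat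
  obtain ⟨a, ha⟩ : ∃ a : ℕ → ℕ → ℝ, ∀ n, a n = atomReg (L n + 1) (β n) (c n) (δ n) := ⟨_, fun _ => rfl⟩
  have ha0 : ∀ n, a n 0 = 0 := fun n => by rw [ha]; exact atomReg_zero _ _
  have hamono : ∀ n, Monotone (a n) := fun n => by rw [ha]; exact atomReg_mono _ _
  have hann : ∀ n j, 0 ≤ a n j := fun n j => by rw [ha]; exact atomReg_nonneg (hβ0 n) (hδpos n) (hδ1 n) j
  have hasum : ∀ n (s : ℝ), 0 < s → Summable fun j => Real.exp (-s * a n j) := fun n s hs => by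
    rw [ha]; exact summable_exp_atomReg (hβ0 n) (hδpos n) (hδ1 n) hs
  -- femto step counts `T = ⌈q c_n⌉`
  have hTge : ∀ q : ℝ, 0 < q → ∀ n, q * c n ≤ (femtoSteps q (β n) (L n + 1) : ℝ) := fun q hq n => by
    unfold femtoSteps; rw [hc, ← mul_div_assoc]; exact Nat.le_ceil _
  have hTlt : ∀ q : ℝ, 0 < q → ∀ n, (femtoSteps q (β n) (L n + 1) : ℝ) < q * c n + 1 := fun q hq n => by
    unfold femtoSteps; rw [hc, ← mul_div_assoc]
    exact Nat.ceil_lt_add_one (div_nonneg (mul_nonneg hq.le (Nat.cast_nonneg _)) (hΛpos n).le)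
  have hσlow : ∀ q : ℝ, 0 < q → ∀ n, q ≤ (femtoSteps q (β n) (L n + 1) : ℝ) / c n := fun q hq n => by
    rw [le_div_iff₀ (hcpos n)]; exact hTge q hq n
  have hσup : ∀ q : ℝ, 0 < q → ∀ n, (femtoSteps q (β n) (L n + 1) : ℝ) / c n ≤ q + 1 / c n := fun q hq n => by
    rw [div_le_iff₀ (hcpos n), add_mul, one_div_mul_cancel (hcpos n).ne']; exact (hTlt q hq n).le
  have hσmin : ∀ q : ℝ, 0 < q → ∀ n, 1 / c n ≤ (femtoSteps q (β n) (L n + 1) : ℝ) / c n := fun q hq n => by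
    apply div_le_div_of_nonneg_right _ (hcpos n).le
    have hpos : (0 : ℝ) < femtoSteps q (β n) (L n + 1) := lt_of_lt_of_le (mul_pos hq (hcpos n)) (hTge q hq n)
    have h1 : 1 ≤ femtoSteps q (β n) (L n + 1) :=
      Nat.one_le_iff_ne_zero.mpr fun h0 => by rw [h0] at hpos; simp at hpos
    exact_mod_cast h1
  -- ═══ the Tauberian step: every regularised atom sequence converges to Lüscher's gap ═══
  have hconv : ∀ j, Tendsto (fun n => a n j) atTop (𝓝 (levelGap j)) := by
    refine Literature.Analysis.Asymptotics.LaplaceAtoms.laplaceAtoms levelGap a levelGap_zero levelGap_mono' hLG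
      ha0 hamono hasum ?_
    intro s hs
    have hq : ∀ m, 0 < qgrid (qapprox s m) := fun m => qgrid_pos _
    -- Claim A: at every grid point the regularised dyadic ratio converges to Lüscher's ratio
    have claimA : ∀ m, Tendsto (fun n =>
        |(∑' j, Real.exp (-(2 * ((femtoSteps (qgrid (qapprox s m)) (β n) (L n + 1) : ℝ) / c n)) * a n j)) /
            (∑' j, Real.exp (-((femtoSteps (qgrid (qapprox s m)) (β n) (L n + 1) : ℝ) / c n) * a n j)) ^ 2 -
          hTraceRatio (qgrid (qapprox s m))|) atTop (𝓝 0) := by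
      intro m
      set q : ℝ := qgrid (qapprox s m) with hq_def
      have hq0 : 0 < q := hq m
      obtain ⟨T, hT⟩ : ∃ T : ℕ → ℕ, ∀ n, T n = femtoSteps q (β n) (L n + 1) := ⟨_, fun _ => rfl⟩
      simp only [← hT]
      have hT1 : ∀ n, 1 / c n ≤ (T n : ℝ) / c n := fun n => by rw [hT]; exact hσmin q hq0 n
      have hTq' : ∀ n, (T n : ℝ) / c n ≤ q + 1 / c n := fun n => by rw [hT]; exact hσup q hq0 n
      have hE1 : ∀ᶠ n in atTop, 2 ≤ T n := by
        filter_upwards [hc_top.eventually (eventually_ge_atTop (2 / q))] with n hn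
        have h1 : (2 : ℝ) ≤ q * c n := by rw [div_le_iff₀ hq0] at hn; linarith
        have h2 := hTge q hq0 n
        rw [← hT] at h2
        exact_mod_cast h1.trans h2
      have hE2 : ∀ᶠ n in atTop, 1 ≤ oneSiteCoupling (β n) (L n + 1) := hB_top.eventually (eventually_ge_atTop 1)
      have hE3 : ∀ᶠ n in atTop, qapprox s m ≤ n := eventually_ge_atTop _
      have hE4 : ∀ᶠ n in atTop, 2 * (q + 1 / c n) ≤ (n : ℝ) + 1 := by
        have h1 : ∀ᶠ n in atTop, 1 / c n ≤ 1 := hc_inv.eventually (eventually_le_nhds one_pos)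
        have h2 : ∀ᶠ n : ℕ in atTop, 2 * (q + 1) ≤ (n : ℝ) + 1 := by
          obtain ⟨N, hN⟩ := exists_nat_ge (2 * (q + 1))
          refine eventually_atTop.mpr ⟨N, fun n hn => hN.trans ?_⟩
          have : (N : ℝ) ≤ n := by exact_mod_cast hn
          linarith
        filter_upwards [h1, h2] with n h1 h2
        linarith
      have hOS1 : Tendsto (fun n => levelRatio 1 (oneSiteCoupling (β n) (L n + 1)) (T n)) atTop (𝓝 (hTraceRatio q)) :=
        tendsto_levelRatio_oneSite hOS hq0 hB_top (fun n => by rw [hT]; exact femtoSteps_mul_sub_le hq0.le (hlam n) (hW n))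
      -- the eventual bound
      have hbound : ∀ᶠ n in atTop,
          |(∑' j, Real.exp (-(2 * ((T n : ℝ) / c n)) * a n j)) / (∑' j, Real.exp (-((T n : ℝ) / c n) * a n j)) ^ 2 -
              hTraceRatio q| ≤
            4 * (1 / ((n : ℝ) + 1)) + |levelRatio 1 (oneSiteCoupling (β n) (L n + 1)) (T n) - hTraceRatio q| := by
        filter_upwards [hE1, hE2, hE3, hE4] with n h1 h2 h3 h4
        have hic : 0 < 1 / c n := one_div_pos.mpr (hcpos n)
        have hσpos : 0 < (T n : ℝ) / c n := lt_of_lt_of_le hic (hT1 n)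
        have hσS : (T n : ℝ) / c n ≤ (n : ℝ) + 1 := by linarith [hTq' n]
        have h2T : ((2 * T n : ℕ) : ℝ) / c n = 2 * ((T n : ℝ) / c n) := by push_cast; ring
        have hσS2 : ((2 * T n : ℕ) : ℝ) / c n ≤ (n : ℝ) + 1 := by rw [h2T]; linarith [hTq' n]
        have hσmin2 : 1 / c n ≤ ((2 * T n : ℕ) : ℝ) / c n := by rw [h2T]; linarith [hT1 n]
        have hD1 := abs_tsum_exp_atomReg_sub_levelMoment_le hTF (hβ1 n) (hcpos n) (hδpos n) (hδ1 n) h1 hic (hT1 n) hσS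
          (hS1 n) (hS2 n)
        have hD2 := abs_tsum_exp_atomReg_sub_levelMoment_le hTF (hβ1 n) (hcpos n) (hδpos n) (hδ1 n)
          (by omega : 2 ≤ 2 * T n) hic hσmin2 hσS2 (hS1 n) (hS2 n)
        rw [← ha n] at hD1 hD2
        have e1 : |levelMoment (L n + 1) (β n) (T n) - ∑' j, Real.exp (-((T n : ℝ) / c n) * a n j)| ≤ 1 / ((n : ℝ) + 1) := by
          rw [abs_sub_comm]; exact hD1.trans (hFG n)
        have e2 : |levelMoment (L n + 1) (β n) (2 * T n) - ∑' j, Real.exp (-(((2 * T n : ℕ) : ℝ) / c n) * a n j)| ≤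
            1 / ((n : ℝ) + 1) := by
          rw [abs_sub_comm]; exact hD2.trans (hFG n)
        -- sizes for the ratio perturbation lemma
        have hBge : 1 ≤ levelMoment (L n + 1) (β n) (T n) := by
          have hs := (hasSum_xval_pow (L := L n + 1) hTF (hβ1 n) h1).summable
          have := hs.le_tsum 0 (fun j _ => pow_nonneg (xval_nonneg (L := L n + 1) (hβ0 n) j) _)
          rw [xval_zero, one_pow] at this
          exact this
        have hB'ge : 1 ≤ ∑' j, Real.exp (-((T n : ℝ) / c n) * a n j) := by
          have := (hasum n _ hσpos).le_tsum 0 (fun j _ => (Real.exp_pos _).le)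
          rw [ha0, mul_zero, Real.exp_zero] at this
          exact this
        have hA'nn : 0 ≤ ∑' j, Real.exp (-(((2 * T n : ℕ) : ℝ) / c n) * a n j) := tsum_nonneg fun j => (Real.exp_pos _).le
        have hA'B' : (∑' j, Real.exp (-(((2 * T n : ℕ) : ℝ) / c n) * a n j)) ≤ ∑' j, Real.exp (-((T n : ℝ) / c n) * a n j) := by
          refine Summable.tsum_le_tsum (fun j => ?_) (hasum n _ (by rw [h2T]; linarith)) (hasum n _ hσpos)
          apply Real.exp_le_exp.mpr
          rw [h2T]
          nlinarith [hann n j]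
        have hR := ratio_sub_ratio_le (A := levelMoment (L n + 1) (β n) (2 * T n)) hBge hB'ge hA'nn hA'B'
        -- currency conversions
        have hLR : traceRatio (L n + 1) (β n) (T n) = levelRatio (L n + 1) (β n) (T n) := traceRatio_eq_levelRatio hTF (hβ1 n) h1
        have hLR1 : traceRatio 1 (oneSiteCoupling (β n) (L n + 1)) (T n) = levelRatio 1 (oneSiteCoupling (β n) (L n + 1)) (T n) :=
          traceRatio_eq_levelRatio hTF h2 h1
        have hTT := hTTS n (qapprox s m) h3
        rw [← hq_def] at hTT
        rw [← hT n, hLR, hLR1] at hTT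
        unfold levelRatio at hTT ⊢
        rw [show (2 : ℝ) * ((T n : ℝ) / c n) = ((2 * T n : ℕ) : ℝ) / c n from h2T.symm]
        have t1 := abs_sub_le ((∑' j, Real.exp (-(((2 * T n : ℕ) : ℝ) / c n) * a n j)) /
            (∑' j, Real.exp (-((T n : ℝ) / c n) * a n j)) ^ 2)
          (levelMoment (L n + 1) (β n) (2 * T n) / levelMoment (L n + 1) (β n) (T n) ^ 2) (hTraceRatio q)
        have t2 := abs_sub_le (levelMoment (L n + 1) (β n) (2 * T n) / levelMoment (L n + 1) (β n) (T n) ^ 2)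
          (levelMoment 1 (oneSiteCoupling (β n) (L n + 1)) (2 * T n) / levelMoment 1 (oneSiteCoupling (β n) (L n + 1)) (T n) ^ 2)
          (hTraceRatio q)
        rw [abs_sub_comm] at hR
        linarith
      refine squeeze_zero' (Eventually.of_forall fun n => abs_nonneg _) hbound ?_
      have := (tendsto_one_div_add_atTop_nhds_zero_nat.const_mul (4 : ℝ)).add (tendsto_iff_norm_sub_tendsto_zero.mp hOS1)
      simpa only [mul_zero, zero_add, Real.norm_eq_abs] using this
    -- diagonal selection over the dyadic approximants of `s`
    obtain ⟨φ, hφ, hφu⟩ := exists_diag claimA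
    have hφu' : Tendsto (fun n =>
        |(∑' j, Real.exp (-(2 * ((femtoSteps (qgrid (qapprox s (φ n))) (β n) (L n + 1) : ℝ) / c n)) * a n j)) /
            (∑' j, Real.exp (-((femtoSteps (qgrid (qapprox s (φ n))) (β n) (L n + 1) : ℝ) / c n) * a n j)) ^ 2 -
          hTraceRatio (qgrid (qapprox s (φ n)))|) atTop (𝓝 0) := hφu
    have hh : Tendsto (fun n => hTraceRatio (qgrid (qapprox s (φ n)))) atTop (𝓝 (hTraceRatio s)) :=
      tendsto_hTraceRatio hs ((tendsto_qgrid_qapprox hs).comp hφ)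
    refine ⟨fun n => (femtoSteps (qgrid (qapprox s (φ n))) (β n) (L n + 1) : ℝ) / c n, ?_, ?_⟩
    · -- `σ_n → s`
      have hup : Tendsto (fun n => s + (1 / 2 : ℝ) ^ (φ n) + 1 / c n) atTop (𝓝 s) := by
        have h1 : Tendsto (fun n => (1 / 2 : ℝ) ^ (φ n)) atTop (𝓝 0) :=
          (tendsto_pow_atTop_nhds_zero_of_lt_one (by norm_num) (by norm_num)).comp hφ
        have := ((tendsto_const_nhds (x := s)).add h1).add hc_inv
        simpa only [add_zero] using this
      refine tendsto_of_tendsto_of_tendsto_of_le_of_le tendsto_const_nhds hup (fun n => ?_) (fun n => ?_)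
      · exact (le_qgrid_qapprox hs (φ n)).trans (hσlow _ (hq _) n)
      · have h1 := hσup _ (hq (φ n)) n
        have h2 := qgrid_qapprox_le hs (φ n)
        change (femtoSteps (qgrid (qapprox s (φ n))) (β n) (L n + 1) : ℝ) / c n ≤ s + (1 / 2 : ℝ) ^ (φ n) + 1 / c n
        linarith
    · -- the ratios converge to `r_𝔥(s)`
      change Tendsto (fun n =>
        (∑' j, Real.exp (-(2 * ((femtoSteps (qgrid (qapprox s (φ n))) (β n) (L n + 1) : ℝ) / c n)) * a n j)) /
          (∑' j, Real.exp (-((femtoSteps (qgrid (qapprox s (φ n))) (β n) (L n + 1) : ℝ) / c n) * a n j)) ^ 2)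
        atTop (𝓝 (hTraceRatio s))
      rw [tendsto_iff_norm_sub_tendsto_zero]
      have h0 := hφu'.add (tendsto_iff_norm_sub_tendsto_zero.mp hh)
      rw [add_zero] at h0
      refine squeeze_zero (fun n => norm_nonneg _) (fun n => ?_) h0
      rw [Real.norm_eq_abs, Real.norm_eq_abs]
      exact abs_sub_le _ _ _
  -- ═══ the contradiction at level `k` ═══
  have hk := hconv k
  have hev1 : ∀ᶠ n in atTop, δ n * k ≤ η / 2 := by
    have : Tendsto (fun n => δ n * k) atTop (𝓝 0) := by simpa using hδ0.mul_const (k : ℝ)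
    exact this.eventually (eventually_le_nhds (by positivity : (0 : ℝ) < η / 2))
  have hev2 : ∀ᶠ n in atTop, k ≠ 0 → levelGap k + η ≤ k / δ n := by
    by_cases hk0 : k = 0
    · exact Eventually.of_forall fun n h => absurd hk0 h
    · have hk1 : (1 : ℝ) ≤ k := by exact_mod_cast Nat.one_le_iff_ne_zero.mpr hk0
      have hpos : 0 ≤ levelGap k + η := by linarith [levelGap_nonneg k]
      obtain ⟨N, hN⟩ := exists_nat_ge (levelGap k + η)
      refine eventually_atTop.mpr ⟨N, fun n hn _ => ?_⟩
      rw [le_div_iff₀ (hδpos n)]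
      have hn' : (N : ℝ) ≤ n := by exact_mod_cast hn
      have h1 : (levelGap k + η) * δ n ≤ (n : ℝ) * (1 / ((n : ℝ) + 1)) :=
        mul_le_mul (hN.trans hn') (hδε n) (hδpos n).le (Nat.cast_nonneg n)
      have h2 : (n : ℝ) * (1 / ((n : ℝ) + 1)) ≤ 1 := by
        rw [mul_one_div, div_le_one (by positivity)]; linarith
      linarith
  obtain ⟨N3, hN3⟩ := (Metric.tendsto_atTop.mp hk) (η / 4) (by positivity)
  obtain ⟨n, hn1, hn2, hn3⟩ := (hev1.and (hev2.and (eventually_ge_atTop N3))).exists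
  have hfar := far_of_violation (hβ0 n) (hΛpos n) (hδpos n) hη hn1 hn2 (hV n)
  rw [← hc n, ← ha n] at hfar
  have hnear := hN3 n hn3
  rw [Real.dist_eq] at hnear
  linarith

end Inv

end Summit.QuantumFields.YangMills.Cruxes.RunningReduction.TT


/-! ═══
# PART 7 (rev 6) — the former stub `stub_traceInversion` DISCHARGED; rev-6 compositions (the «TT» door is now 5-ary: TF, TTS, OSTL + the two shared KT stubs)
═══ -/

namespace Summit.QuantumFields.YangMills.Cruxes.RunningReduction.TT

/-- FORMER stub (M), PROVED in rev 6 (PART 6 «INV»): the Tauberian inversion. [cite: Feller1971, XIII.1 Thm 2a] -/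
theorem stub_traceInversion : Stmt.stub_traceInversion := Inv.traceInversion

/-- ★ **rev-6 composition («TT» door)**: `stub_traceFormula → stub_twistedTraceScaling → stub_oneSiteTraceLimit → KT.stub_dressedRitz → KT.stub_oneSiteLowerCoarse →
RunningReduction` — `LevelGapSummable` (rev 5) and `TraceInversion` (rev 6) are discharged in-file. -/
theorem RunningReduction_of_trace6 :
    Stmt.stub_traceFormula → Stmt.stub_twistedTraceScaling → Stmt.stub_oneSiteTraceLimit →
      KT.Stmt.stub_dressedRitz → KT.Stmt.stub_oneSiteLowerCoarse →
      Summit.QuantumFields.YangMills.Theses.LuscherReduction.RunningReduction :=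
  fun hTF hTS hOS hDR hLow => RunningReduction_of_trace hTF hTS hOS stub_traceInversion hDR hLow

/-- The same with the route's crux ONE in place of `KT.stub_oneSiteLowerCoarse`. -/
theorem RunningReduction_of_trace6_ONE
    (hTF : Stmt.stub_traceFormula) (hTS : Stmt.stub_twistedTraceScaling) (hOS : Stmt.stub_oneSiteTraceLimit)
    (hDR : KT.Stmt.stub_dressedRitz) (hONE : Summit.QuantumFields.YangMills.Theses.LuscherReduction.OneSiteLevels) :
    Summit.QuantumFields.YangMills.Theses.LuscherReduction.RunningReduction :=
  RunningReduction_of_trace6 hTF hTS hOS hDR (KT.stub_oneSiteLowerCoarse_of_ONE hONE)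

/-- rev 6: the three open «TT»-proper stubs already give the coarse two-sided Lüscher law `CoarseLevels` for EVERY level. -/
theorem coarseLevels_of_stubs6 (hTF : Stmt.stub_traceFormula) (hTS : Stmt.stub_twistedTraceScaling)
    (hOS : Stmt.stub_oneSiteTraceLimit) : CoarseLevels :=
  Inv.traceInversion hTF hTS stub_levelGapSummable hOS

end Summit.QuantumFields.YangMills.Cruxes.RunningReduction.TT

/-! ═══
# PART 8 «OST» (rev 7, owner ym-beyond-p1 g18) — the one-site stub reduced to the route's crux ONE:
# `OneSiteLevels → LevelGapSummable → OneSiteTail → OneSiteTraceLimit` (PROVED), new registered stub `stub_oneSiteTail` (M)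

`OneSiteTraceLimit` (registered stub, M/L) asks, in LEVEL currency at ONE site, that the normalised moment ratio `m_B(2T)/m_B(T)²`, `m_B(T) = Σ_k x_k(B)^T`,
`x_k = λ_k(B)/λ_0(B)`, tends to `r_𝔥(s) = Σ e^{−2sΔ_k}/(Σ e^{−sΔ_k})²` as `B → ∞` with `|Tλ_b(B) − s| ≤ λ_b(B)`.  The route's crux ONE (`OneSiteLevels`, stmt-QuantumFields-20007,
closed modulo AL1 by the 20007 lineage) gives, LEVEL BY LEVEL, `x_k(B) = exp(−(λ_bΔ_k ± C_kλ_b²))` for `B ≥ B0(k)` — hence `x_k(B)^T → e^{−sΔ_k}` termwise, uniformly over the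
admissible `T`.  What ONE does not give is UNIFORMITY IN `k`: the tails `Σ_{k ≥ K} x_k(B)^T`.  PART 8 isolates exactly that as the new registered stub

  `OneSiteTail`:  ∀ s > 0, ∀ ε > 0, ∃ K B0, ∀ B ≥ B0, ∀ T with s ≤ 2Tλ_b(B):  Summable (x_k(B)^T)_k  ∧  Σ_k x_{k+K}(B)^T ≤ ε

(M: a B-uniform domination of the one-site physical transfer values from above, e.g. `x_k(B) ≤ exp(−λ_b(B)·g(k))` with `g` Laplace-summable — the lattice-QM → continuum-QM trace-norm
statement for the three-matrix model on `SU(2)³`; true if the one-site femto partition function converges to `Tr e^{−s𝔥}` in the physical sector, which is the `L = 1` case of the very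
trace scaling the TT door assumes at every `L`), and PROVES `OST.oneSiteTraceLimit_of_ONE : OneSiteLevels → LevelGapSummable → OneSiteTail → OneSiteTraceLimit` (finite part termwise from
ONE with explicit thresholds `λ_b ≤ τ` via `bareLambda_le_of_le`; tails from `OneSiteTail` and from `LevelGapSummable` (`tendsto_sum_nat_add`); ratio by `Inv.ratio_sub_ratio_le`).
Rev-7 composition: `RunningReduction_of_trace7_ONE : TF → TTS → stub_oneSiteTail → KT.stub_dressedRitz → ONE → RED` — modulo the route's other crux ONE the TT door has FOUR open stubs
(traceFormula M, twistedTraceScaling XL, oneSiteTail M, dressedRitz XL/L).  `stub_oneSiteTraceLimit` stays registered (a direct proof not through ONE remains admissible).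
HONEST FRAMING: elementary real analysis; nothing of ONE, of the tail bound, or of the RG is proved here.
═══ -/

namespace Summit.QuantumFields.YangMills.Cruxes.RunningReduction.TT

open Summit.QuantumFields.YangMills.Theorems.FemtoTransferGap
open Summit.QuantumFields.YangMills.Cruxes.RunningReduction

/-- **`OneSiteTail` (new registered stub, M): B-uniform tail bound for the one-site femto moments.**  For every `s > 0` and `ε > 0` there are `K` and `B0` such that at
every one-site coupling `B ≥ B0` and every Euclidean time `T` with `s ≤ 2Tλ_b(B)` the normalised one-site transfer values have summable `T`-th powers with tail
`Σ_k x_{k+K}(B)^T ≤ ε`.  [cite: Luscher1983, §1] [cite: LuscherMunster1984] [cite: Simon1983, Thm 1.1] -/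
def OneSiteTail : Prop :=
  ∀ s : ℝ, 0 < s → ∀ ε : ℝ, 0 < ε → ∃ K : ℕ, ∃ B0 : ℝ, ∀ B : ℝ, B0 ≤ B → ∀ T : ℕ,
    s ≤ 2 * ((T : ℝ) * bareLambda B) →
      Summable (fun k : ℕ => (levelValue su2Rep 1 B k / levelValue su2Rep 1 B 0) ^ T) ∧
      ∑' k : ℕ, (levelValue su2Rep 1 B (k + K) / levelValue su2Rep 1 B 0) ^ T ≤ ε

namespace OST

/-- Tails of a nonnegative summable sequence decrease under further shifts. -/
theorem tsum_shift_le {f : ℕ → ℝ} (hf : Summable f) (h0 : ∀ k, 0 ≤ f k) (K d : ℕ) :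
    ∑' k, f (k + (K + d)) ≤ ∑' k, f (k + K) := by
  have hg : Summable (fun k => f (k + K)) := (summable_nat_add_iff K).2 hf
  have h := hg.sum_add_tsum_nat_add d
  have h1 : (fun k => f (k + (K + d))) = fun i => f (i + d + K) := by
    funext i; congr 1; omega
  have h2 : 0 ≤ ∑ i ∈ Finset.range d, f (i + K) := Finset.sum_nonneg fun i _ => h0 _
  rw [h1]
  linarith

/-- **Termwise limit from ONE.**  For each level `k`: `|x_k(B)^T − e^{−sΔ_k}| ≤ ε` for `B ≥ B1(k,s,ε)` and every `T` with `|Tλ_b − s| ≤ 2λ_b`. -/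
theorem term_close (hONE : Summit.QuantumFields.YangMills.Theses.LuscherReduction.OneSiteLevels) (k : ℕ)
    {s : ℝ} (hs : 0 < s) {ε : ℝ} (hε : 0 < ε) :
    ∃ B1 : ℝ, ∀ B : ℝ, B1 ≤ B → ∀ T : ℕ, |(T : ℝ) * bareLambda B - s| ≤ 2 * bareLambda B →
      |(levelValue su2Rep 1 B k / levelValue su2Rep 1 B 0) ^ T - Real.exp (-s * levelGap k)| ≤ ε := by
  obtain ⟨C, B0, h⟩ := hONE k
  have hΔ : 0 ≤ levelGap k := Inv.levelGap_nonneg k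
  set A : ℝ := 2 * levelGap k + |C| * (s + 2) + 1 with hA
  have hApos : 0 < A := by positivity
  have hA1 : 1 ≤ A := by
    have : 0 ≤ 2 * levelGap k + |C| * (s + 2) := by positivity
    linarith
  set τ : ℝ := min 1 (ε / 2) / A with hτ
  have hmpos : 0 < min 1 (ε / 2) := lt_min one_pos (by positivity)
  have hτpos : 0 < τ := div_pos hmpos hApos
  have hτA : τ * A = min 1 (ε / 2) := by rw [hτ]; field_simp
  have hτle1 : τ ≤ 1 := by
    have h1 : τ ≤ 1 / A := div_le_div_of_nonneg_right (min_le_left _ _) hApos.le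
    have h2 : 1 / A ≤ 1 := by rw [div_le_one hApos]; exact hA1
    exact h1.trans h2
  refine ⟨max B0 (max 1 (2 / τ ^ 3)), fun B hB T hT => ?_⟩
  have hB0 : B0 ≤ B := le_trans (le_max_left _ _) hB
  have hB1 : 1 ≤ B := le_trans ((le_max_left _ _).trans (le_max_right _ _)) hB
  have hBτ : 2 / τ ^ 3 ≤ B := le_trans ((le_max_right _ _).trans (le_max_right _ _)) hB
  have hlpos : 0 < bareLambda B := bareLambda_pos' (by linarith)
  have hlτ : bareLambda B ≤ τ := bareLambda_le_of_le hτpos hBτ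
  have hl1 : bareLambda B ≤ 1 := hlτ.trans hτle1
  obtain ⟨hpos0, hup, hlow⟩ := h B hB0
  set l := bareLambda B with hl
  set Δ := levelGap k with hΔdef
  set x := levelValue su2Rep 1 B k / levelValue su2Rep 1 B 0 with hx
  have hxup : x ≤ Real.exp (-(Δ * l - C * l ^ 2)) := by
    rw [hx, div_le_iff₀ hpos0]; exact hup
  have hxlow : Real.exp (-(Δ * l + C * l ^ 2)) ≤ x := by
    rw [hx, le_div_iff₀ hpos0]; exact hlow
  have hxpos : 0 < x := lt_of_lt_of_le (Real.exp_pos _) hxlow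
  have hTup : x ^ T ≤ Real.exp (-(Δ * l - C * l ^ 2)) ^ T := pow_le_pow_left₀ hxpos.le hxup T
  have hTlow : Real.exp (-(Δ * l + C * l ^ 2)) ^ T ≤ x ^ T := pow_le_pow_left₀ (Real.exp_pos _).le hxlow T
  rw [← Real.exp_nat_mul] at hTup hTlow
  have hu1 : (T : ℝ) * l ≤ s + 2 * l := by have := (abs_le.1 hT).2; linarith
  have hu2 : s - 2 * l ≤ (T : ℝ) * l := by have := (abs_le.1 hT).1; linarith
  have hu0 : 0 ≤ (T : ℝ) * l := by positivity
  -- ρ := l (2Δ + |C|(s+2)) ≤ τ A - τ ≤ min 1 (ε/2)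
  set ρ : ℝ := l * (2 * Δ + |C| * (s + 2)) with hρ
  have hρ0 : 0 ≤ ρ := by positivity
  have hρle : ρ ≤ min 1 (ε / 2) := by
    have h1 : ρ ≤ τ * (2 * Δ + |C| * (s + 2)) := mul_le_mul_of_nonneg_right hlτ (by positivity)
    have h2 : τ * (2 * Δ + |C| * (s + 2)) ≤ τ * A := by
      refine mul_le_mul_of_nonneg_left ?_ hτpos.le
      rw [hA]; linarith
    linarith [hτA]
  have hρ1 : ρ ≤ 1 := hρle.trans (min_le_left _ _)
  have hρε : ρ ≤ ε / 2 := hρle.trans (min_le_right _ _)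
  have hρexp : ρ = 2 * l * Δ + |C| * (s + 2) * l := by rw [hρ]; ring
  -- |C (T l) l| ≤ |C| (s+2) l
  have hC1 : C * ((T : ℝ) * l) * l ≤ |C| * (s + 2) * l := by
    refine mul_le_mul_of_nonneg_right ?_ hlpos.le
    calc C * ((T : ℝ) * l) ≤ |C| * ((T : ℝ) * l) := mul_le_mul_of_nonneg_right (le_abs_self C) hu0
      _ ≤ |C| * (s + 2) := mul_le_mul_of_nonneg_left (by linarith) (abs_nonneg C)
  have hC2 : -(|C| * (s + 2) * l) ≤ C * ((T : ℝ) * l) * l := by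
    have h3 : -(|C| * ((T : ℝ) * l)) ≤ C * ((T : ℝ) * l) := by
      have h5 := mul_le_mul_of_nonneg_right (neg_abs_le C) hu0
      linarith [h5, neg_mul (|C|) ((T : ℝ) * l)]
    have h4 : |C| * ((T : ℝ) * l) ≤ |C| * (s + 2) := mul_le_mul_of_nonneg_left (by linarith) (abs_nonneg C)
    have h6 := mul_le_mul_of_nonneg_right h3 hlpos.le
    have h7 := mul_le_mul_of_nonneg_right h4 hlpos.le
    rw [neg_mul] at h6
    linarith
  have hD1 : s * Δ - 2 * l * Δ ≤ (T : ℝ) * l * Δ := by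
    have := mul_le_mul_of_nonneg_right hu2 hΔ; linarith
  have hD2 : (T : ℝ) * l * Δ ≤ s * Δ + 2 * l * Δ := by
    have := mul_le_mul_of_nonneg_right hu1 hΔ; linarith
  have key1 : (T : ℝ) * -(Δ * l - C * l ^ 2) ≤ -s * Δ + ρ := by
    have : (T : ℝ) * -(Δ * l - C * l ^ 2) = C * ((T : ℝ) * l) * l - (T : ℝ) * l * Δ := by ring
    rw [this, hρexp]; linarith
  have key2 : -s * Δ - ρ ≤ (T : ℝ) * -(Δ * l + C * l ^ 2) := by
    have : (T : ℝ) * -(Δ * l + C * l ^ 2) = -(C * ((T : ℝ) * l) * l) - (T : ℝ) * l * Δ := by ring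
    rw [this, hρexp]; linarith
  have hxT_up : x ^ T ≤ Real.exp (-s * Δ + ρ) := hTup.trans (Real.exp_le_exp.2 key1)
  have hxT_low : Real.exp (-s * Δ - ρ) ≤ x ^ T := (Real.exp_le_exp.2 key2).trans hTlow
  have hE : Real.exp (-s * Δ) ≤ 1 := by
    rw [Real.exp_le_one_iff]
    have : 0 ≤ s * Δ := mul_nonneg hs.le hΔ
    linarith
  have hEpos : 0 < Real.exp (-s * Δ) := Real.exp_pos _
  have hEρ : Real.exp (-s * Δ) * ρ ≤ ρ := mul_le_of_le_one_left hρ0 hE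
  rw [abs_le]
  constructor
  · have h1 : Real.exp (-s * Δ - ρ) = Real.exp (-s * Δ) * Real.exp (-ρ) := by
      rw [sub_eq_add_neg, Real.exp_add]
    have h2 : 1 - ρ ≤ Real.exp (-ρ) := by have := Real.add_one_le_exp (-ρ); linarith
    have h3 : Real.exp (-s * Δ) * (1 - ρ) ≤ x ^ T := by
      calc Real.exp (-s * Δ) * (1 - ρ) ≤ Real.exp (-s * Δ) * Real.exp (-ρ) :=
            mul_le_mul_of_nonneg_left h2 hEpos.le
        _ = Real.exp (-s * Δ - ρ) := h1.symm
        _ ≤ x ^ T := hxT_low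
    have h4 : Real.exp (-s * Δ) * (1 - ρ) = Real.exp (-s * Δ) - Real.exp (-s * Δ) * ρ := by ring
    linarith
  · have h1 : Real.exp (-s * Δ + ρ) = Real.exp (-s * Δ) * Real.exp ρ := Real.exp_add _ _
    have h2 : Real.exp ρ ≤ 1 + 2 * ρ := by
      have hh := Real.abs_exp_sub_one_le (x := ρ) (by rw [abs_of_nonneg hρ0]; exact hρ1)
      rw [abs_of_nonneg hρ0] at hh
      have := (abs_le.1 hh).2; linarith
    have h3 : x ^ T ≤ Real.exp (-s * Δ) * (1 + 2 * ρ) :=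
      hxT_up.trans (by rw [h1]; exact mul_le_mul_of_nonneg_left h2 hEpos.le)
    have h4 : Real.exp (-s * Δ) * (1 + 2 * ρ) = Real.exp (-s * Δ) + 2 * (Real.exp (-s * Δ) * ρ) := by ring
    linarith

/-- **Uniform moment limit.**  `|m_B(T) − Σ_k e^{−sΔ_k}| ≤ ε` for `B ≥ B2(s, ε)` and every `T` with `|Tλ_b − s| ≤ 2λ_b` (the tolerance `2λ_b` covers both `T` and `2T`). -/
theorem moment_close (hONE : Summit.QuantumFields.YangMills.Theses.LuscherReduction.OneSiteLevels)
    (hLG : LevelGapSummable) (hTail : OneSiteTail) {s : ℝ} (hs : 0 < s) {ε : ℝ} (hε : 0 < ε) :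
    ∃ B2 : ℝ, ∀ B : ℝ, B2 ≤ B → ∀ T : ℕ, |(T : ℝ) * bareLambda B - s| ≤ 2 * bareLambda B →
      Summable (fun k : ℕ => (levelValue su2Rep 1 B k / levelValue su2Rep 1 B 0) ^ T) ∧
      |(∑' k : ℕ, (levelValue su2Rep 1 B k / levelValue su2Rep 1 B 0) ^ T) - ∑' k : ℕ, Real.exp (-s * levelGap k)| ≤ ε := by
  have hε4 : 0 < ε / 4 := by positivity
  have hM : Summable (fun k => Real.exp (-s * levelGap k)) := hLG s hs
  have hMtail : ∀ᶠ i : ℕ in atTop, ∑' k, Real.exp (-s * levelGap (k + i)) < ε / 4 :=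
    (tendsto_sum_nat_add (fun k => Real.exp (-s * levelGap k))).eventually (eventually_lt_nhds hε4)
  obtain ⟨N, hN⟩ := Filter.eventually_atTop.1 hMtail
  obtain ⟨K1, B1, hT1⟩ := hTail s hs (ε / 4) hε4
  set K : ℕ := K1 + N with hK
  have hε' : 0 < ε / (4 * ((K : ℝ) + 1)) := by positivity
  choose Bk hBk using fun k => term_close hONE k hs hε'
  set B3 : ℝ := ∑ k ∈ Finset.range K, max (Bk k) 0 with hB3
  have hs8 : 0 < s / 8 := by positivity
  refine ⟨max (max B1 B3) (max 1 (2 / (s / 8) ^ 3)), fun B hB T hT => ?_⟩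
  have hB1 : B1 ≤ B := le_trans ((le_max_left _ _).trans (le_max_left _ _)) hB
  have hB3' : B3 ≤ B := le_trans ((le_max_right _ _).trans (le_max_left _ _)) hB
  have hBone : 1 ≤ B := le_trans ((le_max_left _ _).trans (le_max_right _ _)) hB
  have hBs : 2 / (s / 8) ^ 3 ≤ B := le_trans ((le_max_right _ _).trans (le_max_right _ _)) hB
  have hl : bareLambda B ≤ s / 8 := bareLambda_le_of_le hs8 hBs
  have hlpos : 0 < bareLambda B := bareLambda_pos' (by linarith)
  have hwin : s ≤ 2 * ((T : ℝ) * bareLambda B) := by have := (abs_le.1 hT).1; linarith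
  obtain ⟨hsum, htail⟩ := hT1 B hB1 T hwin
  refine ⟨hsum, ?_⟩
  set f : ℕ → ℝ := fun k => (levelValue su2Rep 1 B k / levelValue su2Rep 1 B 0) ^ T with hf
  set g : ℕ → ℝ := fun k => Real.exp (-s * levelGap k) with hg
  have hB0' : (0 : ℝ) ≤ B := by linarith
  have hf0 : ∀ k, 0 ≤ f k := fun k =>
    pow_nonneg (div_nonneg (levelValue_su2Rep_nonneg 1 hB0' k) (levelValue_su2Rep_nonneg 1 hB0' 0)) T
  have hg0 : ∀ k, 0 ≤ g k := fun k => (Real.exp_pos _).le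
  have hfdec := hsum.sum_add_tsum_nat_add K
  have hgdec := hM.sum_add_tsum_nat_add K
  have hftail : ∑' i, f (i + K) ≤ ε / 4 := (tsum_shift_le hsum hf0 K1 N).trans htail
  have hgtail : ∑' i, g (i + K) < ε / 4 := hN K (by omega)
  have hftail0 : 0 ≤ ∑' i, f (i + K) := tsum_nonneg fun i => hf0 _
  have hgtail0 : 0 ≤ ∑' i, g (i + K) := tsum_nonneg fun i => hg0 _
  have hfin : ∑ k ∈ Finset.range K, |f k - g k| ≤ ∑ k ∈ Finset.range K, ε / (4 * ((K : ℝ) + 1)) := by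
    refine Finset.sum_le_sum fun k hk => ?_
    have hBk' : Bk k ≤ B := by
      have h1 : max (Bk k) 0 ≤ B3 :=
        Finset.single_le_sum (f := fun k => max (Bk k) 0) (fun i _ => le_max_right _ _) hk
      exact le_trans (le_max_left _ _) (h1.trans hB3')
    exact hBk k B hBk' T hT
  have hfin' : ∑ k ∈ Finset.range K, |f k - g k| ≤ ε / 4 := by
    refine hfin.trans ?_
    rw [Finset.sum_const, Finset.card_range, nsmul_eq_mul]
    have hK1 : (0 : ℝ) < (K : ℝ) + 1 := by positivity
    rw [show (K : ℝ) * (ε / (4 * ((K : ℝ) + 1))) = ε / 4 * ((K : ℝ) / ((K : ℝ) + 1)) by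
      field_simp]
    have : (K : ℝ) / ((K : ℝ) + 1) ≤ 1 := by rw [div_le_one hK1]; linarith
    calc ε / 4 * ((K : ℝ) / ((K : ℝ) + 1)) ≤ ε / 4 * 1 := mul_le_mul_of_nonneg_left this hε4.le
      _ = ε / 4 := mul_one _
  have hfinabs : |∑ k ∈ Finset.range K, f k - ∑ k ∈ Finset.range K, g k| ≤ ε / 4 := by
    rw [← Finset.sum_sub_distrib]; exact (Finset.abs_sum_le_sum_abs _ _).trans hfin'
  rw [← hfdec, ← hgdec]
  have hsplit : (∑ k ∈ Finset.range K, f k + ∑' i, f (i + K)) - (∑ k ∈ Finset.range K, g k + ∑' i, g (i + K)) =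
      (∑ k ∈ Finset.range K, f k - ∑ k ∈ Finset.range K, g k) + (∑' i, f (i + K) - ∑' i, g (i + K)) := by ring
  rw [hsplit]
  calc |(∑ k ∈ Finset.range K, f k - ∑ k ∈ Finset.range K, g k) + (∑' i, f (i + K) - ∑' i, g (i + K))|
      ≤ |∑ k ∈ Finset.range K, f k - ∑ k ∈ Finset.range K, g k| + |∑' i, f (i + K) - ∑' i, g (i + K)| := abs_add_le _ _
    _ ≤ ε / 4 + (ε / 4 + ε / 4) := add_le_add hfinabs (by rw [abs_le]; constructor <;> linarith)
    _ ≤ ε := by linarith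

/-- ★ **`OneSiteTraceLimit` from ONE + `LevelGapSummable` + `OneSiteTail`** (PROVED). -/
theorem oneSiteTraceLimit_of_ONE (hONE : Summit.QuantumFields.YangMills.Theses.LuscherReduction.OneSiteLevels)
    (hLG : LevelGapSummable) (hTail : OneSiteTail) : OneSiteTraceLimit := by
  intro s hs ε hε
  have hε3 : 0 < ε / 3 := by positivity
  have h2s : 0 < 2 * s := by positivity
  obtain ⟨B2, h2⟩ := moment_close hONE hLG hTail hs hε3
  obtain ⟨B2', h2'⟩ := moment_close hONE hLG hTail h2s hε3
  refine ⟨max (max B2 B2') 1, fun B hB T hT => ?_⟩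
  have hB2 : B2 ≤ B := le_trans ((le_max_left _ _).trans (le_max_left _ _)) hB
  have hB2' : B2' ≤ B := le_trans ((le_max_right _ _).trans (le_max_left _ _)) hB
  have hBone : 1 ≤ B := le_trans (le_max_right _ _) hB
  have hlpos : 0 < bareLambda B := bareLambda_pos' (by linarith)
  have hT1 : |(T : ℝ) * bareLambda B - s| ≤ 2 * bareLambda B := hT.trans (by linarith)
  have hT2 : |((2 * T : ℕ) : ℝ) * bareLambda B - 2 * s| ≤ 2 * bareLambda B := by
    push_cast
    rw [show (2 : ℝ) * (T : ℝ) * bareLambda B - 2 * s = 2 * ((T : ℝ) * bareLambda B - s) by ring, abs_mul,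
      abs_of_pos (by norm_num : (0 : ℝ) < 2)]
    linarith
  obtain ⟨hsum1, hm1⟩ := h2 B hB2 T hT1
  obtain ⟨hsum2, hm2⟩ := h2' B hB2' (2 * T) hT2
  have hB0' : (0 : ℝ) ≤ B := by linarith
  have hone : 1 ≤ ∑' k : ℕ, (levelValue su2Rep 1 B k / levelValue su2Rep 1 B 0) ^ T := by
    have h := hsum1.le_tsum 0 (fun j _ =>
      pow_nonneg (div_nonneg (levelValue_su2Rep_nonneg 1 hB0' j) (levelValue_su2Rep_nonneg 1 hB0' 0)) T)
    have h0 : (levelValue su2Rep 1 B 0 / levelValue su2Rep 1 B 0) ^ T = 1 := by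
      rw [div_self (Inv.levelValue_zero_pos 1 B).ne', one_pow]
    rw [h0] at h; exact h
  have hone' : 1 ≤ ∑' k : ℕ, Real.exp (-s * levelGap k) := by
    have h := (hLG s hs).le_tsum 0 (fun j _ => (Real.exp_pos _).le)
    rw [levelGap_zero, mul_zero, Real.exp_zero] at h; exact h
  have hA' : 0 ≤ ∑' k : ℕ, Real.exp (-(2 * s) * levelGap k) := tsum_nonneg fun k => (Real.exp_pos _).le
  have hA'B' : ∑' k : ℕ, Real.exp (-(2 * s) * levelGap k) ≤ ∑' k : ℕ, Real.exp (-s * levelGap k) := by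
    refine Summable.tsum_le_tsum (fun k => ?_) (hLG (2 * s) h2s) (hLG s hs)
    refine Real.exp_le_exp.2 ?_
    have : 0 ≤ s * levelGap k := mul_nonneg hs.le (Inv.levelGap_nonneg k)
    linarith
  show |(∑' k : ℕ, (levelValue su2Rep 1 B k / levelValue su2Rep 1 B 0) ^ (2 * T)) /
      (∑' k : ℕ, (levelValue su2Rep 1 B k / levelValue su2Rep 1 B 0) ^ T) ^ 2 -
      (∑' k : ℕ, Real.exp (-(2 * s) * levelGap k)) / (∑' k : ℕ, Real.exp (-s * levelGap k)) ^ 2| ≤ ε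
  refine (Inv.ratio_sub_ratio_le hone hone' hA' hA'B').trans ?_
  linarith [hm1, hm2]

end OST

/-! ### Rev-7 registered stub and compositions -/

/-- registered stub (M): B-uniform one-site tail bound `OneSiteTail`. [cite: Simon1983, Thm 1.1] [cite: Luscher1983, §1] -/
abbrev Stmt.stub_oneSiteTail : Prop := OneSiteTail

/-- stub (M): uniform tail of the one-site femto moments. [cite: Simon1983, Thm 1.1] -/
theorem stub_oneSiteTail : Stmt.stub_oneSiteTail := by
  sorry

/-- rev 7: the registered one-site stub `stub_oneSiteTraceLimit` from the route's crux ONE and the new tail stub (in-file `levelGapSummable_holds`). -/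
theorem stub_oneSiteTraceLimit_of_ONE (hONE : Summit.QuantumFields.YangMills.Theses.LuscherReduction.OneSiteLevels)
    (hTail : Stmt.stub_oneSiteTail) : Stmt.stub_oneSiteTraceLimit :=
  OST.oneSiteTraceLimit_of_ONE hONE levelGapSummable_holds hTail

/-- ★ rev 8 (ONE closed): the registered one-site stub `stub_oneSiteTraceLimit` REDUCES to the tail stub alone. -/
theorem stub_oneSiteTraceLimit : Stmt.stub_oneSiteTraceLimit :=
  stub_oneSiteTraceLimit_of_ONE Summit.QuantumFields.YangMills.Theorems.FemtoTransferGap.oneSiteLevels_proof stub_oneSiteTail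

/-- ★ **rev-7 composition («TT» door modulo the route's crux ONE)**: `stub_traceFormula → stub_twistedTraceScaling → stub_oneSiteTail → KT.stub_dressedRitz → OneSiteLevels →
RunningReduction`.  In-file: `LevelGapSummable` (rev 5), `TraceInversion` (rev 6), `OneSiteTraceLimit ⇐ ONE + tail` (rev 7), `oneSiteLowerCoarse ⇐ ONE` (rev 2). -/
theorem RunningReduction_of_trace7_ONE
    (hTF : Stmt.stub_traceFormula) (hTS : Stmt.stub_twistedTraceScaling) (hTail : Stmt.stub_oneSiteTail)
    (hDR : KT.Stmt.stub_dressedRitz) (hONE : Summit.QuantumFields.YangMills.Theses.LuscherReduction.OneSiteLevels) :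
    Summit.QuantumFields.YangMills.Theses.LuscherReduction.RunningReduction :=
  RunningReduction_of_trace6_ONE hTF hTS (stub_oneSiteTraceLimit_of_ONE hONE hTail) hDR hONE

/-- rev 7: the coarse two-sided Lüscher law for every level from TF, TTS, the tail stub and ONE. -/
theorem coarseLevels_of_stubs7_ONE (hTF : Stmt.stub_traceFormula) (hTS : Stmt.stub_twistedTraceScaling)
    (hTail : Stmt.stub_oneSiteTail) (hONE : Summit.QuantumFields.YangMills.Theses.LuscherReduction.OneSiteLevels) : CoarseLevels :=
  coarseLevels_of_stubs6 hTF hTS (stub_oneSiteTraceLimit_of_ONE hONE hTail)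

/-- ★★ **rev-8 composition = THE TT DOOR, unconditional in ONE**: `stub_traceFormula → stub_twistedTraceScaling → stub_oneSiteTail → KT.stub_dressedRitz → RunningReduction`
(ONE closed 2026-08-27T07:09Z; `LevelGapSummable`, `TraceInversion`, `OneSiteTraceLimit ⇐ tail`, `oneSiteLowerCoarse` all discharged in-file / from the tree).
This is the glue `TraceFormula → TwistedTraceScaling → OneSiteTail → DressedRitz → RunningReduction` of the owner's route-level split of RED (g19). -/
theorem RunningReduction_of_trace8
    (hTF : Stmt.stub_traceFormula) (hTS : Stmt.stub_twistedTraceScaling) (hTail : Stmt.stub_oneSiteTail) (hDR : KT.Stmt.stub_dressedRitz) :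
    Summit.QuantumFields.YangMills.Theses.LuscherReduction.RunningReduction :=
  RunningReduction_of_trace7_ONE hTF hTS hTail hDR Summit.QuantumFields.YangMills.Theorems.FemtoTransferGap.oneSiteLevels_proof

/-- rev 8: the coarse two-sided Lüscher law for every level from TF, TTS and the tail stub (ONE closed). -/
theorem coarseLevels_of_stubs8 (hTF : Stmt.stub_traceFormula) (hTS : Stmt.stub_twistedTraceScaling) (hTail : Stmt.stub_oneSiteTail) : CoarseLevels :=
  coarseLevels_of_stubs7_ONE hTF hTS hTail Summit.QuantumFields.YangMills.Theorems.FemtoTransferGap.oneSiteLevels_proof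

end Summit.QuantumFields.YangMills.Cruxes.RunningReduction.TT

end
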